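import Mathlib.MeasureTheory.Integral.DominatedConvergence
import Mathlib.MeasureTheory.Integral.Prod
import Mathlib.MeasureTheory.Constructions.Pi
import Mathlib.MeasureTheory.Integral.Pi
import Mathlib.Analysis.SpecialFunctions.Gaussian.FourierTransform
import Literature.MathematicalPhysics.KineticTheory.HardBallErgodicity
import Literature.MathematicalPhysics.KineticTheory.TaggedSphereDiffusion
import Literature.Analysis.FluidPDE.HardSphereDynamicsProofs
import Literature.Analysis.FluidPDE.BoltzmannEquationProofs
import HarnessLib

/-!
# A tagged sphere in a hard-sphere gas at equilibrium: the linear Boltzmann limit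
(Bodineau–Gallagher–Saint-Raymond, Invent. Math. 203 (2016) = arXiv:1305.3397v2), fact (c)

The named fact `Literature.MathematicalPhysics.KineticTheory.bodineau_gallagher_saintRaymond_linear`
(`Literature/MathematicalPhysics/KineticTheory/ShortRangePotentials.lean`, item (c)) renders the
Boltzmann–Grad limit of a tagged sphere in a gas at equilibrium on `T^d`: along
`(N_k + 1) ε_k^{d-1} = 1` the one-time law of the tagged sphere converges weakly to
`g(t, x, v) dx dv`, `g` a global mild solution of the linear Boltzmann equation with
`g(0) = ρ⁰ ⊗ M_β`. Its proof in print is BGSR's Theorem 2.2, a Lanford-type derivation valid for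
all times (BBGKY and Boltzmann hierarchies, pruning of super-exponential collision trees,
geometric control of recollisions; §§3–5). This file is the bottom-up proof plan of the fact:
it PROVES every ingredient that is measure theory or an exact identity of the equilibrium
measure, and reduces the statement, at every inverse mean free path `α`, to the one printed input
that is a genuine derivation theorem, BGSR's Theorem 2.2 at `α` in sequence form (the statement
predicate `BgsrTheorem22At α`, or its a.e.-pointwise shadow `BgsrAeConvergenceAt α`); this
yields the corrected statement "(c) for every `α > 1`" (`∀ α > 1, LinearBoltzmannLimitAt α`,
the conclusion of the proved reduction `bodineau_gallagher_saintRaymond_linear_alpha_of`)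
CONDITIONALLY on that input, while (c) itself (`α = 1`, outside BGSR's printed hypothesis)
reduces in the same way to `BgsrTheorem22At 1` — see "Discrepancy" below. No named fact remains
in this file (see "No named fact remains" below): BGSR's Theorem 2.2 is vendored once in the
tree, as `bgsr_linearBoltzmannApprox` (`TaggedSphereDiffusion`).
The sibling file `TaggedSphereDiffusion` (fact (d))
provides the objects: BGSR's datum `bgsrInitialDensity` (2.8), the tagged distribution
`bgsrTaggedMarginal` (`f_N^{(1)}`, §3) and the solution class `IsTaggedLinearBoltzmannSolution`
of the linear Boltzmann equation (1.3).

## What is proved here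

* `Kinetic.map_eval_zero_withDensity_pi` — the push-forward of `F dZ` on `Y^{n+1}` under
  `Z ↦ z₀` is `(∫ F(z₀, Z') dZ') dz₀` (Fubini on `Y^{n+1} ≃ Y × Y^n`), and
  `Kinetic.taggedLaw_ofReal_eq_withDensity_integral` — **the law of the tagged sphere has density
  the first marginal of the transported density**: `Kinetic.taggedLaw Φ (f₀ dZ) t =
  (∫ 1_good f₀(Φ_{-t}(z₀, Z')) dZ') dz₀` (mild Liouville equation
  `HardSphereFlow.lawAt_withDensity_holds` + conullness of the good set + Fubini); for BGSR's datum,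
  `Hilbert6.taggedLaw_eq_withDensity_bgsrTaggedMarginal`: the tagged law is `f_N^{(1)}(t) dx dv`
  (BGSR (2.10), §3 "`f_N^{(1)}` is exactly the distribution of the tagged particle").
* `Kinetic.canonicalDensity_maxwellianBeta_flow` — **the Gibbs measure is stationary**: the
  density `M_{N,β} = 𝒵⁻¹ 1_{D_ε} M_β^{⊗N}` is invariant along the flow on its good set
  (conservation of energy, `IsHardSphereTrajectory.configEnergy_eq_holds`).
* `Hilbert6.integral_indicator_tensorPow_cons` — by translation invariance of `T^d` and Fubini,
  `∫ 1_{D_ε} M_β^{⊗(N+1)}((x, v), Z') dZ' = M_β(v) 𝒵_{N+1}` for *every* `(x, v)`; hence the tagged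
  marginal of the Gibbs measure is exactly `M_β` (`integral_canonicalDensity_cons`; this is why
  BGSR's datum is normalised, p. 7 after (2.8)).
* `Hilbert6.bgsrTaggedMarginal_le` — **BGSR Prop. 4.1 for `s = 1`, exact on the torus**:
  `f_N^{(1)}(t, x, v) ≤ ‖ρ⁰‖_∞ M_β(v)` for every `t` and every `(x, v)` (maximum principle for
  the Liouville equation against the stationary Gibbs measure, then integration).
* `Hilbert6.bgsrTaggedMarginal_zero_ae_eq` — **BGSR Prop. 3.3 for `s = 1`, exact on the torus**:
  if `𝒵 > 0` then `f_N^{(1)}(0) = ρ⁰ ⊗ M_β` a.e.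
* `Hilbert6.equilibriumTaggedPartition_eventually_pos` — **BGSR Appendix A (A.1)**:
  `𝒵_{n+1} ≥ (1 - n (2ε)^d) 𝒵_n` (Fubini and a union bound on `T^d`, with `(2ε)^d` for the
  printed `κ_d ε^d`), hence `𝒵_{N_k+1} > 0` eventually along a Boltzmann–Grad sequence.
* `Hilbert6.nthMarginal_canonicalDensity_le_two_pow`, `Hilbert6.nthMarginal_hsTransport_le`,
  `Hilbert6.nthMarginal_hsTransport_le_two_pow` — **BGSR Prop. 3.2 (upper half) and Prop. 4.1 for
  every `s`**, hence the a priori bound (4.3) in raw form: in the regime `N (2ε)^d ≤ 1/2`,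
  `f_N^{(s)}(t, Z_s) ≤ ‖ρ⁰‖_∞ 2^s M_β^{⊗s}(V_s)` for all `s ≤ N + 1`, `t`, `Z_s`.
* `Hilbert6.abs_nthMarginal_canonicalDensity_sub_le`, `Hilbert6.nthMarginal_bgsrInitialDensity_eq`,
  `Hilbert6.abs_nthMarginal_bgsrInitialDensity_sub_le` — **BGSR Prop. 3.2 (two-sided) and Prop. 3.3
  for every `s`**, with explicit constants, from the second step of Appendix A
  (`integral_indicator_near_le`: the excluded-volume integral is `≤ (2ε)^d 𝒵_m`;
  `marginal_indicator_tensorPow_ge`): in the regime `(n-1)(2ε)^d ≤ 1/2`,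
  `|M^{(s)}_{n,β} - M_β^{⊗s}| 1_{D^s} ≤ (s+1) 2^{s+1} n (2ε)^d M_β^{⊗s}` and
  `f_N^{0(s)} = ρ⁰(x₁) M^{(s)}_{N,β}` exactly.
* `Hilbert6.tendsto_integral_mul_of_maxwellian_dominated` — dominated convergence with a
  Maxwellian majorant, and the assemblies `Hilbert6.linearBoltzmannLimitAt_of`
  (Thm 2.2 at `α` ⟹ the weak-convergence statement at `α`) and `…_linear_alpha_of`.
* `Hilbert6.tendsto_integral_mul_of_maxwellian_dominated_ae`,
  `Hilbert6.bgsrAeConvergenceAt_of_theorem22At`, `Hilbert6.linearBoltzmannLimitAt_of_ae`,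
  `…_linear_alpha_of_ae` (section AeAssembly) — the same assembly from the weaker, a.e.-pointwise
  form `BgsrAeConvergenceAt α` of Thm 2.2 at `α`, which is all that weak convergence consumes.
* Corollaries: discharges of the named facts `Kinetic.equilibriumTaggedPartition_le_one`,
  `Kinetic.equilibriumTaggedPartition_pos` and `Kinetic.lintegral_equilibriumTaggedDensity` of
  `Literature.Analysis.FunctionSpaces.LorentzGas` (`…_holds`, at the end of the file).

## No named fact remains in this file: the two merges of 2026-08-15 (D-0026)

* This file states and proves; it ASSERTS nothing. The printed derivation theorem it rests on,
  BGSR Thm 2.2, is vendored ONCE in the tree, as the named fact `bgsr_linearBoltzmannApprox`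
  of the sibling file `TaggedSphereDiffusion` (the uniform form with the rate (2.9), `t > 1`,
  `α > 1`, which fact (d) consumes); fact (c) itself (`α = 1`) is the named fact
  `bodineau_gallagher_saintRaymond_linear` of `ShortRangePotentials` (cite: Fougères 2024
  Thm 3.1, see "Discrepancy"). Here BGSR Thm 2.2 at inverse mean free path `α` is the statement
  predicate `BgsrTheorem22At α` (sequence form without rate; docstring = Thm 2.2 as printed: a
  solution `φ_α` of (1.3) in the class `IsTaggedLinearBoltzmannSolution β α ρ⁰` with
  `|f_{N_k}^{(1)}(t) - M_β φ_α(t)| ≤ δ` a.e., eventually in `k`, for all `t > 0`, `δ > 0`) with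
  its a.e.-pointwise shadow `BgsrAeConvergenceAt α`, and (c) at `α` is the predicate
  `LinearBoltzmannLimitAt α`; the corrected statement "(c) for every `α > 1`" is the CONCLUSION
  of the proved reductions
  `bodineau_gallagher_saintRaymond_linear_alpha_of : (∀ α > 1, BgsrTheorem22At α) → ∀ α > 1, LinearBoltzmannLimitAt α`
  and `…_alpha_of_ae : (∀ α > 1, BgsrAeConvergenceAt α) → ∀ α > 1, LinearBoltzmannLimitAt α`,
  everything but the hypothesis being proved here. (Statement predicates parametrised by `α` —
  `BgsrTheorem22At`, `LinearBoltzmannLimitAt`, `BgsrAeConvergenceAt` — are UpperCamelCase and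
  asserted nowhere.)
* History of the merges. Earlier revisions carried two closed named facts here, both citing
  Thm 2.2: `bgsr_theorem22 := ∀ α > 1, BgsrTheorem22At α` and
  `bodineau_gallagher_saintRaymond_linear_alpha := ∀ α > 1, LinearBoltzmannLimitAt α`, the
  latter proved from the former by `linearBoltzmannLimitAt_of`. Both were triaged XL by their
  prove-seats (each IS the Lanford-type derivation theorem) and reviewed as decomposition
  children (D-0026: a child must be a distinct published result with its own locator, M-sized,
  neither a slice of the parent's proof nor the parent reworded). First review:
  `bgsr_theorem22` was the missing step of this file's own reduction dressed as a second fact,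
  and was MERGED into the obligation of `…_linear_alpha` (the `def` deleted, its statement kept
  verbatim as the predicate `BgsrTheorem22At` and as the hypothesis of `…_alpha_of`). Second
  review: `…_linear_alpha` in turn is the parent (c) reworded at the printed range `α > 1`,
  carries the very locator of `bgsr_linearBoltzmannApprox` (Thm 2.2 (2.9)), had no user in the
  tree, and its proof obligation — BGSR §§3–5 — is the one already carried by
  `bgsr_linearBoltzmannApprox` (and, at `α = 1`, by (c)): a second XL seat on one printed
  theorem. It was MERGED as well: the `def` is deleted and its statement is the explicit
  conclusion of `…_alpha_of` / `…_alpha_of_ae`. No statement changed meaning in either merge;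
  what was asserted twice is now asserted once (`bgsr_linearBoltzmannApprox`).
* What `bgsr_linearBoltzmannApprox` gives here, and what it does not. For `α > 1` and `t > 1`,
  the conclusion of `BgsrTheorem22At α` at such `t` follows from it along exact sequences
  (`N_k → ∞`, the rate tends to `0`, an `L^∞` bound is an a.e. bound) once "the solution `φ_α`"
  is fixed independently of `k` by uniqueness in the class
  (`IsTaggedLinearBoltzmannSolution.unique`, with existence
  `exists_isTaggedLinearBoltzmannSolution`, both in `TaggedLinearBoltzmannSeries`, downstream of
  this file — that bridge belongs there); `t = 0` is exact here (Prop. 3.3). The printed range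
  `t ∈ (0, 1]` of Thm 2.2 ("for all `t > 0`") is NOT covered by `bgsr_linearBoltzmannApprox` as
  vendored (fixed-time `L^∞(T^d × ℝ^d)` bounds for `t > 1`, the range of Prop. 4.3 and (5.1)).
  In print it is covered because §5 works throughout in `L^∞([0, t] × T^d × ℝ^d)` — (5.21),
  Props. 5.4–5.8 and the proof of Thm 2.2 (arXiv pp. 25–30) bound
  `‖f_N^{(1)} - g_α‖_{L^∞([0,t] × T^d × ℝ^d)}` for `t > 1`, i.e. uniformly over earlier times —
  and, alternatively, by the exact velocity–time scaling `(β, t, v) ↦ (β c⁻², t c⁻¹, c v)` of the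
  hard-sphere dynamics, of the datum (2.8) and of (1.3), all statements being quantified over
  every `β > 0` (a rescaling of `HardSphereFlow`s not developed in the tree). After the merges
  that range is stated here (docstring and body of `BgsrTheorem22At`) and asserted by no named
  fact; a re-vendoring of `bgsr_linearBoltzmannApprox` in the printed `L^∞([0, t] × T^d × ℝ^d)`
  form would make "(c) for every `α > 1`" its corollary outright.
* How the obligation is met, bottom-up and without further named facts (D-0026):
  `TaggedLinearBoltzmannSeries` proves the well-posedness of (1.3) in the class
  `IsTaggedLinearBoltzmannSolution` (existence by the collision series, maximum principle,
  uniqueness) and `bgsrTheorem22At_of_series : BgsrSeriesConvergenceAt α → BgsrTheorem22At α`;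
  the Boltzmann-side pruning and truncations (Prop. 4.3, Props. 5.4–5.5) are
  `HierarchyPruningEstimates`, `HierarchyEnergyTruncation`, `HierarchyTimeSeparation(Blocks)`,
  `TaggedBoltzmannPruning`, `TaggedBoltzmannTruncation`; the BBGKY side is reduced in
  `HardSphereHierarchyModel` (`bgsrMarginal_ae_abs_sub_truncSepMain_le`) to the iterated Duhamel
  formula for the hard-sphere marginals (Spohn 2006, GSRT 2013 Ch. 4) and to BGSR §5 (Props.
  5.1–5.3 and 5.6–5.8: geometric control of recollisions and the term-by-term comparison of the
  pruned expansions; `RecollisionGeometry`, `HardSphereFreeStretch`). Completed at `α > 1` it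
  proves `∀ α > 1, LinearBoltzmannLimitAt α` outright (and discharges
  `bgsr_linearBoltzmannApprox` if the rate is tracked); completed at `α = 1` it discharges (c).

## Discrepancy with the printed theorem: fact (c) is reduced, not derived (gap recorded)

BGSR Thm 2.2 is printed "for all `t > 0` and all `α > 1`" (p. 7). Fact (c) fixes
`α = (N_k + 1) ε_k^{d-1} = 1`, the boundary value the printed hypothesis excludes (and asks all
`t ≥ 0`; `t = 0` is Prop. 3.3, exact on the torus and proved here). When this file was written no
held source printed the `α = 1`, all-times statement on the torus: BGSR only remark (p. 7) that
"in [7, 30]"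
(van Beijeren–Lanford–Lebowitz–Spohn 1980, Lebowitz–Spohn 1982) "the linear Boltzmann equation
was derived for any time `t > 0` (independent of `N`)", and a reading of BGSR's proof (where `α`
enters only through `αε ≪ 1`, (4.13), (4.15) and `αt ≥ 1` in the proof of Prop. 4.3, and the bound
is obtained in `L^∞([0, t] × T^d × ℝ^d)`, Prop. 5.8) is not a printed statement. Accordingly NO
bridging fact at `α = 1` is vendored here. What this file provides instead is (i) the corrected
statement with the printed hypothesis, `∀ α > 1, LinearBoltzmannLimitAt α` ((c) at every
`α > 1`), REDUCED to the printed theorem as the conclusion of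
`bodineau_gallagher_saintRaymond_linear_alpha_of`, and (ii) the complete reduction at every `α` (`linearBoltzmannLimitAt_of`) together with
`bodineau_gallagher_saintRaymond_linear_of_limitAt_one : (c at 1) → (c)`, so that a printed
source for the `α = 1` case closes (c) in two lines from `BgsrTheorem22At 1`. Such a source has
since been identified and is now the cite of (c) in `ShortRangePotentials` (review of
2026-08-15): F. Fougères, J. Stat. Phys. 191 (2024) = arXiv:2404.03266, Thm 3.1, written in
BGSR's framework at "constant mean free path `N⁻¹ ε^{1-d} = 1`" (§2.2, datum (7) = (2.8)), prints
`‖f_N^{(1)} - g‖_{L^∞([0,t] × T^d × ℝ^d)} ≤ ‖ρ‖ exp(-c_β |log ε|^{1-a})` for `ε` small and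
`t ≲ (log|c_β log ε|)^{1/2-a}`, `a ∈ (0, 1/2)`, `g = M_β φ`; along an exact sequence this yields
`BgsrTheorem22At 1` (uniqueness in the class identifies Fougères' `φ`), which is NOT proved in
the tree either — (c) stays a named fact of `ShortRangePotentials`, of the same size XL.

## Design choices

* `f_N^{(1)}` is the sibling file's `bgsrTaggedMarginal` (first marginal of the density
  transported on the good set); the tagged law of fact (c) (`Kinetic.taggedLaw`, a push-forward
  measure) is identified with `f_N^{(1)} dx dv` by a theorem, not by definition.
* All estimates are pointwise/a.e. statements "eventually along the sequence" (`∀ᶠ k in atTop`),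
  which is how the paper's provisos "as `N → ∞` in the scaling `N ε^{d-1} = α ≪ 1/ε`" read along
  an exact Boltzmann–Grad sequence. The paper's `N` is the total number of spheres, `N k + 1`
  here (tagged sphere `0` plus `N k` background spheres).
* `Kinetic.translateAll` (diagonal translations, from `HardBallErgodicity`) is reused for the
  translation invariance; `Kinetic.translateAllEquiv` packages it as a measurable equivalence
  (these generic torus lemmas are placed in the `Kinetic` namespace).
* σ-finiteness of `dx dv` on `T^d × ℝ^d` is registered as a *local* instance
  (`sigmaFinite_volume_phaseSpace`): instance search finds it, but not under the binder
  `∀ i : Fin n` required by the product-measure lemmas on configurations.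
* Everything is sorry-free; Bochner integrals have junk value `0`.

## References

* T. Bodineau, I. Gallagher, L. Saint-Raymond, *The Brownian motion as the limit of a
  deterministic system of hard-spheres*, Invent. Math. 203 (2016) 493–553; arXiv:1305.3397v2:
  (1.3), (2.5)–(2.10), Thm 2.2, §3, Props. 3.2–3.3, Prop. 4.1, Prop. 4.3 with (4.13)–(4.15),
  Prop. 5.8, Appendix A (A.1).
* H. van Beijeren, O. E. Lanford III, J. L. Lebowitz, H. Spohn, *Equilibrium time correlation
  functions in the low-density limit*, J. Stat. Phys. 22 (1980) 237–257.
* J. L. Lebowitz, H. Spohn, *Steady state self-diffusion at low density*, J. Stat. Phys. 29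
  (1982) 39–55.
* I. Gallagher, L. Saint-Raymond, B. Texier, *From Newton to Boltzmann* (2013), (4.3.2),
  Prop. 4.1.1.
-/

open MeasureTheory Metric Set Filter Topology
open scoped ENNReal InnerProductSpace

namespace Literature.MathematicalPhysics.KineticTheory

noncomputable section

section Kinetic



/-! ## Marginal of a density under the first coordinate projection -/

section MarginalDensity

variable {Y : Type*} [MeasureSpace Y] [SigmaFinite (volume : Measure Y)] {n : ℕ}

omit [SigmaFinite (volume : Measure Y)] in
/-- The coordinate split `(Fin (n+1) → Y) ≃ᵐ Y × (Fin n → Y)` at the coordinate `0`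
(`MeasurableEquiv.piFinSuccAbove`) has inverse `Fin.cons`. [folklore] -/
theorem piFinSuccAbove_zero_symm_apply (p : Y × (Fin n → Y)) :
    (MeasurableEquiv.piFinSuccAbove (fun _ : Fin (n + 1) => Y) 0).symm p = Fin.cons p.1 p.2 := by
  simp [MeasurableEquiv.piFinSuccAbove_symm_apply, Fin.insertNthEquiv, Fin.insertNth_zero']

/-- **Density of the first-coordinate marginal.** For a measurable `F ≥ 0` on `Y^{n+1}`, the
push-forward of `F dZ` under `Z ↦ z₀` is `(∫ F(z₀, Z') dZ') dz₀` (Fubini on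
`Y^{n+1} ≃ Y × Y^n`). This is the measure-theoretic content of "the first marginal
`f_N^{(1)} = ∫ f_N dz₂ ⋯ dz_N` is the distribution of the tagged particle" (BGSR (4.1), GST 2013
(4.3.2)). [folklore] -/
theorem map_eval_zero_withDensity_pi {F : (Fin (n + 1) → Y) → ℝ≥0∞} (hF : Measurable F) :
    ((volume : Measure (Fin (n + 1) → Y)).withDensity F).map (fun z => z 0) =
      volume.withDensity fun y => ∫⁻ zm : Fin n → Y, F (Fin.cons y zm) := by
  set e := MeasurableEquiv.piFinSuccAbove (fun _ : Fin (n + 1) => Y) 0 with he_def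
  have he : MeasurePreserving e volume volume := volume_preserving_piFinSuccAbove _ 0
  have hes : MeasurePreserving e.symm volume volume := he.symm e
  ext s hs
  rw [Measure.map_apply (measurable_pi_apply 0) hs,
    withDensity_apply _ (measurable_pi_apply 0 hs), withDensity_apply _ hs,
    ← lintegral_indicator (measurable_pi_apply 0 hs), ← lintegral_indicator hs,
    ← hes.lintegral_comp_emb e.symm.measurableEmbedding]
  change ∫⁻ p, ((fun z : Fin (n + 1) → Y => z 0) ⁻¹' s).indicator F (e.symm p)
      ∂(volume : Measure Y).prod (volume : Measure (Fin n → Y)) = _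
  rw [lintegral_prod _]
  · refine lintegral_congr fun y => ?_
    by_cases hy : y ∈ s
    · rw [indicator_of_mem hy]
      refine lintegral_congr fun zm => ?_
      rw [piFinSuccAbove_zero_symm_apply, indicator_of_mem]
      simpa using hy
    · rw [indicator_of_notMem hy]
      rw [← lintegral_zero (μ := (volume : Measure (Fin n → Y)))]
      refine lintegral_congr fun zm => ?_
      rw [piFinSuccAbove_zero_symm_apply, indicator_of_notMem]
      simpa using hy
  · exact ((hF.indicator (measurable_pi_apply 0 hs)).comp e.symm.measurable).aemeasurable

/-- For an integrable real `F ≥ 0` on `Y^{n+1}` the marginal density can be computed with the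
Bochner integral: `∫⁻ F(y, Z') dZ' = ofReal (∫ F(y, Z') dZ')` for a.e. `y` (the sections of an
integrable function are a.e. integrable). [folklore] -/
theorem lintegral_cons_eq_ofReal_integral_ae {F : (Fin (n + 1) → Y) → ℝ} (hF : Integrable F)
    (hF0 : ∀ z, 0 ≤ F z) :
    ∀ᵐ y : Y, ∫⁻ zm : Fin n → Y, ENNReal.ofReal (F (Fin.cons y zm)) =
      ENNReal.ofReal (∫ zm : Fin n → Y, F (Fin.cons y zm)) := by
  set e := MeasurableEquiv.piFinSuccAbove (fun _ : Fin (n + 1) => Y) 0 with he_def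
  have he : MeasurePreserving e volume volume := volume_preserving_piFinSuccAbove _ 0
  have hes : MeasurePreserving e.symm volume volume := he.symm e
  have hint : Integrable (F ∘ e.symm) ((volume : Measure Y).prod (volume : Measure (Fin n → Y))) :=
    (hes.integrable_comp_emb e.symm.measurableEmbedding).2 hF
  filter_upwards [hint.prod_right_ae] with y hy
  have hy' : Integrable (fun zm : Fin n → Y => F (Fin.cons y zm)) := by
    refine hy.congr (Eventually.of_forall fun zm => ?_)
    show F (e.symm (y, zm)) = F (Fin.cons y zm)
    rw [piFinSuccAbove_zero_symm_apply]
  rw [ofReal_integral_eq_lintegral_ofReal hy' (Eventually.of_forall fun zm => hF0 _)]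

end MarginalDensity


/-! ## The Maxwellian `M_β` -/

section Maxwellian

variable {d : Type*} [Fintype d]

/-- Closed form of the Maxwellian: `M_β(v) = (2π/β)^{-d/2} exp (-(β/2) |v|²)` (BGSR (2.5)).
[cite: BodineauGallagherSaintRaymondInvent2016, (2.5)] -/
theorem maxwellianBeta_eq (β : ℝ) (v : EuclideanSpace ℝ d) :
    Literature.Analysis.FunctionSpaces.maxwellianBeta β v = (2 * Real.pi * β⁻¹) ^ (-(Module.finrank ℝ (EuclideanSpace ℝ d) : ℝ) / 2) *
      Real.exp (-(β / 2) * ‖v‖ ^ 2) := by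
  simp only [Literature.Analysis.FunctionSpaces.maxwellianBeta, Literature.Analysis.FluidPDE.localMaxwellian, one_mul, sub_zero]
  congr 1
  congr 1
  field_simp

/-- The Maxwellian `M_β` is continuous. [folklore] -/
@[fun_prop]
theorem continuous_maxwellianBeta (β : ℝ) : Continuous (Literature.Analysis.FunctionSpaces.maxwellianBeta (d := d) β) := by
  have : Literature.Analysis.FunctionSpaces.maxwellianBeta (d := d) β = fun v =>
      (2 * Real.pi * β⁻¹) ^ (-(Module.finrank ℝ (EuclideanSpace ℝ d) : ℝ) / 2) *
        Real.exp (-(β / 2) * ‖v‖ ^ 2) := funext (maxwellianBeta_eq β)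
  rw [this]
  fun_prop

/-- The Maxwellian `M_β` is measurable. [folklore] -/
@[fun_prop]
theorem measurable_maxwellianBeta (β : ℝ) : Measurable (Literature.Analysis.FunctionSpaces.maxwellianBeta (d := d) β) :=
  (continuous_maxwellianBeta β).measurable

/-- The Maxwellian `M_β` is integrable on `ℝ^d` for `β > 0` (BGSR (2.5); from the Gaussian
integrability `Kinetic.integrable_exp_neg_mul_sq_norm` of `BoltzmannEquationProofs`). [folklore] -/
theorem integrable_maxwellianBeta {β : ℝ} (hβ : 0 < β) :
    Integrable (Literature.Analysis.FunctionSpaces.maxwellianBeta (d := d) β) := by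
  have h := (Literature.Analysis.FluidPDE.integrable_exp_neg_mul_sq_norm (E := EuclideanSpace ℝ d) (half_pos hβ)).const_mul
    ((2 * Real.pi * β⁻¹) ^ (-(Module.finrank ℝ (EuclideanSpace ℝ d) : ℝ) / 2))
  exact h.congr (Eventually.of_forall fun v => (maxwellianBeta_eq β v).symm)

/-- The Maxwellian has unit mass: `∫ M_β dv = 1` for `β > 0` (BGSR (2.5); Gaussian integral
`∫ e^{-b|v|²} dv = (π/b)^{d/2}` with `b = β/2`). [cite: BodineauGallagherSaintRaymondInvent2016, (2.5)] -/
theorem integral_maxwellianBeta {β : ℝ} (hβ : 0 < β) :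
    ∫ v, Literature.Analysis.FunctionSpaces.maxwellianBeta (d := d) β v = 1 := by
  simp_rw [maxwellianBeta_eq β]
  rw [integral_const_mul, GaussianFourier.integral_rexp_neg_mul_sq_norm (half_pos hβ),
    show Real.pi / (β / 2) = 2 * Real.pi * β⁻¹ by field_simp, neg_div, Real.rpow_neg (by positivity),
    inv_mul_cancel₀ (Real.rpow_pos_of_pos (by positivity) _).ne']

/-- The Maxwellian is bounded by its value at the origin: `M_β(v) ≤ (2π/β)^{-d/2}` for `β > 0`.
[folklore] -/
theorem maxwellianBeta_le {β : ℝ} (hβ : 0 < β) (v : EuclideanSpace ℝ d) :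
    Literature.Analysis.FunctionSpaces.maxwellianBeta β v ≤
      (2 * Real.pi * β⁻¹) ^ (-(Module.finrank ℝ (EuclideanSpace ℝ d) : ℝ) / 2) := by
  rw [maxwellianBeta_eq]
  have hc : 0 < (2 * Real.pi * β⁻¹) ^ (-(Module.finrank ℝ (EuclideanSpace ℝ d) : ℝ) / 2) :=
    Real.rpow_pos_of_pos (by positivity) _
  refine (mul_le_mul_of_nonneg_left ?_ hc.le).trans_eq (mul_one _)
  rw [Real.exp_le_one_iff]
  nlinarith [sq_nonneg ‖v‖]

/-- The tensor power of the Maxwellian is a function of the kinetic energy: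
`M_β^{⊗n}(Z) = ((2π/β)^{-d/2})^n exp (-β H_n(Z))`, `H_n(Z) = ½ ∑ |v_i|²` (BGSR (2.6)).
[cite: BodineauGallagherSaintRaymondInvent2016, (2.6)] -/
theorem tensorPow_maxwellianBeta {X : Type*} (β : ℝ) {n : ℕ} (z : Literature.Analysis.FluidPDE.Config n d X) :
    Literature.Analysis.FluidPDE.tensorPow n (fun p : X × EuclideanSpace ℝ d => Literature.Analysis.FunctionSpaces.maxwellianBeta β p.2) z =
      ((2 * Real.pi * β⁻¹) ^ (-(Module.finrank ℝ (EuclideanSpace ℝ d) : ℝ) / 2)) ^ n *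
        Real.exp (-β * Literature.Analysis.FluidPDE.configEnergy z) := by
  simp only [Literature.Analysis.FluidPDE.tensorPow, maxwellianBeta_eq]
  rw [Finset.prod_mul_distrib, Finset.prod_const, Finset.card_univ, Fintype.card_fin,
    ← Real.exp_sum]
  congr 2
  simp only [Literature.Analysis.FluidPDE.configEnergy, Finset.mul_sum]
  exact Finset.sum_congr rfl fun i _ => by ring

end Maxwellian

/-! ## Invariance of the Gibbs density along the flow -/

section Gibbs

variable {d : Type*} [Fintype d] {X : Type*} [MeasureSpace X] [TopologicalSpace X]
  {G : Literature.Analysis.FluidPDE.Geometry d X} {ε : ℝ} {n : ℕ}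

/-- Along the hard-sphere flow (on its good set) the product Maxwellian is conserved, by
conservation of the kinetic energy (`IsHardSphereTrajectory.configEnergy_eq`). [folklore] -/
theorem tensorPow_maxwellianBeta_flow (Φ : Literature.Analysis.FluidPDE.HardSphereFlow G ε n) (β : ℝ) {z : Literature.Analysis.FluidPDE.Config n d X}
    (hz : z ∈ Φ.good) (s : ℝ) :
    Literature.Analysis.FluidPDE.tensorPow n (fun p : X × EuclideanSpace ℝ d => Literature.Analysis.FunctionSpaces.maxwellianBeta β p.2) (Φ.flow s z) =
      Literature.Analysis.FluidPDE.tensorPow n (fun p : X × EuclideanSpace ℝ d => Literature.Analysis.FunctionSpaces.maxwellianBeta β p.2) z := by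
  rw [tensorPow_maxwellianBeta, tensorPow_maxwellianBeta,
    Literature.Analysis.FluidPDE.IsHardSphereTrajectory.configEnergy_eq_holds (Φ.isTrajectory z hz) s 0]
  simp only [Φ.flow_zero z hz]

/-- **The Gibbs measure is stationary** (BGSR, proof of Prop. 4.1: "the Gibbs measure `M_{N,β}`
is a stationary solution" of the Liouville equation): the hard-sphere Gibbs density
`𝒵⁻¹ 1_{D_ε} M_β^{⊗n}` is invariant along the flow on its good set (the good set is invariant and
lies in `D_ε`, and the kinetic energy is conserved).
[cite: BodineauGallagherSaintRaymondInvent2016, Prop. 4.1 (proof)] -/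
theorem canonicalDensity_maxwellianBeta_flow (Φ : Literature.Analysis.FluidPDE.HardSphereFlow G ε n) (β : ℝ) {z : Literature.Analysis.FluidPDE.Config n d X}
    (hz : z ∈ Φ.good) (s : ℝ) :
    Literature.Analysis.FluidPDE.canonicalDensity G ε n (fun p => Literature.Analysis.FunctionSpaces.maxwellianBeta β p.2) (Φ.flow s z) =
      Literature.Analysis.FluidPDE.canonicalDensity G ε n (fun p => Literature.Analysis.FunctionSpaces.maxwellianBeta β p.2) z := by
  simp only [Literature.Analysis.FluidPDE.canonicalDensity]
  rw [indicator_of_mem (Φ.good_subset (Φ.mapsTo_good s hz)), indicator_of_mem (Φ.good_subset hz),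
    tensorPow_maxwellianBeta_flow Φ β hz s]

omit [TopologicalSpace X] in
/-- The hard-sphere partition function of the Maxwellian is nonnegative. [folklore] -/
theorem canonicalPartition_maxwellianBeta_nonneg {β : ℝ} (hβ : 0 < β) :
    0 ≤ Literature.Analysis.FluidPDE.canonicalPartition G ε n fun p : X × EuclideanSpace ℝ d => Literature.Analysis.FunctionSpaces.maxwellianBeta β p.2 :=
  integral_nonneg fun z => Set.indicator_nonneg
    (fun w _ => Literature.Analysis.FluidPDE.tensorPow_nonneg (fun p => (Literature.Analysis.FunctionSpaces.maxwellianBeta_pos hβ p.2).le) n w) z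

omit [TopologicalSpace X] in
/-- The hard-sphere Gibbs density is nonnegative. [folklore] -/
theorem canonicalDensity_maxwellianBeta_nonneg {β : ℝ} (hβ : 0 < β) (z : Literature.Analysis.FluidPDE.Config n d X) :
    0 ≤ Literature.Analysis.FluidPDE.canonicalDensity G ε n (fun p : X × EuclideanSpace ℝ d => Literature.Analysis.FunctionSpaces.maxwellianBeta β p.2) z :=
  mul_nonneg (inv_nonneg.2 (canonicalPartition_maxwellianBeta_nonneg hβ))
    (Set.indicator_nonneg (fun w _ => Literature.Analysis.FluidPDE.tensorPow_nonneg (fun p => (Literature.Analysis.FunctionSpaces.maxwellianBeta_pos hβ p.2).le) n w) z)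

end Gibbs

/-! ## First marginals via `Fin.cons` -/

section NthMarginal

variable {d : Type*} [Fintype d] {X : Type*} [MeasureSpace X] {N : ℕ}

/-- The first marginal of a function of `N + 1` particles, evaluated at `z₀`, is the integral
over the remaining `N` particles adjoined by `Fin.cons`:
`W^{(1)}(z₀) = ∫ W(z₀, Z') dZ'` (GST 2013 (4.3.2) with `s = 1`). [folklore] -/
theorem nthMarginal_succ_one (W : Literature.Analysis.FluidPDE.Config (N + 1) d X → ℝ) (y : X × EuclideanSpace ℝ d) :
    Literature.Analysis.FluidPDE.nthMarginal (N + 1) 1 W (fun _ => y) = ∫ zm : Literature.Analysis.FluidPDE.Config N d X, W (Fin.cons y zm) := by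
  rw [Literature.Analysis.FluidPDE.nthMarginal, dif_pos (Nat.le_add_left 1 N)]
  show ∫ zm : Literature.Analysis.FluidPDE.Config N d X, W (fun i => Fin.append (fun _ => y) zm (Fin.cast _ i)) = _
  congr 1 with zm
  congr 1
  funext i
  rw [Fin.append_left_eq_cons]
  rfl

end NthMarginal

/-! ## The tagged law has density the first marginal of the transported density -/

section TaggedLaw

variable {d : Type*} [Fintype d] {X : Type*} [MeasureSpace X] [TopologicalSpace X]
  {G : Literature.Analysis.FluidPDE.Geometry d X} {ε : ℝ} {N : ℕ}

/-- Transport along the hard-sphere flow preserves integrability: if `f₀` is integrable on phase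
space then so is `1_good · (f₀ ∘ Φ_{-t})` (the good set lies in `D_ε` and the flow preserves the
Liouville measure `1_{D_ε} dZ`). [folklore] -/
theorem integrable_indicator_hsTransport (hD : MeasurableSet (Literature.Analysis.FluidPDE.hardSphereDomain G (N + 1) ε))
    (Φ : Literature.Analysis.FluidPDE.HardSphereFlow G ε (N + 1)) {f₀ : Literature.Analysis.FluidPDE.Config (N + 1) d X → ℝ} (hf₀m : Measurable f₀)
    (hf₀ : Integrable f₀) (t : ℝ) :
    Integrable (Φ.good.indicator (Literature.Analysis.FluidPDE.hsTransport Φ t f₀)) := by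
  have hmeas : Measurable (Literature.Analysis.FluidPDE.hsTransport Φ t f₀) := hf₀m.comp (Φ.measurable_flow (-t))
  refine ⟨(hmeas.indicator Φ.measurableSet_good).aestronglyMeasurable, ?_⟩
  rw [hasFiniteIntegral_iff_enorm]
  calc ∫⁻ z, ‖Φ.good.indicator (Literature.Analysis.FluidPDE.hsTransport Φ t f₀) z‖ₑ
      ≤ ∫⁻ z, (Literature.Analysis.FluidPDE.hardSphereDomain G (N + 1) ε).indicator (fun z => ‖f₀ (Φ.flow (-t) z)‖ₑ) z := by
        refine lintegral_mono fun z => ?_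
        by_cases hz : z ∈ Φ.good
        · rw [indicator_of_mem hz, indicator_of_mem (Φ.good_subset hz), Literature.Analysis.FluidPDE.hsTransport_apply]
        · rw [indicator_of_notMem hz]
          simp
    _ = ∫⁻ z, ‖f₀ (Φ.flow (-t) z)‖ₑ ∂Literature.Analysis.FluidPDE.liouville G (N + 1) ε := by
        rw [lintegral_indicator hD, Literature.Analysis.FluidPDE.liouville_eq]
    _ = ∫⁻ z, ‖f₀ z‖ₑ ∂Literature.Analysis.FluidPDE.liouville G (N + 1) ε :=
        (Φ.measurePreserving (-t)).lintegral_comp hf₀m.enorm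
    _ ≤ ∫⁻ z, ‖f₀ z‖ₑ := by
        rw [Literature.Analysis.FluidPDE.liouville_eq]
        exact lintegral_mono' Measure.restrict_le_self le_rfl
    _ < ∞ := hf₀.2

/-- **The density of the tagged law.** For an `(N+1)`-sphere system started from `f₀ dZ`
(`f₀ ≥ 0` measurable), the one-time law of the tagged sphere `0` (`Kinetic.taggedLaw`) is
absolutely continuous with density `z₀ ↦ ∫⁻ 1_good f₀(Φ_{-t}(z₀, Z')) dZ'`, the first marginal of
the density transported along the flow on its good set (BGSR §3: "`f_N^{(1)}` is the distribution
of the tagged particle"; GST 2013 (4.3.2)). Ingredients: the mild Liouville equation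
`HardSphereFlow.lawAt_withDensity` (the flow preserves the Liouville measure), the good set being
Liouville-conull inside `D_ε`, and Fubini (`map_eval_zero_withDensity_pi`).
[cite: BodineauGallagherSaintRaymondInvent2016, §3 (4.1)] -/
theorem taggedLaw_ofReal_eq_withDensity_lintegral [SigmaFinite (volume : Measure X)]
    (hD : MeasurableSet (Literature.Analysis.FluidPDE.hardSphereDomain G (N + 1) ε)) (Φ : Literature.Analysis.FluidPDE.HardSphereFlow G ε (N + 1))
    {f₀ : Literature.Analysis.FluidPDE.Config (N + 1) d X → ℝ} (hf₀m : Measurable f₀) (t : ℝ) :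
    Literature.Analysis.FunctionSpaces.taggedLaw Φ (fun z => ENNReal.ofReal (f₀ z)) t =
      volume.withDensity fun y => ∫⁻ zm : Literature.Analysis.FluidPDE.Config N d X,
        ENNReal.ofReal (Φ.good.indicator (Literature.Analysis.FluidPDE.hsTransport Φ t f₀) (Fin.cons y zm)) := by
  have hW : Measurable fun z => ENNReal.ofReal (f₀ z) := hf₀m.ennreal_ofReal
  have hF : Measurable (Φ.good.indicator (Literature.Analysis.FluidPDE.hsTransport Φ t f₀)) :=
    (hf₀m.comp (Φ.measurable_flow (-t))).indicator Φ.measurableSet_good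
  rw [Literature.Analysis.FunctionSpaces.taggedLaw_eq_map_lawAt, Literature.Analysis.FluidPDE.HardSphereFlow.lawAt_withDensity_holds Φ hW t, Literature.Analysis.FluidPDE.liouville_eq,
    ← withDensity_indicator hD]
  have hae : (Literature.Analysis.FluidPDE.hardSphereDomain G (N + 1) ε).indicator
      (Φ.transportDensity (fun z => ENNReal.ofReal (f₀ z)) t) =ᵐ[volume]
      fun z => ENNReal.ofReal (Φ.good.indicator (Literature.Analysis.FluidPDE.hsTransport Φ t f₀) z) := by
    have h0 : (volume : Measure (Literature.Analysis.FluidPDE.Config (N + 1) d X))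
        (Literature.Analysis.FluidPDE.hardSphereDomain G (N + 1) ε ∩ Φ.goodᶜ) = 0 := by
      have h := Φ.measure_compl_good
      rwa [Literature.Analysis.FluidPDE.liouville_eq, Measure.restrict_apply Φ.measurableSet_good.compl, Set.inter_comm] at h
    filter_upwards [measure_eq_zero_iff_ae_notMem.1 h0] with z hz
    by_cases hg : z ∈ Φ.good
    · rw [indicator_of_mem (Φ.good_subset hg), indicator_of_mem hg]
      rfl
    · have hzD : z ∉ Literature.Analysis.FluidPDE.hardSphereDomain G (N + 1) ε := fun h => hz ⟨h, hg⟩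
      rw [indicator_of_notMem hzD, indicator_of_notMem hg, ENNReal.ofReal_zero]
  rw [withDensity_congr_ae hae, map_eval_zero_withDensity_pi hF.ennreal_ofReal]

/-- The same density computed with the Bochner integral, for an integrable `f₀ ≥ 0`: the tagged
law is `f^{(1)}(t, z₀) dz₀` with `f^{(1)}(t, z₀) = ∫ 1_good f₀(Φ_{-t}(z₀, Z')) dZ'`.
[cite: BodineauGallagherSaintRaymondInvent2016, §3 (4.1)] -/
theorem taggedLaw_ofReal_eq_withDensity_integral [SigmaFinite (volume : Measure X)]
    (hD : MeasurableSet (Literature.Analysis.FluidPDE.hardSphereDomain G (N + 1) ε)) (Φ : Literature.Analysis.FluidPDE.HardSphereFlow G ε (N + 1))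
    {f₀ : Literature.Analysis.FluidPDE.Config (N + 1) d X → ℝ} (hf₀m : Measurable f₀) (hf₀ : Integrable f₀)
    (hf₀0 : ∀ z, 0 ≤ f₀ z) (t : ℝ) :
    Literature.Analysis.FunctionSpaces.taggedLaw Φ (fun z => ENNReal.ofReal (f₀ z)) t =
      volume.withDensity fun y => ENNReal.ofReal (∫ zm : Literature.Analysis.FluidPDE.Config N d X,
        Φ.good.indicator (Literature.Analysis.FluidPDE.hsTransport Φ t f₀) (Fin.cons y zm)) := by
  rw [taggedLaw_ofReal_eq_withDensity_lintegral hD Φ hf₀m t]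
  refine withDensity_congr_ae ?_
  exact lintegral_cons_eq_ofReal_integral_ae (integrable_indicator_hsTransport hD Φ hf₀m hf₀ t)
    fun z => Set.indicator_nonneg (fun w _ => hf₀0 _) z

end TaggedLaw

end Kinetic

section Hilbert6

open Literature.Analysis.FluidPDE Literature.Analysis.FunctionSpaces

variable {d : Type*} [Fintype d]

local notation "𝔼" => EuclideanSpace ℝ d
local notation "𝕋" => UnitAddTorus d

/-- Lebesgue measure `dx dv` on the one-particle phase space `T^d × ℝ^d` is σ-finite. Instance
search finds this, but not under a binder `∀ i : Fin n, …` as required by the product-measure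
lemmas on configurations `(T^d × ℝ^d)^n`; registered as a *local* instance. [folklore] -/
theorem sigmaFinite_volume_phaseSpace : SigmaFinite (volume : Measure (𝕋 × 𝔼)) := inferInstance

attribute [local instance] sigmaFinite_volume_phaseSpace

/-! ## BGSR's datum on the torus: measurability, integrability, bounds -/

section Datum

variable {ε β : ℝ} {N n : ℕ} {ρ₀ : UnitAddTorus d → ℝ} {R : ℝ}

omit [Fintype d] in
/-- The hard-sphere domain of the torus is measurable. [folklore] -/
theorem measurableSet_hardSphereDomain_torus [Fintype d] (n : ℕ) (ε : ℝ) :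
    MeasurableSet (hardSphereDomain (Torus.geometry d) n ε) :=
  measurableSet_hardSphereDomain _ Torus.measurable_geometry_sepVec n ε

/-- The product Maxwellian is measurable. [folklore] -/
theorem measurable_tensorPow_maxwellianBeta (β : ℝ) (n : ℕ) :
    Measurable (tensorPow n fun p : 𝕋 × 𝔼 => maxwellianBeta β p.2) := by
  change Measurable fun z : Config n d 𝕋 => ∏ i, maxwellianBeta β (z i).2
  exact Finset.measurable_prod _ fun i _ =>
    (measurable_maxwellianBeta β).comp (measurable_pi_apply i).snd

/-- The product Maxwellian is integrable on `(T^d × ℝ^d)^n` for `β > 0` (`T^d` has unit volume and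
`∫ M_β = 1`). [folklore] -/
theorem integrable_tensorPow_maxwellianBeta (hβ : 0 < β) (n : ℕ) :
    Integrable (tensorPow n fun p : 𝕋 × 𝔼 => maxwellianBeta β p.2) := by
  have h1 : Integrable (fun p : 𝕋 × 𝔼 => maxwellianBeta β p.2) :=
    (integrable_maxwellianBeta hβ).comp_snd volume
  exact Integrable.fintype_prod (f := fun _ : Fin n => fun p : 𝕋 × 𝔼 => maxwellianBeta β p.2)
    fun _ => h1

/-- The hard-sphere Gibbs density of the torus is measurable. [folklore] -/
theorem measurable_canonicalDensity_torus (ε β : ℝ) (n : ℕ) :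
    Measurable (canonicalDensity (Torus.geometry d) ε n fun p : 𝕋 × 𝔼 => maxwellianBeta β p.2) := by
  unfold canonicalDensity
  exact measurable_const.mul ((measurable_tensorPow_maxwellianBeta β n).indicator
    (measurableSet_hardSphereDomain_torus n ε))

/-- The Gibbs density is dominated by `𝒵⁻¹ M_β^{⊗n}`. [folklore] -/
theorem canonicalDensity_torus_le (hβ : 0 < β) (z : Config n d 𝕋) :
    canonicalDensity (Torus.geometry d) ε n (fun p : 𝕋 × 𝔼 => maxwellianBeta β p.2) z ≤
      (canonicalPartition (Torus.geometry d) ε n fun p : 𝕋 × 𝔼 => maxwellianBeta β p.2)⁻¹ *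
        tensorPow n (fun p : 𝕋 × 𝔼 => maxwellianBeta β p.2) z :=
  by
  unfold canonicalDensity
  refine mul_le_mul_of_nonneg_left ?_ (inv_nonneg.2 (canonicalPartition_maxwellianBeta_nonneg hβ))
  exact Set.indicator_apply_le' (fun _ => le_rfl)
    (fun _ => tensorPow_nonneg (fun p => (maxwellianBeta_pos hβ p.2).le) n z)

/-- The hard-sphere Gibbs density of the torus is integrable. [folklore] -/
theorem integrable_canonicalDensity_torus (hβ : 0 < β) (ε : ℝ) (n : ℕ) :
    Integrable (canonicalDensity (Torus.geometry d) ε n fun p : 𝕋 × 𝔼 => maxwellianBeta β p.2) := by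
  unfold canonicalDensity
  exact ((integrable_tensorPow_maxwellianBeta hβ n).indicator
    (measurableSet_hardSphereDomain_torus n ε)).const_mul _

/-- BGSR's datum (2.8) is measurable for a measurable `ρ⁰`. [folklore] -/
theorem measurable_bgsrInitialDensity (hρ₀ : Measurable ρ₀) (ε : ℝ) (N : ℕ) (β : ℝ) :
    Measurable (bgsrInitialDensity ε N β ρ₀ : Config (N + 1) d 𝕋 → ℝ) :=
  (measurable_canonicalDensity_torus ε β (N + 1)).mul
    (hρ₀.comp (measurable_pi_apply 0).fst)

/-- BGSR's datum (2.8) is nonnegative for `ρ⁰ ≥ 0`. [folklore] -/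
theorem bgsrInitialDensity_nonneg (hβ : 0 < β) (hρ₀0 : ∀ x, 0 ≤ ρ₀ x)
    (z : Config (N + 1) d 𝕋) : 0 ≤ bgsrInitialDensity ε N β ρ₀ z :=
  mul_nonneg (canonicalDensity_maxwellianBeta_nonneg hβ z) (hρ₀0 _)

/-- BGSR's datum is dominated by the Gibbs density: `f_N^0 ≤ ‖ρ⁰‖_∞ M_{N,β}` (first line of the
proof of BGSR Prop. 4.1). [cite: BodineauGallagherSaintRaymondInvent2016, Prop. 4.1 (proof)] -/
theorem bgsrInitialDensity_le (hβ : 0 < β) (hR : ∀ x, ρ₀ x ≤ R) (z : Config (N + 1) d 𝕋) :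
    bgsrInitialDensity ε N β ρ₀ z ≤
      R * canonicalDensity (Torus.geometry d) ε (N + 1) (fun p => maxwellianBeta β p.2) z := by
  rw [bgsrInitialDensity, mul_comm]
  exact mul_le_mul_of_nonneg_right (hR _) (canonicalDensity_maxwellianBeta_nonneg hβ z)

/-- BGSR's datum is integrable for a bounded measurable `ρ⁰ ≥ 0`. [folklore] -/
theorem integrable_bgsrInitialDensity (hβ : 0 < β) (hρ₀ : Measurable ρ₀) (hρ₀0 : ∀ x, 0 ≤ ρ₀ x)
    (hR : ∀ x, ρ₀ x ≤ R) (ε : ℝ) (N : ℕ) :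
    Integrable (bgsrInitialDensity ε N β ρ₀ : Config (N + 1) d 𝕋 → ℝ) := by
  refine Integrable.mono' ((integrable_canonicalDensity_torus hβ ε (N + 1)).const_mul R)
    (measurable_bgsrInitialDensity hρ₀ ε N β).aestronglyMeasurable (Eventually.of_forall fun z => ?_)
  rw [Real.norm_eq_abs, abs_of_nonneg (bgsrInitialDensity_nonneg hβ hρ₀0 z)]
  exact bgsrInitialDensity_le hβ hR z

end Datum

/-! ## Proposition 4.1 (`s = 1`): the pointwise maximum-principle bound -/

section MaximumPrinciple

variable {ε β : ℝ} {N : ℕ} {ρ₀ : UnitAddTorus d → ℝ} {R : ℝ}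

/-- **The Liouville maximum principle against the stationary Gibbs measure** (BGSR, proof of
Prop. 4.1: `f_N(t, Z_N) ≤ M_{N,β}(Z_N) ‖ρ⁰‖_∞` for all `t`): the density transported along the flow
on its good set is dominated pointwise by `‖ρ⁰‖_∞ M_{N,β}`, the Gibbs density being invariant
(`Kinetic.canonicalDensity_maxwellianBeta_flow`).
[cite: BodineauGallagherSaintRaymondInvent2016, Prop. 4.1 (proof)] -/
theorem indicator_hsTransport_bgsrInitialDensity_le (hβ : 0 < β) (hρ₀0 : ∀ x, 0 ≤ ρ₀ x)
    (hR : ∀ x, ρ₀ x ≤ R) (Φ : HardSphereFlow (Torus.geometry d) ε (N + 1)) (t : ℝ)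
    (z : Config (N + 1) d 𝕋) :
    Φ.good.indicator (hsTransport Φ t (bgsrInitialDensity ε N β ρ₀)) z ≤
      R * canonicalDensity (Torus.geometry d) ε (N + 1) (fun p => maxwellianBeta β p.2) z := by
  by_cases hz : z ∈ Φ.good
  · rw [indicator_of_mem hz, hsTransport_apply]
    calc bgsrInitialDensity ε N β ρ₀ (Φ.flow (-t) z)
        ≤ R * canonicalDensity (Torus.geometry d) ε (N + 1) (fun p => maxwellianBeta β p.2)
            (Φ.flow (-t) z) := bgsrInitialDensity_le hβ hR _
      _ = R * canonicalDensity (Torus.geometry d) ε (N + 1) (fun p => maxwellianBeta β p.2) z := by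
          rw [canonicalDensity_maxwellianBeta_flow Φ β hz (-t)]
  · rw [indicator_of_notMem hz]
    exact mul_nonneg ((hρ₀0 0).trans (hR 0)) (canonicalDensity_maxwellianBeta_nonneg hβ z)

/-- The transported datum is nonnegative. [folklore] -/
theorem indicator_hsTransport_bgsrInitialDensity_nonneg (hβ : 0 < β) (hρ₀0 : ∀ x, 0 ≤ ρ₀ x)
    (Φ : HardSphereFlow (Torus.geometry d) ε (N + 1)) (t : ℝ) (z : Config (N + 1) d 𝕋) :
    0 ≤ Φ.good.indicator (hsTransport Φ t (bgsrInitialDensity ε N β ρ₀)) z :=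
  Set.indicator_nonneg (fun _ _ => bgsrInitialDensity_nonneg hβ hρ₀0 _) z

end MaximumPrinciple

/-! ## The tagged marginal of the Gibbs measure on the torus is the Maxwellian -/

section GibbsMarginal

variable {ε β : ℝ} {n N : ℕ}

omit [Fintype d] in
/-- Tensor powers factor along `Fin.cons`. [folklore] -/
theorem tensorPow_cons [Fintype d] (f : 𝕋 × 𝔼 → ℝ) (y : 𝕋 × 𝔼) (zm : Config n d 𝕋) :
    tensorPow (n + 1) f (Fin.cons y zm) = f y * tensorPow n f zm := by
  simp [tensorPow, Fin.prod_univ_succ]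

omit [Fintype d] in
/-- Whether `(z₀, Z')` lies in the hard-sphere domain only depends on the position of `z₀`.
[folklore] -/
theorem cons_mem_hardSphereDomain_iff [Fintype d] (x : 𝕋) (v v' : 𝔼) (zm : Config n d 𝕋) :
    (Fin.cons (x, v) zm : Config (n + 1) d 𝕋) ∈ hardSphereDomain (Torus.geometry d) (n + 1) ε ↔
      (Fin.cons (x, v') zm : Config (n + 1) d 𝕋) ∈ hardSphereDomain (Torus.geometry d) (n + 1) ε :=
  mem_hardSphereDomain_congr_fst fun i => Fin.cases rfl (fun _ => rfl) i

omit [Fintype d] in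
/-- Diagonal translations commute with `Fin.cons`. [folklore] -/
theorem translateAll_cons [Fintype d] (a : 𝕋) (y : 𝕋 × 𝔼) (zm : Config n d 𝕋) :
    translateAll a (Fin.cons y zm : Config (n + 1) d 𝕋) = Fin.cons (y.1 + a, y.2) (translateAll a zm) := by
  funext i
  refine Fin.cases ?_ (fun j => ?_) i <;> simp [translateAll]

omit [Fintype d] in
/-- Diagonal translations do not change the product Maxwellian. [folklore] -/
theorem tensorPow_maxwellianBeta_translateAll [Fintype d] (β : ℝ) (a : 𝕋) (z : Config n d 𝕋) :
    tensorPow n (fun p : 𝕋 × 𝔼 => maxwellianBeta β p.2) (translateAll a z) =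
      tensorPow n (fun p : 𝕋 × 𝔼 => maxwellianBeta β p.2) z := by
  simp [tensorPow, translateAll]

/-- Diagonal translations do not change the Gibbs weight `1_{D_ε} M_β^{⊗n}` (translation
invariance of `T^d`; BGSR after (2.8)). [folklore] -/
theorem indicator_tensorPow_translateAll (β : ℝ) (a : 𝕋) (z : Config n d 𝕋) :
    (hardSphereDomain (Torus.geometry d) n ε).indicator
        (tensorPow n fun p : 𝕋 × 𝔼 => maxwellianBeta β p.2) (translateAll a z) =
      (hardSphereDomain (Torus.geometry d) n ε).indicator
        (tensorPow n fun p : 𝕋 × 𝔼 => maxwellianBeta β p.2) z := by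
  by_cases hz : z ∈ hardSphereDomain (Torus.geometry d) n ε
  · rw [indicator_of_mem hz, indicator_of_mem ((translateAll_mem_hardSphereDomain_iff a ε z).2 hz),
      tensorPow_maxwellianBeta_translateAll]
  · rw [indicator_of_notMem hz,
      indicator_of_notMem (mt (translateAll_mem_hardSphereDomain_iff a ε z).1 hz)]

/-- The diagonal translation by `a ∈ T^d` preserves the Liouville (Lebesgue) measure of
`(T^d × ℝ^d)^n` (Haar measure on the torus). [folklore] -/
theorem measurePreserving_translateAll (a : 𝕋) :
    MeasurePreserving (translateAll (N := n) (d := d) a) volume volume := by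
  have h1 : MeasurePreserving (fun p : 𝕋 × 𝔼 => (p.1 + a, p.2)) volume volume :=
    (measurePreserving_add_right volume a).prod (MeasurePreserving.id volume)
  exact volume_preserving_pi (α' := fun _ : Fin n => 𝕋 × 𝔼) (β' := fun _ : Fin n => 𝕋 × 𝔼)
    fun _ => h1

/-- The diagonal translation as a measurable equivalence (inverse: translation by `-a`). [folklore] -/
def translateAllEquiv (a : 𝕋) : Config n d 𝕋 ≃ᵐ Config n d 𝕋 where
  toFun := translateAll a
  invFun := translateAll (-a)
  left_inv z := by rw [← translateAll_add, neg_add_cancel, translateAll_zero]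
  right_inv z := by rw [← translateAll_add, add_neg_cancel, translateAll_zero]
  measurable_toFun := (measurePreserving_translateAll a).measurable
  measurable_invFun := (measurePreserving_translateAll (-a)).measurable

/-- Unfolding lemma. [folklore] -/
@[simp]
theorem translateAllEquiv_apply (a : 𝕋) (z : Config n d 𝕋) :
    translateAllEquiv a z = translateAll a z := rfl

/-- **Translation invariance of the conditional exclusion volume**: the Gibbs weight of the
background, given the tagged particle at `(x, v)`, does not depend on `x`:
`∫ 1_{D_ε}(x + a, v, Z') M^{⊗}(Z') dZ' = ∫ 1_{D_ε}(x, v, Z') M^{⊗}(Z') dZ'` (BGSR after (2.8): "the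
distribution `f_N^0` is normalized by `1` … thanks to the translation invariance of `T^d`").
[cite: BodineauGallagherSaintRaymondInvent2016, after (2.8)] -/
theorem integral_indicator_tensorPow_cons_add (β : ℝ) (x a : 𝕋) (v : 𝔼) :
    ∫ zm : Config N d 𝕋, (hardSphereDomain (Torus.geometry d) (N + 1) ε).indicator
        (tensorPow (N + 1) fun p : 𝕋 × 𝔼 => maxwellianBeta β p.2) (Fin.cons (x + a, v) zm) =
      ∫ zm : Config N d 𝕋, (hardSphereDomain (Torus.geometry d) (N + 1) ε).indicator
        (tensorPow (N + 1) fun p : 𝕋 × 𝔼 => maxwellianBeta β p.2) (Fin.cons (x, v) zm) := by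
  have hmp : MeasurePreserving (translateAllEquiv (n := N) (d := d) (-a)) volume volume :=
    measurePreserving_translateAll (-a)
  rw [← hmp.integral_comp' fun zm : Config N d 𝕋 =>
    (hardSphereDomain (Torus.geometry d) (N + 1) ε).indicator
      (tensorPow (N + 1) fun p : 𝕋 × 𝔼 => maxwellianBeta β p.2) (Fin.cons (x, v) zm)]
  refine integral_congr_ae (Eventually.of_forall fun zm => ?_)
  beta_reduce
  rw [translateAllEquiv_apply, ← indicator_tensorPow_translateAll β (-a) (Fin.cons (x + a, v) zm),
    translateAll_cons]
  simp

/-- **The partition function by conditioning on the tagged particle**: for every `x ∈ T^d` and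
`v ∈ ℝ^d`, `∫ 1_{D_ε}((x, v), Z') M_β^{⊗(N+1)}((x, v), Z') dZ' = M_β(v) 𝒵_{N+1}` (Fubini and
translation invariance; BGSR (2.7)–(2.8)). [cite: BodineauGallagherSaintRaymondInvent2016, (2.7)] -/
theorem integral_indicator_tensorPow_cons (hβ : 0 < β) (x : 𝕋) (v : 𝔼) :
    ∫ zm : Config N d 𝕋, (hardSphereDomain (Torus.geometry d) (N + 1) ε).indicator
        (tensorPow (N + 1) fun p : 𝕋 × 𝔼 => maxwellianBeta β p.2) (Fin.cons (x, v) zm) =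
      maxwellianBeta β v * equilibriumTaggedPartition (Torus.geometry d) ε N β := by
  -- notation
  set D := hardSphereDomain (Torus.geometry d) (N + 1) ε with hD
  set T : Config (N + 1) d 𝕋 → ℝ := tensorPow (N + 1) fun p : 𝕋 × 𝔼 => maxwellianBeta β p.2
    with hT
  set TN : Config N d 𝕋 → ℝ := tensorPow N fun p : 𝕋 × 𝔼 => maxwellianBeta β p.2 with hTN
  -- the conditional exclusion volume `A x` (independent of `v`)
  set A : 𝕋 → ℝ := fun x => ∫ zm : Config N d 𝕋,
    {zm | (Fin.cons (x, (0 : 𝔼)) zm : Config (N + 1) d 𝕋) ∈ D}.indicator TN zm with hA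
  -- factorisation of the integrand
  have hfac : ∀ (y : 𝕋 × 𝔼) (zm : Config N d 𝕋), D.indicator T (Fin.cons y zm) =
      maxwellianBeta β y.2 *
        {zm | (Fin.cons (y.1, (0 : 𝔼)) zm : Config (N + 1) d 𝕋) ∈ D}.indicator TN zm := by
    intro y zm
    by_cases h : (Fin.cons y zm : Config (N + 1) d 𝕋) ∈ D
    · have h' : zm ∈ {zm : Config N d 𝕋 | (Fin.cons (y.1, (0 : 𝔼)) zm : Config (N + 1) d 𝕋) ∈ D} :=
        (cons_mem_hardSphereDomain_iff y.1 y.2 0 zm).1 h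
      rw [indicator_of_mem h, indicator_of_mem h', hT, tensorPow_cons]
    · have h' : zm ∉ {zm : Config N d 𝕋 | (Fin.cons (y.1, (0 : 𝔼)) zm : Config (N + 1) d 𝕋) ∈ D} :=
        fun h' => h ((cons_mem_hardSphereDomain_iff y.1 y.2 0 zm).2 h')
      rw [indicator_of_notMem h, indicator_of_notMem h', mul_zero]
  have hB : ∀ (y : 𝕋 × 𝔼), ∫ zm : Config N d 𝕋, D.indicator T (Fin.cons y zm) =
      maxwellianBeta β y.2 * A y.1 := by
    intro y
    simp_rw [hfac]
    rw [integral_const_mul]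
  -- translation invariance: `A x = A 0`
  have hA0 : ∀ x, A x = A 0 := by
    intro x
    have h := integral_indicator_tensorPow_cons_add (ε := ε) (N := N) β (0 : 𝕋) x (0 : 𝔼)
    rw [zero_add, hB, hB] at h
    simpa [(maxwellianBeta_pos hβ (0 : 𝔼)).ne'] using h
  -- Fubini: `𝒵 = A 0`
  have hZ : equilibriumTaggedPartition (Torus.geometry d) ε N β = A 0 := by
    rw [equilibriumTaggedPartition, canonicalPartition]
    have hes : MeasurePreserving
        (MeasurableEquiv.piFinSuccAbove (fun _ : Fin (N + 1) => 𝕋 × 𝔼) 0).symm volume volume :=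
      (volume_preserving_piFinSuccAbove (fun _ : Fin (N + 1) => 𝕋 × 𝔼) 0).symm _
    have hint : Integrable (D.indicator T) :=
      (integrable_tensorPow_maxwellianBeta hβ (N + 1)).indicator
        (measurableSet_hardSphereDomain_torus (N + 1) ε)
    rw [← hes.integral_comp']
    change ∫ p, D.indicator T ((MeasurableEquiv.piFinSuccAbove (fun _ : Fin (N + 1) => 𝕋 × 𝔼) 0).symm p)
      ∂(volume : Measure (𝕋 × 𝔼)).prod (volume : Measure (Config N d 𝕋)) = A 0
    have hint' : Integrable
        (fun p => D.indicator T ((MeasurableEquiv.piFinSuccAbove (fun _ : Fin (N + 1) => 𝕋 × 𝔼) 0).symm p))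
        ((volume : Measure (𝕋 × 𝔼)).prod (volume : Measure (Config N d 𝕋))) :=
      (hes.integrable_comp_emb (MeasurableEquiv.measurableEmbedding _)).2 hint
    rw [integral_prod _ hint']
    simp_rw [piFinSuccAbove_zero_symm_apply, hB, hA0]
    rw [integral_mul_const]
    have h1 : ∫ y : 𝕋 × 𝔼, maxwellianBeta β y.2 = 1 := by
      rw [show (volume : Measure (𝕋 × 𝔼)) = (volume : Measure 𝕋).prod volume from rfl,
        integral_fun_snd]
      simp [integral_maxwellianBeta hβ]
    rw [h1, one_mul]
  rw [hB, hA0, hZ]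

/-- The tagged one-particle marginal of the hard-sphere Gibbs measure on the torus is *exactly*
the Maxwellian: `M^{(1)}_{N,β}(x, v) = ∫ M_{N,β}((x, v), Z') dZ' = M_β(v)` whenever `𝒵 > 0`
(translation invariance of `T^d`; this is the `s = 1` case of BGSR Prop. 3.2, without error term
on the torus). [cite: BodineauGallagherSaintRaymondInvent2016, Prop. 3.2 (s = 1)] -/
theorem integral_canonicalDensity_cons (hβ : 0 < β)
    (hZ : equilibriumTaggedPartition (Torus.geometry d) ε N β ≠ 0) (x : 𝕋) (v : 𝔼) :
    ∫ zm : Config N d 𝕋, canonicalDensity (Torus.geometry d) ε (N + 1)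
        (fun p => maxwellianBeta β p.2) (Fin.cons (x, v) zm) = maxwellianBeta β v := by
  simp only [canonicalDensity]
  rw [integral_const_mul, integral_indicator_tensorPow_cons hβ x v]
  change (equilibriumTaggedPartition (Torus.geometry d) ε N β)⁻¹ *
    (maxwellianBeta β v * equilibriumTaggedPartition (Torus.geometry d) ε N β) = _
  field_simp

/-- Without positivity of `𝒵` one still has `∫ M_{N,β}((x, v), Z') dZ' ≤ M_β(v)` (the left side
is `0` if `𝒵 = 0`). [folklore] -/
theorem integral_canonicalDensity_cons_le (hβ : 0 < β) (x : 𝕋) (v : 𝔼) :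
    ∫ zm : Config N d 𝕋, canonicalDensity (Torus.geometry d) ε (N + 1)
        (fun p => maxwellianBeta β p.2) (Fin.cons (x, v) zm) ≤ maxwellianBeta β v := by
  by_cases hZ : equilibriumTaggedPartition (Torus.geometry d) ε N β = 0
  · simp only [canonicalDensity]
    rw [integral_const_mul]
    change (equilibriumTaggedPartition (Torus.geometry d) ε N β)⁻¹ * _ ≤ _
    rw [hZ, inv_zero, zero_mul]
    exact (maxwellianBeta_pos hβ v).le
  · exact (integral_canonicalDensity_cons hβ hZ x v).le

/-- The background integral of the Gibbs density is integrable in `Z'` for every tagged state.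
[folklore] -/
theorem integrable_canonicalDensity_cons (hβ : 0 < β) (y : 𝕋 × 𝔼) :
    Integrable fun zm : Config N d 𝕋 => canonicalDensity (Torus.geometry d) ε (N + 1)
      (fun p => maxwellianBeta β p.2) (Fin.cons y zm) := by
  have hmeas : Measurable fun zm : Config N d 𝕋 => (Fin.cons y zm : Config (N + 1) d 𝕋) := by
    have : (fun zm : Config N d 𝕋 => (Fin.cons y zm : Config (N + 1) d 𝕋)) =
        (MeasurableEquiv.piFinSuccAbove (fun _ : Fin (N + 1) => 𝕋 × 𝔼) 0).symm ∘ fun zm => (y, zm) :=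
      funext fun zm => (piFinSuccAbove_zero_symm_apply (y, zm)).symm
    rw [this]
    exact (MeasurableEquiv.measurable _).comp (measurable_const.prodMk measurable_id)
  refine Integrable.mono'
    ((integrable_tensorPow_maxwellianBeta hβ N).const_mul
      ((canonicalPartition (Torus.geometry d) ε (N + 1) fun p : 𝕋 × 𝔼 => maxwellianBeta β p.2)⁻¹ *
        maxwellianBeta β y.2))
    ((measurable_canonicalDensity_torus ε β (N + 1)).comp hmeas).aestronglyMeasurable
    (Eventually.of_forall fun zm => ?_)
  rw [Real.norm_eq_abs, abs_of_nonneg (canonicalDensity_maxwellianBeta_nonneg hβ _)]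
  refine (canonicalDensity_torus_le hβ _).trans_eq ?_
  rw [tensorPow_cons, mul_assoc]

end GibbsMarginal

/-! ## The tagged distribution `f_N^{(1)}`: Prop 4.1 and Prop 3.3 for `s = 1` -/

section TaggedMarginal

variable {ε β : ℝ} {N : ℕ} {ρ₀ : UnitAddTorus d → ℝ} {R : ℝ}

/-- `f_N^{(1)}(t, x, v) = ∫ 1_good f_N^0(Φ_{-t}((x, v), Z')) dZ'`. [folklore] -/
theorem bgsrTaggedMarginal_eq_integral (Φ : HardSphereFlow (Torus.geometry d) ε (N + 1)) (β : ℝ)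
    (ρ₀ : 𝕋 → ℝ) (t : ℝ) (x : 𝕋) (v : 𝔼) :
    bgsrTaggedMarginal Φ β ρ₀ t x v = ∫ zm : Config N d 𝕋,
      Φ.good.indicator (hsTransport Φ t (bgsrInitialDensity ε N β ρ₀)) (Fin.cons (x, v) zm) :=
  nthMarginal_succ_one _ _

/-- `f_N^{(1)} ≥ 0`. [folklore] -/
theorem bgsrTaggedMarginal_nonneg (hβ : 0 < β) (hρ₀0 : ∀ x, 0 ≤ ρ₀ x)
    (Φ : HardSphereFlow (Torus.geometry d) ε (N + 1)) (t : ℝ) (x : 𝕋) (v : 𝔼) :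
    0 ≤ bgsrTaggedMarginal Φ β ρ₀ t x v := by
  rw [bgsrTaggedMarginal_eq_integral]
  exact integral_nonneg fun zm => indicator_hsTransport_bgsrInitialDensity_nonneg hβ hρ₀0 Φ t _

/-- **BGSR Proposition 4.1 for `s = 1`, in exact form on the torus**: for the datum (2.8) with
`0 ≤ ρ⁰ ≤ R`, the distribution of the tagged particle satisfies, for *every* time `t` and every
`(x, v)`, `f_N^{(1)}(t, x, v) ≤ R M_β(v)` (printed: `sup_t f_N^{(s)}(t) ≤ M^{(s)}_{N,β} ‖ρ⁰‖_∞
≤ C^s M_β^{⊗s} ‖ρ⁰‖_∞`; for `s = 1` on `T^d` one has `M^{(1)}_{N,β} = M_β` exactly, so `C = 1`).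
Proof as printed: maximum principle for the Liouville equation against the stationary Gibbs
measure (`indicator_hsTransport_bgsrInitialDensity_le`), then integration
(`integral_canonicalDensity_cons_le`). [cite: BodineauGallagherSaintRaymondInvent2016, Prop. 4.1] -/
theorem bgsrTaggedMarginal_le (hβ : 0 < β) (hρ₀0 : ∀ x, 0 ≤ ρ₀ x) (hR : ∀ x, ρ₀ x ≤ R)
    (Φ : HardSphereFlow (Torus.geometry d) ε (N + 1)) (t : ℝ) (x : 𝕋) (v : 𝔼) :
    bgsrTaggedMarginal Φ β ρ₀ t x v ≤ R * maxwellianBeta β v := by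
  have hR0 : 0 ≤ R := (hρ₀0 0).trans (hR 0)
  rw [bgsrTaggedMarginal_eq_integral]
  calc ∫ zm : Config N d 𝕋,
        Φ.good.indicator (hsTransport Φ t (bgsrInitialDensity ε N β ρ₀)) (Fin.cons (x, v) zm)
      ≤ ∫ zm : Config N d 𝕋, R * canonicalDensity (Torus.geometry d) ε (N + 1)
          (fun p => maxwellianBeta β p.2) (Fin.cons (x, v) zm) :=
        integral_mono_of_nonneg
          (Eventually.of_forall fun zm =>
            indicator_hsTransport_bgsrInitialDensity_nonneg hβ hρ₀0 Φ t _)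
          ((integrable_canonicalDensity_cons hβ (x, v)).const_mul R)
          (Eventually.of_forall fun zm =>
            indicator_hsTransport_bgsrInitialDensity_le hβ hρ₀0 hR Φ t _)
    _ = R * ∫ zm : Config N d 𝕋, canonicalDensity (Torus.geometry d) ε (N + 1)
          (fun p => maxwellianBeta β p.2) (Fin.cons (x, v) zm) := integral_const_mul _ _
    _ ≤ R * maxwellianBeta β v :=
        mul_le_mul_of_nonneg_left (integral_canonicalDensity_cons_le hβ x v) hR0

/-- At time `0` the transported datum is the datum, almost everywhere (the good set is conull in
`D_ε`, on which the datum is supported, and `Φ_0 = id` there). [folklore] -/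
theorem indicator_hsTransport_zero_ae_eq
    (Φ : HardSphereFlow (Torus.geometry d) ε (N + 1)) (β : ℝ) (ρ₀ : 𝕋 → ℝ) :
    Φ.good.indicator (hsTransport Φ 0 (bgsrInitialDensity ε N β ρ₀)) =ᵐ[volume]
      bgsrInitialDensity ε N β ρ₀ := by
  have h0 : (volume : Measure (Config (N + 1) d 𝕋))
      (hardSphereDomain (Torus.geometry d) (N + 1) ε ∩ Φ.goodᶜ) = 0 := by
    have h := Φ.measure_compl_good
    rwa [liouville_eq, Measure.restrict_apply Φ.measurableSet_good.compl, Set.inter_comm] at h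
  filter_upwards [measure_eq_zero_iff_ae_notMem.1 h0] with z hz
  by_cases hg : z ∈ Φ.good
  · rw [indicator_of_mem hg, hsTransport_apply, neg_zero, Φ.flow_zero z hg]
  · have hzD : z ∉ hardSphereDomain (Torus.geometry d) (N + 1) ε := fun h => hz ⟨h, hg⟩
    rw [indicator_of_notMem hg, bgsrInitialDensity, canonicalDensity, indicator_of_notMem hzD]
    ring

/-- **BGSR Proposition 3.3 for `s = 1`, in exact form on the torus**: if `𝒵 > 0` then the initial
distribution of the tagged particle is *exactly* `ρ⁰(x) M_β(v)` for a.e. `(x, v)` (printed: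
`|f_N^{0(1)} - ρ⁰ M_β| ≤ C εα M_β ‖ρ⁰‖_∞`; on `T^d` the tagged marginal of the Gibbs measure is
`M_β` by translation invariance, so the error term vanishes for `s = 1`).
[cite: BodineauGallagherSaintRaymondInvent2016, Prop. 3.3] -/
theorem bgsrTaggedMarginal_zero_ae_eq (hβ : 0 < β)
    (hZ : equilibriumTaggedPartition (Torus.geometry d) ε N β ≠ 0)
    (Φ : HardSphereFlow (Torus.geometry d) ε (N + 1)) (ρ₀ : 𝕋 → ℝ) :
    ∀ᵐ z : 𝕋 × 𝔼, bgsrTaggedMarginal Φ β ρ₀ 0 z.1 z.2 = ρ₀ z.1 * maxwellianBeta β z.2 := by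
  set e := MeasurableEquiv.piFinSuccAbove (fun _ : Fin (N + 1) => 𝕋 × 𝔼) 0 with he_def
  have hes : MeasurePreserving e.symm volume volume :=
    (volume_preserving_piFinSuccAbove (fun _ : Fin (N + 1) => 𝕋 × 𝔼) 0).symm _
  -- the a.e. identity `1_good f⁰ ∘ Φ₀ = f⁰`, transported to the product and sliced
  have hae := indicator_hsTransport_zero_ae_eq Φ β ρ₀
  have hae' : ∀ᵐ p ∂(volume : Measure ((𝕋 × 𝔼) × Config N d 𝕋)),
      Φ.good.indicator (hsTransport Φ 0 (bgsrInitialDensity ε N β ρ₀)) (e.symm p) =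
        bgsrInitialDensity ε N β ρ₀ (e.symm p) := by
    have h2 : ∀ᵐ z ∂(Measure.map e.symm (volume : Measure ((𝕋 × 𝔼) × Config N d 𝕋))),
        Φ.good.indicator (hsTransport Φ 0 (bgsrInitialDensity ε N β ρ₀)) z =
          bgsrInitialDensity ε N β ρ₀ z := by
      rw [hes.map_eq]
      exact hae
    exact ae_of_ae_map e.symm.measurable.aemeasurable h2
  filter_upwards [Measure.ae_ae_of_ae_prod hae'] with y hy
  obtain ⟨x, v⟩ := y
  rw [bgsrTaggedMarginal_eq_integral]
  have hy' : (fun zm : Config N d 𝕋 =>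
      Φ.good.indicator (hsTransport Φ 0 (bgsrInitialDensity ε N β ρ₀)) (Fin.cons (x, v) zm)) =ᵐ[volume]
      fun zm => bgsrInitialDensity ε N β ρ₀ (Fin.cons (x, v) zm) := by
    filter_upwards [hy] with zm hzm
    rw [← piFinSuccAbove_zero_symm_apply ((x, v), zm)]
    exact hzm
  rw [integral_congr_ae hy']
  have hf : ∀ zm : Config N d 𝕋, bgsrInitialDensity ε N β ρ₀ (Fin.cons (x, v) zm) =
      canonicalDensity (Torus.geometry d) ε (N + 1) (fun p => maxwellianBeta β p.2)
        (Fin.cons (x, v) zm) * ρ₀ x := fun zm => rfl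
  simp_rw [hf]
  rw [integral_mul_const, integral_canonicalDensity_cons hβ hZ x v, mul_comm]

/-- **The law of the tagged sphere has density `f_N^{(1)}(t)`** (BGSR (2.10) / §3: "`f_N^{(1)}` is
exactly the distribution of the tagged particle"): for the datum (2.8) with a bounded measurable
`ρ⁰ ≥ 0`, `Kinetic.taggedLaw Φ (equilibriumTaggedDensity … β (ρ⁰ ∘ fst)) t = f_N^{(1)}(t, x, v) dx dv`
with `f_N^{(1)} = bgsrTaggedMarginal` (mild Liouville equation + Fubini,
`Kinetic.taggedLaw_ofReal_eq_withDensity_integral`).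
[cite: BodineauGallagherSaintRaymondInvent2016, (2.10)] -/
theorem taggedLaw_eq_withDensity_bgsrTaggedMarginal (hβ : 0 < β) (hρ₀ : Measurable ρ₀)
    (hρ₀0 : ∀ x, 0 ≤ ρ₀ x) (hR : ∀ x, ρ₀ x ≤ R)
    (Φ : HardSphereFlow (Torus.geometry d) ε (N + 1)) (t : ℝ) :
    Literature.Analysis.FunctionSpaces.taggedLaw Φ (Literature.Analysis.FunctionSpaces.equilibriumTaggedDensity (Torus.geometry d) ε N β fun z => ρ₀ z.1) t =
      volume.withDensity fun z : 𝕋 × 𝔼 => ENNReal.ofReal (bgsrTaggedMarginal Φ β ρ₀ t z.1 z.2) := by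
  have h := taggedLaw_ofReal_eq_withDensity_integral (X := 𝕋)
    (measurableSet_hardSphereDomain_torus (N + 1) ε) Φ (measurable_bgsrInitialDensity hρ₀ ε N β)
    (integrable_bgsrInitialDensity hβ hρ₀ hρ₀0 hR ε N) (bgsrInitialDensity_nonneg hβ hρ₀0) t
  have hfun : (fun y : 𝕋 × 𝔼 => ENNReal.ofReal (∫ zm : Config N d 𝕋,
      Φ.good.indicator (hsTransport Φ t (bgsrInitialDensity ε N β ρ₀)) (Fin.cons y zm))) =
      fun z : 𝕋 × 𝔼 => ENNReal.ofReal (bgsrTaggedMarginal Φ β ρ₀ t z.1 z.2) := by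
    funext z
    rw [bgsrTaggedMarginal_eq_integral, Prod.mk.eta]
  rw [← hfun, ← h]
  rfl

/-- `Fin.cons`, as a map `(T^d × ℝ^d) × (T^d × ℝ^d)^N → (T^d × ℝ^d)^{N+1}`, is measurable. [folklore] -/
theorem measurable_finCons :
    Measurable fun p : (𝕋 × 𝔼) × Config N d 𝕋 => (Fin.cons p.1 p.2 : Config (N + 1) d 𝕋) := by
  have : (fun p : (𝕋 × 𝔼) × Config N d 𝕋 => (Fin.cons p.1 p.2 : Config (N + 1) d 𝕋)) =
      (MeasurableEquiv.piFinSuccAbove (fun _ : Fin (N + 1) => 𝕋 × 𝔼) 0).symm :=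
    funext fun p => (piFinSuccAbove_zero_symm_apply p).symm
  rw [this]
  exact MeasurableEquiv.measurable _

/-- `f_N^{(1)}(t)` is measurable on `T^d × ℝ^d` (a parametric integral of a measurable function).
[folklore] -/
theorem measurable_bgsrTaggedMarginal (hρ₀ : Measurable ρ₀)
    (Φ : HardSphereFlow (Torus.geometry d) ε (N + 1)) (β t : ℝ) :
    Measurable fun z : 𝕋 × 𝔼 => bgsrTaggedMarginal Φ β ρ₀ t z.1 z.2 := by
  have hF : Measurable (Φ.good.indicator (hsTransport Φ t (bgsrInitialDensity ε N β ρ₀))) :=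
    ((measurable_bgsrInitialDensity hρ₀ ε N β).comp (Φ.measurable_flow (-t))).indicator
      Φ.measurableSet_good
  have h := ((hF.comp measurable_finCons).stronglyMeasurable.integral_prod_right'
    (ν := (volume : Measure (Config N d 𝕋)))).measurable
  have hfun : (fun z : 𝕋 × 𝔼 => bgsrTaggedMarginal Φ β ρ₀ t z.1 z.2) = fun z => ∫ zm : Config N d 𝕋,
      Φ.good.indicator (hsTransport Φ t (bgsrInitialDensity ε N β ρ₀)) (Fin.cons z zm) := by
    funext z
    rw [bgsrTaggedMarginal_eq_integral, Prod.mk.eta]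
  rw [hfun]
  exact h

/-- The law of the tagged sphere integrates observables against `f_N^{(1)}(t)`:
`∫ φ dLaw(t) = ∫ f_N^{(1)}(t, z) φ(z) dz` (BGSR (2.10)).
[cite: BodineauGallagherSaintRaymondInvent2016, (2.10)] -/
theorem integral_taggedLaw_eq_integral_bgsrTaggedMarginal (hβ : 0 < β) (hρ₀ : Measurable ρ₀)
    (hρ₀0 : ∀ x, 0 ≤ ρ₀ x) (hR : ∀ x, ρ₀ x ≤ R)
    (Φ : HardSphereFlow (Torus.geometry d) ε (N + 1)) (t : ℝ) (φ : 𝕋 × 𝔼 → ℝ) :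
    ∫ z, φ z ∂Literature.Analysis.FunctionSpaces.taggedLaw Φ
        (Literature.Analysis.FunctionSpaces.equilibriumTaggedDensity (Torus.geometry d) ε N β fun z => ρ₀ z.1) t =
      ∫ z : 𝕋 × 𝔼, bgsrTaggedMarginal Φ β ρ₀ t z.1 z.2 * φ z := by
  rw [taggedLaw_eq_withDensity_bgsrTaggedMarginal hβ hρ₀ hρ₀0 hR Φ t,
    integral_withDensity_eq_integral_toReal_smul
      (measurable_bgsrTaggedMarginal hρ₀ Φ β t).ennreal_ofReal
      (Eventually.of_forall fun z => ENNReal.ofReal_lt_top)]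
  refine integral_congr_ae (Eventually.of_forall fun z => ?_)
  simp only [ENNReal.toReal_ofReal (bgsrTaggedMarginal_nonneg hβ hρ₀0 Φ t z.1 z.2), smul_eq_mul]

end TaggedMarginal

/-! ## From a.e.-uniform convergence of densities to weak convergence -/

section WeakConvergence

/-- From a.e.-uniform estimates along a sequence to a.e. pointwise convergence: if for every
`δ > 0`, eventually in `k`, `|F_k - f| ≤ δ` a.e., then `F_k → f` a.e. [folklore] -/
theorem ae_tendsto_of_forall_eventually_ae_le {Ω : Type*} [MeasurableSpace Ω] {μ : Measure Ω}
    {F : ℕ → Ω → ℝ} {f : Ω → ℝ}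
    (h : ∀ δ, 0 < δ → ∀ᶠ k in atTop, ∀ᵐ z ∂μ, |F k z - f z| ≤ δ) :
    ∀ᵐ z ∂μ, Tendsto (fun k => F k z) atTop (𝓝 (f z)) := by
  have key : ∀ m : ℕ, ∃ K : ℕ, ∀ k ≥ K, ∀ᵐ z ∂μ, |F k z - f z| ≤ 1 / ((m : ℝ) + 1) := fun m =>
    eventually_atTop.1 (h _ Nat.one_div_pos_of_nat)
  choose K hK using key
  have hae : ∀ᵐ z ∂μ, ∀ m k : ℕ, K m ≤ k → |F k z - f z| ≤ 1 / ((m : ℝ) + 1) := by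
    refine ae_all_iff.2 fun m => ae_all_iff.2 fun k => ?_
    by_cases hk : K m ≤ k
    · filter_upwards [hK m k hk] with z hz _ using hz
    · exact Eventually.of_forall fun z h => absurd h hk
  filter_upwards [hae] with z hz
  rw [Metric.tendsto_atTop]
  intro e he
  obtain ⟨m, hm⟩ := exists_nat_one_div_lt he
  exact ⟨K m, fun k hk => by rw [Real.dist_eq]; exact (hz m k hk).trans_lt hm⟩

/-- **Dominated convergence on `T^d × ℝ^d` with a Maxwellian majorant.** If real densities `f_k`
on `T^d × ℝ^d` are measurable, eventually dominated by `C M_β` (BGSR Prop. 4.1) and converge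
a.e.-uniformly (for every `δ > 0`, eventually `|f_k - g| ≤ δ` a.e.; BGSR Thm 2.2) to a continuous
`g` with `|g| ≤ R M_β`, then `∫ f_k φ → ∬ φ g dx dv` for every bounded continuous `φ`
(majorant `(C ⊔ 0) ‖φ‖_∞ M_β`, integrable since `T^d` has finite volume; Fubini for the limit).
[folklore] -/
theorem tendsto_integral_mul_of_maxwellian_dominated {β : ℝ} (hβ : 0 < β)
    (f : ℕ → 𝕋 × 𝔼 → ℝ) (g : 𝕋 × 𝔼 → ℝ) (hf : ∀ k, Measurable (f k))
    (hg : Continuous g) {R : ℝ} (hgR : ∀ z, |g z| ≤ R * maxwellianBeta β z.2)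
    {C : ℝ} (hdom : ∀ᶠ k in atTop, ∀ z, |f k z| ≤ C * maxwellianBeta β z.2)
    (hconv : ∀ δ, 0 < δ → ∀ᶠ k in atTop, ∀ᵐ z : 𝕋 × 𝔼, |f k z - g z| ≤ δ)
    (φ : 𝕋 × 𝔼 → ℝ) (hφ : Continuous φ) (hφb : ∃ B, ∀ z, |φ z| ≤ B) :
    Tendsto (fun k => ∫ z, f k z * φ z) atTop (𝓝 (∫ x, ∫ v, φ (x, v) * g (x, v))) := by
  obtain ⟨B, hB⟩ := hφb
  set M : 𝔼 → ℝ := maxwellianBeta β with hM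
  have hMpos : ∀ v, 0 < M v := fun v => maxwellianBeta_pos hβ v
  have hMint : Integrable (fun z : 𝕋 × 𝔼 => M z.2) (volume : Measure (𝕋 × 𝔼)) :=
    (integrable_maxwellianBeta hβ).comp_snd volume
  set C' : ℝ := max C 0 with hC'
  have hC'0 : 0 ≤ C' := le_max_right _ _
  -- the limit value, by Fubini
  have hlim_int : Integrable (fun z : 𝕋 × 𝔼 => φ z * g z) (volume : Measure (𝕋 × 𝔼)) := by
    refine Integrable.mono' (hMint.const_mul (B * R))
      (hφ.aestronglyMeasurable.mul hg.aestronglyMeasurable) (Eventually.of_forall fun z => ?_)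
    rw [norm_mul, Real.norm_eq_abs, Real.norm_eq_abs]
    calc |φ z| * |g z| ≤ B * (R * M z.2) :=
          mul_le_mul (hB z) (hgR z) (abs_nonneg _) ((abs_nonneg _).trans (hB z))
      _ = B * R * M z.2 := by ring
  have h_val : ∫ x, ∫ v, φ (x, v) * g (x, v) = ∫ z, g z * φ z ∂(volume : Measure (𝕋 × 𝔼)) := by
    have h := integral_prod (μ := (volume : Measure 𝕋)) (ν := (volume : Measure 𝔼)) _ hlim_int
    rw [show (fun z : 𝕋 × 𝔼 => g z * φ z) = fun z => φ z * g z from funext fun z => mul_comm _ _]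
    exact h.symm
  rw [h_val]
  -- dominated convergence
  refine tendsto_integral_filter_of_dominated_convergence (fun z => C' * M z.2 * B) ?_ ?_ ?_ ?_
  · exact Eventually.of_forall fun k => ((hf k).aestronglyMeasurable).mul hφ.aestronglyMeasurable
  · filter_upwards [hdom] with k hk
    refine Eventually.of_forall fun z => ?_
    rw [norm_mul, Real.norm_eq_abs, Real.norm_eq_abs]
    have h1 : |f k z| ≤ C' * M z.2 :=
      (hk z).trans (mul_le_mul_of_nonneg_right (le_max_left _ _) (hMpos _).le)
    exact mul_le_mul h1 (hB z) (abs_nonneg _) (mul_nonneg hC'0 (hMpos _).le)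
  · exact (hMint.const_mul C').mul_const B
  · have hae := ae_tendsto_of_forall_eventually_ae_le (μ := (volume : Measure (𝕋 × 𝔼))) hconv
    filter_upwards [hae] with z hz
    exact hz.mul_const (φ z)

end WeakConvergence

/-! ## Positivity of the partition function (BGSR Appendix A, first step) -/

section Partition

variable {ε β : ℝ} {n N : ℕ}

omit [Fintype d] in
/-- The `ε`-neighbourhood of a point for the minimal-image Euclidean distance of `T^d` lies in the
closed `ε`-ball of the product (sup) metric: each coordinate of the symmetric representative is
bounded by its Euclidean norm. [folklore] -/
theorem setOf_euclidDist_lt_subset_closedBall [Fintype d] (x₀ : 𝕋) (hε : 0 ≤ ε) :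
    {x : 𝕋 | Torus.euclidDist x x₀ < ε} ⊆ Metric.closedBall x₀ ε := by
  intro x hx
  rw [Metric.mem_closedBall, dist_pi_le_iff hε]
  intro i
  rw [dist_eq_norm, ← Pi.sub_apply, ← Torus.abs_reprSym_apply]
  have h := PiLp.norm_apply_le (Torus.reprSym (x - x₀)) i
  rw [Real.norm_eq_abs] at h
  exact h.trans (le_of_lt hx)

/-- The volume of an `ε`-neighbourhood in `T^d` is at most `(2ε)^d` (product of arcs of length
`min 1 (2ε)`, `AddCircle.volume_closedBall`; BGSR Appendix A uses the exact Euclidean value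
`κ_d ε^d`, any bound `O(ε^d)` suffices). [folklore] -/
theorem volume_setOf_euclidDist_lt_le (x₀ : 𝕋) (hε : 0 ≤ ε) :
    volume {x : 𝕋 | Torus.euclidDist x x₀ < ε} ≤ ENNReal.ofReal ((2 * ε) ^ Fintype.card d) := by
  haveI : ∀ _i : d, SigmaFinite (volume : Measure UnitAddCircle) := fun _ => inferInstance
  refine (measure_mono (setOf_euclidDist_lt_subset_closedBall x₀ hε)).trans ?_
  rw [volume_pi, Measure.pi_closedBall (fun _ : d => (volume : Measure UnitAddCircle)) x₀ hε]
  simp only [AddCircle.volume_closedBall, Finset.prod_const, Finset.card_univ]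
  rw [ENNReal.ofReal_pow (by positivity)]
  gcongr
  exact min_le_right _ _

/-- The volume bound in real form. [folklore] -/
theorem volume_real_setOf_euclidDist_lt_le (x₀ : 𝕋) (hε : 0 ≤ ε) :
    (volume : Measure 𝕋).real {x : 𝕋 | Torus.euclidDist x x₀ < ε} ≤ (2 * ε) ^ Fintype.card d :=
  ENNReal.toReal_le_of_le_ofReal (by positivity) (volume_setOf_euclidDist_lt_le x₀ hε)

/-- Adjoining a tagged particle at distance `≥ ε` from all others to a configuration of the
hard-sphere domain gives a configuration of the hard-sphere domain. [folklore] -/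
theorem cons_mem_hardSphereDomain {zm : Config n d 𝕋}
    (hzm : zm ∈ hardSphereDomain (Torus.geometry d) n ε) {y : 𝕋 × 𝔼}
    (hy : ∀ j, ε ≤ Torus.euclidDist y.1 (zm j).1) :
    (Fin.cons y zm : Config (n + 1) d 𝕋) ∈ hardSphereDomain (Torus.geometry d) (n + 1) ε := by
  rw [mem_hardSphereDomain]
  intro i j hij
  rw [Torus.norm_geometry_sepVec]
  induction i using Fin.cases with
  | zero =>
    induction j using Fin.cases with
    | zero => exact absurd rfl hij
    | succ j' => simpa using hy j'
  | succ i' =>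
    induction j using Fin.cases with
    | zero =>
      rw [Fin.cons_succ, Fin.cons_zero, Torus.euclidDist_comm]
      exact hy i'
    | succ j' =>
      rw [Fin.cons_succ, Fin.cons_succ, ← Torus.norm_geometry_sepVec]
      exact (mem_hardSphereDomain.1 hzm) i' j' fun h => hij (by rw [h])

/-- The set of admissible positions for a new particle is measurable. [folklore] -/
theorem measurableSet_setOf_forall_le_euclidDist (zm : Config n d 𝕋) (ε : ℝ) :
    MeasurableSet {x : 𝕋 | ∀ j, ε ≤ Torus.euclidDist x (zm j).1} := by
  have h : ∀ j, MeasurableSet {x : 𝕋 | ε ≤ Torus.euclidDist x (zm j).1} := fun j => by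
    refine measurableSet_le measurable_const ?_
    change Measurable fun x : 𝕋 => ‖Torus.reprSym (x - (zm j).1)‖
    exact (Torus.measurable_reprSym.comp (measurable_id.sub_const _)).norm
  convert MeasurableSet.iInter h using 1
  ext x
  simp

/-- **The union bound of BGSR Appendix A**: the positions at distance `≥ ε` from `n` given points
have volume at least `1 - n (2ε)^d` (printed with `κ_d ε^d`).
[cite: BodineauGallagherSaintRaymondInvent2016, Appendix A (first step)] -/
theorem volume_real_setOf_forall_le_euclidDist_ge (hε : 0 ≤ ε) (zm : Config n d 𝕋) :
    1 - n * (2 * ε) ^ Fintype.card d ≤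
      (volume : Measure 𝕋).real {x : 𝕋 | ∀ j, ε ≤ Torus.euclidDist x (zm j).1} := by
  set S : Set 𝕋 := {x : 𝕋 | ∀ j, ε ≤ Torus.euclidDist x (zm j).1} with hS
  have hS_meas : MeasurableSet S := measurableSet_setOf_forall_le_euclidDist zm ε
  have hcompl : (volume : Measure 𝕋).real S + (volume : Measure 𝕋).real Sᶜ = 1 := by
    rw [measureReal_add_measureReal_compl hS_meas, probReal_univ]
  have hSc : Sᶜ = ⋃ j : Fin n, {x : 𝕋 | Torus.euclidDist x (zm j).1 < ε} := by
    ext x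
    simp [hS, not_le]
  have hle : (volume : Measure 𝕋).real Sᶜ ≤ n * (2 * ε) ^ Fintype.card d := by
    rw [hSc]
    refine (measureReal_iUnion_fintype_le _).trans ?_
    calc ∑ j : Fin n, (volume : Measure 𝕋).real {x : 𝕋 | Torus.euclidDist x (zm j).1 < ε}
        ≤ ∑ _j : Fin n, (2 * ε) ^ Fintype.card d :=
          Finset.sum_le_sum fun j _ => volume_real_setOf_euclidDist_lt_le _ hε
      _ = n * (2 * ε) ^ Fintype.card d := by simp
  linarith

/-- `∫∫ 1_S(x) M_β(v) c dx dv = |S| c` on `T^d × ℝ^d`. [folklore] -/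
theorem integral_indicator_fst_mul_maxwellianBeta (hβ : 0 < β) {S : Set 𝕋} (hS : MeasurableSet S)
    (c : ℝ) :
    ∫ y : 𝕋 × 𝔼, S.indicator (fun _ => (1 : ℝ)) y.1 * maxwellianBeta β y.2 * c =
      (volume : Measure 𝕋).real S * c := by
  rw [integral_mul_const, Measure.volume_eq_prod,
    integral_prod_mul (fun x : 𝕋 => S.indicator (fun _ => (1 : ℝ)) x) (maxwellianBeta β),
    integral_maxwellianBeta hβ, mul_one]
  congr 1
  exact integral_indicator_one hS

/-- For a fixed background `Z'`, `z₀ ↦ 1_{D_ε^{n+1}} M_β^{⊗(n+1)}(z₀, Z')` is integrable. [folklore] -/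
theorem integrable_indicator_tensorPow_cons (hβ : 0 < β) (zm : Config n d 𝕋) :
    Integrable fun y : 𝕋 × 𝔼 => (hardSphereDomain (Torus.geometry d) (n + 1) ε).indicator
      (tensorPow (n + 1) fun p : 𝕋 × 𝔼 => maxwellianBeta β p.2) (Fin.cons y zm) := by
  have hcons : Measurable fun y : 𝕋 × 𝔼 => (Fin.cons y zm : Config (n + 1) d 𝕋) :=
    measurable_finCons.comp (measurable_id.prodMk measurable_const)
  have h0 : ∀ w : Config (n + 1) d 𝕋, 0 ≤ tensorPow (n + 1) (fun p : 𝕋 × 𝔼 => maxwellianBeta β p.2) w :=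
    fun w => tensorPow_nonneg (fun p => (maxwellianBeta_pos hβ p.2).le) (n + 1) w
  refine Integrable.mono' (((integrable_maxwellianBeta hβ).comp_snd volume).mul_const
      (tensorPow n (fun p : 𝕋 × 𝔼 => maxwellianBeta β p.2) zm))
    (((measurable_tensorPow_maxwellianBeta β (n + 1)).indicator
      (measurableSet_hardSphereDomain_torus (n + 1) ε)).comp hcons).aestronglyMeasurable
    (Eventually.of_forall fun y => ?_)
  rw [Real.norm_eq_abs, abs_of_nonneg (Set.indicator_nonneg (fun w _ => h0 w) _)]
  exact (Set.indicator_le_self' (fun w _ => h0 w) _).trans_eq (tensorPow_cons _ y zm)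

/-- **The exclusion step of BGSR Appendix A** (`∫_{T^d} ∏_{i ≤ s} 1_{|x_i - x_{s+1}| > ε} dx_{s+1} ≥
1 - κ_d s ε^d`, here with `(2ε)^d` for `κ_d ε^d`): integrating out a particle adjoined to a
configuration `Z'` of `n` spheres costs at most the excluded volume,
`∫ 1_{D_ε^{n+1}} M_β^{⊗(n+1)}(z₀, Z') dz₀ ≥ (1 - n (2ε)^d) 1_{D_ε^n} M_β^{⊗n}(Z')`.
[cite: BodineauGallagherSaintRaymondInvent2016, Appendix A (first step)] -/
theorem integral_indicator_tensorPow_cons_ge (hβ : 0 < β) (hε : 0 ≤ ε) (zm : Config n d 𝕋) :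
    (1 - n * (2 * ε) ^ Fintype.card d) * (hardSphereDomain (Torus.geometry d) n ε).indicator
        (tensorPow n fun p : 𝕋 × 𝔼 => maxwellianBeta β p.2) zm ≤
      ∫ y : 𝕋 × 𝔼, (hardSphereDomain (Torus.geometry d) (n + 1) ε).indicator
        (tensorPow (n + 1) fun p : 𝕋 × 𝔼 => maxwellianBeta β p.2) (Fin.cons y zm) := by
  have hTn0 : 0 ≤ tensorPow n (fun p : 𝕋 × 𝔼 => maxwellianBeta β p.2) zm :=
    tensorPow_nonneg (fun p => (maxwellianBeta_pos hβ p.2).le) n zm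
  have hT0 : ∀ w : Config (n + 1) d 𝕋, 0 ≤ tensorPow (n + 1) (fun p : 𝕋 × 𝔼 => maxwellianBeta β p.2) w :=
    fun w => tensorPow_nonneg (fun p => (maxwellianBeta_pos hβ p.2).le) (n + 1) w
  by_cases hzm : zm ∈ hardSphereDomain (Torus.geometry d) n ε
  swap
  · rw [indicator_of_notMem hzm, mul_zero]
    exact integral_nonneg fun y => Set.indicator_nonneg (fun w _ => hT0 w) _
  rw [indicator_of_mem hzm]
  set S : Set 𝕋 := {x : 𝕋 | ∀ j, ε ≤ Torus.euclidDist x (zm j).1} with hS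
  -- pointwise lower bound `1_S(x) M_β(v) Tₙ(Z') ≤ 1_D T(z₀, Z')`
  have hlow : ∀ y : 𝕋 × 𝔼, S.indicator (fun _ => (1 : ℝ)) y.1 * maxwellianBeta β y.2 *
      tensorPow n (fun p : 𝕋 × 𝔼 => maxwellianBeta β p.2) zm ≤
      (hardSphereDomain (Torus.geometry d) (n + 1) ε).indicator
        (tensorPow (n + 1) fun p : 𝕋 × 𝔼 => maxwellianBeta β p.2) (Fin.cons y zm) := by
    intro y
    by_cases hy : y.1 ∈ S
    · rw [indicator_of_mem hy, one_mul, indicator_of_mem (cons_mem_hardSphereDomain hzm hy),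
        tensorPow_cons]
    · rw [indicator_of_notMem hy, zero_mul, zero_mul]
      exact Set.indicator_nonneg (fun w _ => hT0 w) _
  calc (1 - n * (2 * ε) ^ Fintype.card d) * tensorPow n (fun p : 𝕋 × 𝔼 => maxwellianBeta β p.2) zm
      ≤ (volume : Measure 𝕋).real S * tensorPow n (fun p : 𝕋 × 𝔼 => maxwellianBeta β p.2) zm :=
        mul_le_mul_of_nonneg_right (volume_real_setOf_forall_le_euclidDist_ge hε zm) hTn0
    _ = ∫ y : 𝕋 × 𝔼, S.indicator (fun _ => (1 : ℝ)) y.1 * maxwellianBeta β y.2 *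
          tensorPow n (fun p : 𝕋 × 𝔼 => maxwellianBeta β p.2) zm :=
        (integral_indicator_fst_mul_maxwellianBeta hβ
          (measurableSet_setOf_forall_le_euclidDist zm ε) _).symm
    _ ≤ ∫ y : 𝕋 × 𝔼, (hardSphereDomain (Torus.geometry d) (n + 1) ε).indicator
          (tensorPow (n + 1) fun p : 𝕋 × 𝔼 => maxwellianBeta β p.2) (Fin.cons y zm) :=
        integral_mono_of_nonneg (Eventually.of_forall fun y => mul_nonneg (mul_nonneg
          (Set.indicator_nonneg (fun _ _ => zero_le_one) _) (maxwellianBeta_pos hβ _).le) hTn0)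
          (integrable_indicator_tensorPow_cons hβ zm) (Eventually.of_forall hlow)

/-- `𝒵_{n+1}` by integrating out the tagged particle last (Fubini):
`𝒵_{n+1} = ∫ dZ' ∫ dz₀ 1_{D_ε^{n+1}} M_β^{⊗(n+1)}(z₀, Z')`. [folklore] -/
theorem canonicalPartition_succ_eq_integral_integral (hβ : 0 < β) (n : ℕ) :
    canonicalPartition (Torus.geometry d) ε (n + 1) (fun p : 𝕋 × 𝔼 => maxwellianBeta β p.2) =
      ∫ zm : Config n d 𝕋, ∫ y : 𝕋 × 𝔼, (hardSphereDomain (Torus.geometry d) (n + 1) ε).indicator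
        (tensorPow (n + 1) fun p : 𝕋 × 𝔼 => maxwellianBeta β p.2) (Fin.cons y zm) := by
  have hes : MeasurePreserving
      (MeasurableEquiv.piFinSuccAbove (fun _ : Fin (n + 1) => 𝕋 × 𝔼) 0).symm volume volume :=
    (volume_preserving_piFinSuccAbove (fun _ : Fin (n + 1) => 𝕋 × 𝔼) 0).symm _
  have hint : Integrable ((hardSphereDomain (Torus.geometry d) (n + 1) ε).indicator
      (tensorPow (n + 1) fun p : 𝕋 × 𝔼 => maxwellianBeta β p.2)) :=
    (integrable_tensorPow_maxwellianBeta hβ (n + 1)).indicator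
      (measurableSet_hardSphereDomain_torus (n + 1) ε)
  have hint' : Integrable (fun p : (𝕋 × 𝔼) × Config n d 𝕋 =>
      (hardSphereDomain (Torus.geometry d) (n + 1) ε).indicator
        (tensorPow (n + 1) fun p : 𝕋 × 𝔼 => maxwellianBeta β p.2)
        ((MeasurableEquiv.piFinSuccAbove (fun _ : Fin (n + 1) => 𝕋 × 𝔼) 0).symm p))
      ((volume : Measure (𝕋 × 𝔼)).prod (volume : Measure (Config n d 𝕋))) :=
    (hes.integrable_comp_emb (MeasurableEquiv.measurableEmbedding _)).2 hint
  rw [canonicalPartition, ← hes.integral_comp']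
  change ∫ p, (hardSphereDomain (Torus.geometry d) (n + 1) ε).indicator
      (tensorPow (n + 1) fun p : 𝕋 × 𝔼 => maxwellianBeta β p.2)
      ((MeasurableEquiv.piFinSuccAbove (fun _ : Fin (n + 1) => 𝕋 × 𝔼) 0).symm p)
    ∂(volume : Measure (𝕋 × 𝔼)).prod (volume : Measure (Config n d 𝕋)) = _
  rw [integral_prod_symm _ hint']
  simp only [piFinSuccAbove_zero_symm_apply]

/-- The inner integral of the previous lemma is integrable in the background `Z'`. [folklore] -/
theorem integrable_integral_indicator_tensorPow_cons (hβ : 0 < β) (n : ℕ) :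
    Integrable fun zm : Config n d 𝕋 => ∫ y : 𝕋 × 𝔼,
      (hardSphereDomain (Torus.geometry d) (n + 1) ε).indicator
        (tensorPow (n + 1) fun p : 𝕋 × 𝔼 => maxwellianBeta β p.2) (Fin.cons y zm) := by
  have hes : MeasurePreserving
      (MeasurableEquiv.piFinSuccAbove (fun _ : Fin (n + 1) => 𝕋 × 𝔼) 0).symm volume volume :=
    (volume_preserving_piFinSuccAbove (fun _ : Fin (n + 1) => 𝕋 × 𝔼) 0).symm _
  have hint : Integrable ((hardSphereDomain (Torus.geometry d) (n + 1) ε).indicator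
      (tensorPow (n + 1) fun p : 𝕋 × 𝔼 => maxwellianBeta β p.2)) :=
    (integrable_tensorPow_maxwellianBeta hβ (n + 1)).indicator
      (measurableSet_hardSphereDomain_torus (n + 1) ε)
  have hint' : Integrable (fun p : (𝕋 × 𝔼) × Config n d 𝕋 =>
      (hardSphereDomain (Torus.geometry d) (n + 1) ε).indicator
        (tensorPow (n + 1) fun p : 𝕋 × 𝔼 => maxwellianBeta β p.2)
        ((MeasurableEquiv.piFinSuccAbove (fun _ : Fin (n + 1) => 𝕋 × 𝔼) 0).symm p))
      ((volume : Measure (𝕋 × 𝔼)).prod (volume : Measure (Config n d 𝕋))) :=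
    (hes.integrable_comp_emb (MeasurableEquiv.measurableEmbedding _)).2 hint
  refine hint'.integral_prod_right.congr (Eventually.of_forall fun zm => ?_)
  simp only [piFinSuccAbove_zero_symm_apply]

/-- **BGSR Appendix A, (A.1), one step**: `𝒵_{n+1} ≥ (1 - n (2ε)^d) 𝒵_n` for the hard-sphere
partition functions of the Maxwellian on `T^d` (Fubini, then the exclusion step).
[cite: BodineauGallagherSaintRaymondInvent2016, Appendix A (A.1)] -/
theorem canonicalPartition_succ_ge (hβ : 0 < β) (hε : 0 ≤ ε) (n : ℕ) :
    (1 - n * (2 * ε) ^ Fintype.card d) *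
        canonicalPartition (Torus.geometry d) ε n (fun p : 𝕋 × 𝔼 => maxwellianBeta β p.2) ≤
      canonicalPartition (Torus.geometry d) ε (n + 1) (fun p : 𝕋 × 𝔼 => maxwellianBeta β p.2) := by
  rw [canonicalPartition_succ_eq_integral_integral hβ n, canonicalPartition, ← integral_const_mul]
  exact integral_mono (((integrable_tensorPow_maxwellianBeta hβ n).indicator
      (measurableSet_hardSphereDomain_torus n ε)).const_mul _)
    (integrable_integral_indicator_tensorPow_cons hβ n)
    fun zm => integral_indicator_tensorPow_cons_ge hβ hε zm

/-- The partition function of no particles is `1`. [folklore] -/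
theorem canonicalPartition_zero (ε : ℝ) (f : 𝕋 × 𝔼 → ℝ) :
    canonicalPartition (Torus.geometry d) ε 0 f = 1 := by
  rw [canonicalPartition]
  have h1 : (fun z : Config 0 d 𝕋 => (hardSphereDomain (Torus.geometry d) 0 ε).indicator
      (tensorPow 0 f) z) = fun _ => 1 := by
    funext z
    rw [indicator_of_mem (fun i => Fin.elim0 i), tensorPow_zero]
  rw [h1, Measure.volume_pi_eq_dirac]
  simp

/-- **Positivity of the partition function for small excluded volume** (BGSR Appendix A (A.1):
`𝒵_N ≥ 𝒵_{N-s}(1 - εακ_d)^s`, in particular `𝒵_N > 0` once `εακ_d < 1`): if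
`N (2ε)^d < 1` then `𝒵_n > 0` for all `n ≤ N + 1`.
[cite: BodineauGallagherSaintRaymondInvent2016, Appendix A (A.1)] -/
theorem canonicalPartition_pos_of_lt (hβ : 0 < β) (hε : 0 ≤ ε) {N : ℕ}
    (hN : (N : ℝ) * (2 * ε) ^ Fintype.card d < 1) :
    ∀ n ≤ N + 1, 0 < canonicalPartition (Torus.geometry d) ε n (fun p : 𝕋 × 𝔼 => maxwellianBeta β p.2) := by
  intro n
  induction n with
  | zero => intro; rw [canonicalPartition_zero]; exact one_pos
  | succ m ih =>
    intro hm
    have hm' : (m : ℝ) * (2 * ε) ^ Fintype.card d < 1 := by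
      refine lt_of_le_of_lt (mul_le_mul_of_nonneg_right ?_ (by positivity)) hN
      exact_mod_cast (Nat.le_of_succ_le_succ hm)
    exact lt_of_lt_of_le (mul_pos (by linarith) (ih (Nat.le_of_succ_le hm)))
      (canonicalPartition_succ_ge hβ hε m)

/-- **The partition function is eventually positive along a Boltzmann–Grad sequence** (BGSR
Appendix A (A.1) in the scaling `N ε^{d-1} ≡ α`, `α ≪ 1/ε`): along an exact Boltzmann–Grad sequence
`(N_k + 1) ε_k^{d-1} = α` on `T^d`, `d ≥ 2`, the excluded volume `N_k (2ε_k)^d ≤ 2^d α ε_k` tends to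
`0`, so `𝒵_{N_k+1} > 0` eventually (`Kinetic.equilibriumTaggedPartition`); in particular BGSR's
datum (2.8) is eventually a genuine probability density.
[cite: BodineauGallagherSaintRaymondInvent2016, Appendix A (A.1)] -/
theorem equilibriumTaggedPartition_eventually_pos (hd : 2 ≤ Fintype.card d) {β : ℝ} (hβ : 0 < β)
    {α : ℝ} (N : ℕ → ℕ) (ε : ℕ → ℝ)
    (hNε : Literature.Analysis.FluidPDE.IsBoltzmannGradSequenceExact d α (fun k => N k + 1) ε) :
    ∀ᶠ k in atTop, 0 < Literature.Analysis.FunctionSpaces.equilibriumTaggedPartition (Torus.geometry d) (ε k) (N k) β := by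
  obtain ⟨hpos, hε0, hexact⟩ := hNε
  obtain ⟨c, hc⟩ : ∃ c, Fintype.card d = c + 1 := ⟨Fintype.card d - 1, by omega⟩
  -- the excluded volume `N_k (2 ε_k)^d ≤ 2^d α ε_k` tends to `0`
  have hbound : ∀ k, (N k : ℝ) * (2 * ε k) ^ Fintype.card d ≤ 2 ^ Fintype.card d * α * ε k := by
    intro k
    have hk : ((N k : ℝ) + 1) * ε k ^ c = α := by
      have h := hexact k
      simp only [hc, Nat.add_sub_cancel] at h
      exact_mod_cast h
    rw [hc]
    have hεk : 0 ≤ ε k := (hpos k).le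
    calc (N k : ℝ) * (2 * ε k) ^ (c + 1)
        = 2 ^ (c + 1) * ((N k : ℝ) * ε k ^ c) * ε k := by rw [mul_pow, pow_succ (ε k)]; ring
      _ ≤ 2 ^ (c + 1) * (((N k : ℝ) + 1) * ε k ^ c) * ε k := by gcongr; linarith
      _ = 2 ^ (c + 1) * α * ε k := by rw [hk]
  have hsmall : ∀ᶠ k in atTop, (N k : ℝ) * (2 * ε k) ^ Fintype.card d < 1 := by
    have ht : Tendsto (fun k => 2 ^ Fintype.card d * α * ε k) atTop (𝓝 0) := by
      simpa using hε0.const_mul (2 ^ Fintype.card d * α)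
    filter_upwards [ht.eventually (Iio_mem_nhds one_pos)] with k hk
    exact (hbound k).trans_lt hk
  filter_upwards [hsmall] with k hk
  exact canonicalPartition_pos_of_lt hβ (hpos k).le hk (N k + 1) le_rfl

end Partition

/-! ## Prop. 3.2 (upper half) and Prop. 4.1 for every `s`: the a priori bound (4.3) -/

section GeneralMarginals

variable {ε β : ℝ} {s m n : ℕ}

omit [Fintype d] in
/-- The background part of a configuration of the hard-sphere domain is in the hard-sphere
domain. [folklore] -/
theorem append_mem_hardSphereDomain_right [Fintype d] {zs : Config s d 𝕋} {zm : Config m d 𝕋}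
    (h : Fin.append zs zm ∈ hardSphereDomain (Torus.geometry d) (s + m) ε) :
    zm ∈ hardSphereDomain (Torus.geometry d) m ε := by
  rw [mem_hardSphereDomain] at h ⊢
  intro i j hij
  have h' := h (Fin.natAdd s i) (Fin.natAdd s j) fun heq => hij (by simpa using heq)
  simpa only [Fin.append_right] using h'

omit [Fintype d] in
/-- Juxtaposition with a fixed configuration is measurable. [folklore] -/
theorem measurable_finAppend [Fintype d] (zs : Config s d 𝕋) :
    Measurable fun zm : Config m d 𝕋 => (Fin.append zs zm : Config (s + m) d 𝕋) := by
  refine measurable_pi_iff.2 fun i => ?_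
  induction i using Fin.addCases with
  | left i => simpa only [Fin.append_left] using measurable_const
  | right j => simpa only [Fin.append_right] using measurable_pi_apply j

/-- **The exclusion volume bound behind BGSR Prop. 3.2 (upper half)**: integrating the Gibbs
weight of `s + m` spheres over the last `m` of them,
`∫ 1_{D_ε^{s+m}} M_β^{⊗(s+m)}(Z_s, Z') dZ' ≤ M_β^{⊗s}(V_s) 𝒵_m` (drop the constraints involving
`Z_s`; Appendix A, second step: `M_N^{(s)} = 𝒵_N⁻¹ 1_{D^s} M^{⊗s} (𝒵_{N-s} - 𝒵^♭)`).
[cite: BodineauGallagherSaintRaymondInvent2016, Appendix A (second step)] -/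
theorem marginal_indicator_tensorPow_le (hβ : 0 < β) (zs : Config s d 𝕋) :
    marginal s m ((hardSphereDomain (Torus.geometry d) (s + m) ε).indicator
        (tensorPow (s + m) fun p : 𝕋 × 𝔼 => maxwellianBeta β p.2)) zs ≤
      tensorPow s (fun p : 𝕋 × 𝔼 => maxwellianBeta β p.2) zs *
        canonicalPartition (Torus.geometry d) ε m (fun p : 𝕋 × 𝔼 => maxwellianBeta β p.2) := by
  have hM0 : ∀ (k : ℕ) (w : Config k d 𝕋), 0 ≤ tensorPow k (fun p : 𝕋 × 𝔼 => maxwellianBeta β p.2) w :=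
    fun k w => tensorPow_nonneg (fun p => (maxwellianBeta_pos hβ p.2).le) k w
  rw [marginal, canonicalPartition, ← integral_const_mul]
  refine integral_mono_of_nonneg (Eventually.of_forall fun zm => Set.indicator_nonneg (fun w _ => hM0 _ w) _)
    (((integrable_tensorPow_maxwellianBeta hβ m).indicator
      (measurableSet_hardSphereDomain_torus m ε)).const_mul _)
    (Eventually.of_forall fun zm => ?_)
  beta_reduce
  by_cases h : Fin.append zs zm ∈ hardSphereDomain (Torus.geometry d) (s + m) ε
  · rw [indicator_of_mem h, indicator_of_mem (append_mem_hardSphereDomain_right h), tensorPow_append]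
  · rw [indicator_of_notMem h]
    exact mul_nonneg (hM0 s zs) (Set.indicator_nonneg (fun w _ => hM0 _ w) _)

/-- **BGSR Appendix A (A.1), iterated**: `𝒵_{m+j} ≥ (1 - n (2ε)^d)^j 𝒵_m` whenever
`m + j ≤ n + 1` and `n (2ε)^d ≤ 1` (each step `𝒵_{k+1} ≥ (1 - k(2ε)^d) 𝒵_k`, `k ≤ n`).
[cite: BodineauGallagherSaintRaymondInvent2016, Appendix A (A.1)] -/
theorem canonicalPartition_add_ge (hβ : 0 < β) (hε : 0 ≤ ε) {n : ℕ} (hn : (n : ℝ) * (2 * ε) ^ Fintype.card d ≤ 1)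
    (m j : ℕ) (hmj : m + j ≤ n + 1) :
    (1 - n * (2 * ε) ^ Fintype.card d) ^ j *
        canonicalPartition (Torus.geometry d) ε m (fun p : 𝕋 × 𝔼 => maxwellianBeta β p.2) ≤
      canonicalPartition (Torus.geometry d) ε (m + j) (fun p : 𝕋 × 𝔼 => maxwellianBeta β p.2) := by
  induction j with
  | zero => simp
  | succ j ih =>
    have hj : m + j ≤ n := by omega
    have hstep := canonicalPartition_succ_ge (d := d) hβ hε (m + j) (β := β)
    have hfac : 1 - (n : ℝ) * (2 * ε) ^ Fintype.card d ≤ 1 - ((m + j : ℕ) : ℝ) * (2 * ε) ^ Fintype.card d := by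
      have : ((m + j : ℕ) : ℝ) ≤ n := by exact_mod_cast hj
      nlinarith [pow_nonneg (by positivity : (0 : ℝ) ≤ 2 * ε) (Fintype.card d)]
    have h0 : 0 ≤ 1 - (n : ℝ) * (2 * ε) ^ Fintype.card d := by linarith
    calc (1 - (n : ℝ) * (2 * ε) ^ Fintype.card d) ^ (j + 1) *
          canonicalPartition (Torus.geometry d) ε m (fun p : 𝕋 × 𝔼 => maxwellianBeta β p.2)
        = (1 - (n : ℝ) * (2 * ε) ^ Fintype.card d) * ((1 - (n : ℝ) * (2 * ε) ^ Fintype.card d) ^ j *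
            canonicalPartition (Torus.geometry d) ε m (fun p : 𝕋 × 𝔼 => maxwellianBeta β p.2)) := by
          ring
      _ ≤ (1 - ((m + j : ℕ) : ℝ) * (2 * ε) ^ Fintype.card d) *
            canonicalPartition (Torus.geometry d) ε (m + j) (fun p : 𝕋 × 𝔼 => maxwellianBeta β p.2) :=
          mul_le_mul hfac (ih (by omega)) (mul_nonneg (pow_nonneg h0 _)
            (canonicalPartition_maxwellianBeta_nonneg hβ)) (h0.trans hfac)
      _ ≤ canonicalPartition (Torus.geometry d) ε (m + j + 1) (fun p : 𝕋 × 𝔼 => maxwellianBeta β p.2) :=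
          hstep

/-- Reindexing a configuration along `Fin.cast` does not change the Gibbs weight. [folklore] -/
theorem indicator_tensorPow_comp_cast (β ε : ℝ) {k n : ℕ} (h : k = n) (z : Config k d 𝕋) :
    (hardSphereDomain (Torus.geometry d) n ε).indicator
        (tensorPow n fun p : 𝕋 × 𝔼 => maxwellianBeta β p.2) (fun i => z (Fin.cast h.symm i)) =
      (hardSphereDomain (Torus.geometry d) k ε).indicator
        (tensorPow k fun p : 𝕋 × 𝔼 => maxwellianBeta β p.2) z := by
  subst h
  simp only [Fin.cast_eq_self]

/-- Reindexing a configuration along `Fin.cast` does not change the Gibbs density. [folklore] -/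
theorem canonicalDensity_comp_cast (β ε : ℝ) {k n : ℕ} (h : k = n) (z : Config k d 𝕋) :
    canonicalDensity (Torus.geometry d) ε n (fun p : 𝕋 × 𝔼 => maxwellianBeta β p.2)
        (fun i => z (Fin.cast h.symm i)) =
      canonicalDensity (Torus.geometry d) ε k (fun p : 𝕋 × 𝔼 => maxwellianBeta β p.2) z := by
  subst h
  simp only [Fin.cast_eq_self]

/-- **BGSR Proposition 3.2, upper half, for every `s`**: the `s`-marginal of the hard-sphere
Gibbs measure of `n` spheres is dominated by the product Maxwellian,
`M^{(s)}_{n,β}(Z_s) ≤ 𝒵_n⁻¹ 𝒵_{n-s} M_β^{⊗s}(V_s)` (printed, Appendix A second step: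
`M_N^{(s)} = 𝒵_N⁻¹ 1_{D^s} M^{⊗s}(𝒵_{N-s} - 𝒵^♭)` with `𝒵^♭ ≥ 0`; the two-sided statement of
Prop. 3.2, `|(M^{(s)} - M^{⊗s}) 1_{D^s}| ≤ C^s εα M^{⊗s}`, also needs the bound on `𝒵^♭`).
[cite: BodineauGallagherSaintRaymondInvent2016, Prop. 3.2 / Appendix A] -/
theorem nthMarginal_canonicalDensity_le (hβ : 0 < β) {n s : ℕ} (hs : s ≤ n) (zs : Config s d 𝕋) :
    nthMarginal n s (canonicalDensity (Torus.geometry d) ε n fun p : 𝕋 × 𝔼 => maxwellianBeta β p.2) zs ≤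
      (canonicalPartition (Torus.geometry d) ε n fun p : 𝕋 × 𝔼 => maxwellianBeta β p.2)⁻¹ *
        canonicalPartition (Torus.geometry d) ε (n - s) (fun p : 𝕋 × 𝔼 => maxwellianBeta β p.2) *
        tensorPow s (fun p : 𝕋 × 𝔼 => maxwellianBeta β p.2) zs := by
  rw [nthMarginal, dif_pos hs]
  have hc : s + (n - s) = n := Nat.add_sub_of_le hs
  have hfun : (fun z : Config (s + (n - s)) d 𝕋 => canonicalDensity (Torus.geometry d) ε n
      (fun p : 𝕋 × 𝔼 => maxwellianBeta β p.2) fun i => z (Fin.cast hc.symm i)) =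
      canonicalDensity (Torus.geometry d) ε (s + (n - s)) fun p : 𝕋 × 𝔼 => maxwellianBeta β p.2 :=
    funext fun z => canonicalDensity_comp_cast β ε hc z
  rw [hfun]
  have hcd : (canonicalDensity (Torus.geometry d) ε (s + (n - s)) fun p : 𝕋 × 𝔼 => maxwellianBeta β p.2) =
      fun z => (canonicalPartition (Torus.geometry d) ε n fun p : 𝕋 × 𝔼 => maxwellianBeta β p.2)⁻¹ *
        (hardSphereDomain (Torus.geometry d) (s + (n - s)) ε).indicator
          (tensorPow (s + (n - s)) fun p : 𝕋 × 𝔼 => maxwellianBeta β p.2) z := by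
    funext z
    rw [canonicalDensity]
    congr 2
    conv_rhs => rw [← hc]
  rw [hcd, marginal, integral_const_mul, mul_assoc]
  refine mul_le_mul_of_nonneg_left ?_ (inv_nonneg.2 (canonicalPartition_maxwellianBeta_nonneg hβ))
  rw [mul_comm]
  exact marginal_indicator_tensorPow_le hβ zs

/-- **BGSR Proposition 3.2 (upper half) in the Boltzmann–Grad regime**: if `(n - 1)(2ε)^d ≤ 1/2`
(automatic in the scaling `n ε^{d-1} = α ≪ 1/ε`) then `M^{(s)}_{n,β} ≤ 2^s M_β^{⊗s}` for every
`s ≤ n` (printed: `M^{(s)}_{N,β} ≤ C^s M_β^{⊗s}` "provided that `αε ≪ 1`", from (A.1)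
`1 ≤ 𝒵_N⁻¹ 𝒵_{N-s} ≤ (1 - εακ_d)^{-s}`). [cite: BodineauGallagherSaintRaymondInvent2016, Prop. 3.2 with (A.1)] -/
theorem nthMarginal_canonicalDensity_le_two_pow (hβ : 0 < β) (hε : 0 ≤ ε) {n s : ℕ} (hs : s ≤ n)
    (hn : ((n - 1 : ℕ) : ℝ) * (2 * ε) ^ Fintype.card d ≤ 2⁻¹) (zs : Config s d 𝕋) :
    nthMarginal n s (canonicalDensity (Torus.geometry d) ε n fun p : 𝕋 × 𝔼 => maxwellianBeta β p.2) zs ≤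
      2 ^ s * tensorPow s (fun p : 𝕋 × 𝔼 => maxwellianBeta β p.2) zs := by
  have hT0 : 0 ≤ tensorPow s (fun p : 𝕋 × 𝔼 => maxwellianBeta β p.2) zs :=
    tensorPow_nonneg (fun p => (maxwellianBeta_pos hβ p.2).le) s zs
  refine (nthMarginal_canonicalDensity_le hβ hs zs).trans (mul_le_mul_of_nonneg_right ?_ hT0)
  -- `𝒵_n⁻¹ 𝒵_{n-s} ≤ 2^s` from `𝒵_n ≥ (1/2)^s 𝒵_{n-s}`
  set Zn := canonicalPartition (Torus.geometry d) ε n fun p : 𝕋 × 𝔼 => maxwellianBeta β p.2 with hZn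
  set Zm := canonicalPartition (Torus.geometry d) ε (n - s) fun p : 𝕋 × 𝔼 => maxwellianBeta β p.2 with hZm
  have hZm0 : 0 ≤ Zm := canonicalPartition_maxwellianBeta_nonneg hβ
  have hchain : (1 - ((n - 1 : ℕ) : ℝ) * (2 * ε) ^ Fintype.card d) ^ s * Zm ≤ Zn := by
    have h := canonicalPartition_add_ge (d := d) hβ hε (n := n - 1) (by linarith) (n - s) s (by omega)
    rwa [Nat.sub_add_cancel hs] at h
  have hhalf : (2⁻¹ : ℝ) ^ s * Zm ≤ Zn := by
    refine le_trans (mul_le_mul_of_nonneg_right (pow_le_pow_left₀ (by norm_num) (by linarith) s) hZm0) hchain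
  by_cases hZ : Zn = 0
  · rw [hZ, inv_zero, zero_mul]
    positivity
  · have hZpos : 0 < Zn := lt_of_le_of_ne (canonicalPartition_maxwellianBeta_nonneg hβ) (Ne.symm hZ)
    rw [inv_mul_le_iff₀ hZpos]
    calc Zm = 2 ^ s * ((2⁻¹ : ℝ) ^ s * Zm) := by rw [← mul_assoc, ← mul_pow]; norm_num
      _ ≤ 2 ^ s * Zn := mul_le_mul_of_nonneg_left hhalf (by positivity)
      _ = Zn * 2 ^ s := mul_comm _ _

/-- **BGSR Proposition 4.1 for every `s`** (raw form): the `s`-marginal of the transported datum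
is dominated by `‖ρ⁰‖_∞` times the `s`-marginal of the Gibbs measure,
`f_N^{(s)}(t, Z_s) ≤ ‖ρ⁰‖_∞ M^{(s)}_{N,β}(Z_s)` for every `t` and every `Z_s` (maximum principle
against the stationary Gibbs measure, then integration; printed: "`sup_t f_N^{(s)}(t, Z_s) ≤
M^{(s)}_{N,β}(Z_s) ‖ρ⁰‖_{L^∞}`"). [cite: BodineauGallagherSaintRaymondInvent2016, Prop. 4.1] -/
theorem nthMarginal_hsTransport_le (hβ : 0 < β) {N : ℕ} {ρ₀ : 𝕋 → ℝ} {R : ℝ}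
    (hρ₀0 : ∀ x, 0 ≤ ρ₀ x) (hR : ∀ x, ρ₀ x ≤ R)
    (Φ : HardSphereFlow (Torus.geometry d) ε (N + 1)) (t : ℝ) {s : ℕ} (hs : s ≤ N + 1)
    (zs : Config s d 𝕋) :
    nthMarginal (N + 1) s (Φ.good.indicator (hsTransport Φ t (bgsrInitialDensity ε N β ρ₀))) zs ≤
      R * nthMarginal (N + 1) s (canonicalDensity (Torus.geometry d) ε (N + 1)
        fun p : 𝕋 × 𝔼 => maxwellianBeta β p.2) zs := by
  rw [nthMarginal, dif_pos hs, nthMarginal, dif_pos hs, marginal, marginal, ← integral_const_mul]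
  have hc : s + (N + 1 - s) = N + 1 := Nat.add_sub_of_le hs
  -- integrability of the dominating Gibbs section
  have hmeas : Measurable fun zm : Config (N + 1 - s) d 𝕋 =>
      (fun i => Fin.append zs zm (Fin.cast hc.symm i) : Config (N + 1) d 𝕋) :=
    measurable_pi_iff.2 fun i => (measurable_pi_apply _).comp (measurable_finAppend zs)
  have hint : Integrable fun zm : Config (N + 1 - s) d 𝕋 => R * canonicalDensity (Torus.geometry d) ε (N + 1)
      (fun p : 𝕋 × 𝔼 => maxwellianBeta β p.2) (fun i => Fin.append zs zm (Fin.cast hc.symm i)) := by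
    refine Integrable.const_mul ?_ R
    refine Integrable.mono'
      ((integrable_tensorPow_maxwellianBeta hβ (N + 1 - s)).const_mul
        ((canonicalPartition (Torus.geometry d) ε (N + 1) fun p : 𝕋 × 𝔼 => maxwellianBeta β p.2)⁻¹ *
          tensorPow s (fun p : 𝕋 × 𝔼 => maxwellianBeta β p.2) zs))
      ((measurable_canonicalDensity_torus ε β (N + 1)).comp hmeas).aestronglyMeasurable
      (Eventually.of_forall fun zm => ?_)
    rw [Real.norm_eq_abs, abs_of_nonneg (canonicalDensity_maxwellianBeta_nonneg hβ _),
      canonicalDensity_comp_cast β ε hc]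
    refine (canonicalDensity_torus_le hβ _).trans ?_
    rw [tensorPow_append, mul_assoc]
    refine mul_le_mul_of_nonneg_right ?_ (mul_nonneg
      (tensorPow_nonneg (fun p => (maxwellianBeta_pos hβ p.2).le) s zs)
      (tensorPow_nonneg (fun p => (maxwellianBeta_pos hβ p.2).le) _ zm))
    -- `𝒵_{s+(N+1-s)}⁻¹ = 𝒵_{N+1}⁻¹`
    rw [hc]
  refine integral_mono_of_nonneg
    (Eventually.of_forall fun zm => indicator_hsTransport_bgsrInitialDensity_nonneg hβ hρ₀0 Φ t _)
    hint (Eventually.of_forall fun zm => indicator_hsTransport_bgsrInitialDensity_le hβ hρ₀0 hR Φ t _)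

/-- **BGSR (4.3) for the tagged system** (Prop. 4.1 with Prop. 3.2, raw constants): in the regime
`N (2ε)^d ≤ 1/2`, for every `s ≤ N + 1`, every `t` and every `Z_s`,
`f_N^{(s)}(t, Z_s) ≤ ‖ρ⁰‖_∞ 2^s M_β^{⊗s}(V_s)` (printed: `‖f_N^{(k)}(t)‖_{ε,k,β} ≤
C^k (β/2π)^{kd/2} ‖ρ⁰‖_∞`, i.e. `f_N^{(k)} ≤ C^k M_β^{⊗k} ‖ρ⁰‖_∞`).
[cite: BodineauGallagherSaintRaymondInvent2016, (4.3)] -/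
theorem nthMarginal_hsTransport_le_two_pow (hβ : 0 < β) (hε : 0 ≤ ε) {N : ℕ} {ρ₀ : 𝕋 → ℝ} {R : ℝ}
    (hρ₀0 : ∀ x, 0 ≤ ρ₀ x) (hR : ∀ x, ρ₀ x ≤ R)
    (hN : (N : ℝ) * (2 * ε) ^ Fintype.card d ≤ 2⁻¹)
    (Φ : HardSphereFlow (Torus.geometry d) ε (N + 1)) (t : ℝ) {s : ℕ} (hs : s ≤ N + 1)
    (zs : Config s d 𝕋) :
    nthMarginal (N + 1) s (Φ.good.indicator (hsTransport Φ t (bgsrInitialDensity ε N β ρ₀))) zs ≤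
      R * 2 ^ s * tensorPow s (fun p : 𝕋 × 𝔼 => maxwellianBeta β p.2) zs := by
  have hR0 : 0 ≤ R := (hρ₀0 0).trans (hR 0)
  refine (nthMarginal_hsTransport_le hβ hρ₀0 hR Φ t hs zs).trans ?_
  rw [mul_assoc]
  refine mul_le_mul_of_nonneg_left (nthMarginal_canonicalDensity_le_two_pow hβ hε hs ?_ zs) hR0
  simpa using hN

end GeneralMarginals

/-! ## Appendix A (second step): Prop. 3.2 two-sided and Prop. 3.3 for every `s` -/

section ExclusionLower

variable {ε β : ℝ} {s m n : ℕ}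

omit [Fintype d] in
/-- The coordinate split `(Fin (m+1) → Y) ≃ᵐ Y × (Fin m → Y)` at the coordinate `j` has inverse
`Fin.insertNth j`. [folklore] -/
theorem piFinSuccAbove_symm_apply_eq_insertNth {Y : Type*} [MeasurableSpace Y] (j : Fin (m + 1))
    (p : Y × (Fin m → Y)) :
    (MeasurableEquiv.piFinSuccAbove (fun _ : Fin (m + 1) => Y) j).symm p = Fin.insertNth j p.1 p.2 := by
  simp [MeasurableEquiv.piFinSuccAbove_symm_apply, Fin.insertNthEquiv]

omit [Fintype d] in
/-- Tensor powers factor along `Fin.insertNth`. [folklore] -/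
theorem tensorPow_insertNth [Fintype d] (f : 𝕋 × 𝔼 → ℝ) (j : Fin (m + 1)) (y : 𝕋 × 𝔼)
    (zr : Config m d 𝕋) :
    tensorPow (m + 1) f (Fin.insertNth j y zr) = f y * tensorPow m f zr := by
  simp [tensorPow, Fin.prod_univ_succAbove _ j, Fin.insertNth_apply_same, Fin.insertNth_apply_succAbove]

omit [Fintype d] in
/-- Removing a particle from a configuration of the hard-sphere domain gives a configuration of the
hard-sphere domain. [folklore] -/
theorem removeNth_mem_hardSphereDomain [Fintype d] (j : Fin (m + 1)) {z : Config (m + 1) d 𝕋}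
    (h : z ∈ hardSphereDomain (Torus.geometry d) (m + 1) ε) :
    (Fin.removeNth j z : Config m d 𝕋) ∈ hardSphereDomain (Torus.geometry d) m ε := by
  rw [mem_hardSphereDomain] at h ⊢
  intro i k hik
  exact h (j.succAbove i) (j.succAbove k) fun heq => hik (Fin.succAbove_right_injective heq)

omit [Fintype d] in
/-- The two parts of a juxtaposed configuration of the hard-sphere domain are admissible and all
cross distances are `≥ ε`; conversely. Here: the converse direction used for the exclusion
bound. [folklore] -/
theorem append_mem_hardSphereDomain [Fintype d] {zs : Config s d 𝕋} {zm : Config m d 𝕋}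
    (hzs : zs ∈ hardSphereDomain (Torus.geometry d) s ε)
    (hzm : zm ∈ hardSphereDomain (Torus.geometry d) m ε)
    (hcross : ∀ i j, ε ≤ Torus.euclidDist (zs i).1 (zm j).1) :
    Fin.append zs zm ∈ hardSphereDomain (Torus.geometry d) (s + m) ε := by
  rw [mem_hardSphereDomain] at hzs hzm ⊢
  intro i j hij
  rw [Torus.norm_geometry_sepVec]
  induction i using Fin.addCases with
  | left i =>
    induction j using Fin.addCases with
    | left j =>
      rw [Fin.append_left, Fin.append_left, ← Torus.norm_geometry_sepVec]
      exact hzs i j fun h => hij (by rw [h])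
    | right j =>
      rw [Fin.append_left, Fin.append_right]
      exact hcross i j
  | right i =>
    induction j using Fin.addCases with
    | left j =>
      rw [Fin.append_right, Fin.append_left, Torus.euclidDist_comm]
      exact hcross j i
    | right j =>
      rw [Fin.append_right, Fin.append_right, ← Torus.norm_geometry_sepVec]
      exact hzm i j fun h => hij (by rw [h])

/-- The set of configurations whose particle `j` is `ε`-close to a given point is measurable. [folklore] -/
theorem measurableSet_setOf_euclidDist_apply_lt (j : Fin m) (x₀ : 𝕋) (ε : ℝ) :
    MeasurableSet {zm : Config m d 𝕋 | Torus.euclidDist (zm j).1 x₀ < ε} := by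
  refine measurableSet_lt ?_ measurable_const
  change Measurable fun zm : Config m d 𝕋 => ‖Torus.reprSym ((zm j).1 - x₀)‖
  exact (Torus.measurable_reprSym.comp ((measurable_pi_apply j).fst.sub_const _)).norm

/-- **The excluded-volume integral of BGSR Appendix A (second step)**: for `m + 1` spheres with the
Gibbs weight, the weight of the configurations whose particle `j` is `ε`-close to a given point
is at most `(2ε)^d 𝒵_m` (printed with `κ_d ε^d`: integrate particle `j` first, over the
`ε`-neighbourhood, and bound the constraint on the others by `1_{D_ε^m}`).
[cite: BodineauGallagherSaintRaymondInvent2016, Appendix A (second step)] -/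
theorem integral_indicator_near_le (hβ : 0 < β) (hε : 0 ≤ ε) (x₀ : 𝕋) (j : Fin (m + 1)) :
    ∫ zm : Config (m + 1) d 𝕋, {zm : Config (m + 1) d 𝕋 | Torus.euclidDist (zm j).1 x₀ < ε}.indicator
        ((hardSphereDomain (Torus.geometry d) (m + 1) ε).indicator
          (tensorPow (m + 1) fun p : 𝕋 × 𝔼 => maxwellianBeta β p.2)) zm ≤
      (2 * ε) ^ Fintype.card d *
        canonicalPartition (Torus.geometry d) ε m (fun p : 𝕋 × 𝔼 => maxwellianBeta β p.2) := by
  set B : Set 𝕋 := {x : 𝕋 | Torus.euclidDist x x₀ < ε} with hB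
  have hBm : MeasurableSet B := by
    refine measurableSet_lt ?_ measurable_const
    change Measurable fun x : 𝕋 => ‖Torus.reprSym (x - x₀)‖
    exact (Torus.measurable_reprSym.comp (measurable_id.sub_const _)).norm
  have hT0 : ∀ (k : ℕ) (w : Config k d 𝕋), 0 ≤ tensorPow k (fun p : 𝕋 × 𝔼 => maxwellianBeta β p.2) w :=
    fun k w => tensorPow_nonneg (fun p => (maxwellianBeta_pos hβ p.2).le) k w
  -- dominating function, split along particle `j`
  set g : Config (m + 1) d 𝕋 → ℝ := fun zm =>
    (B.indicator (fun _ => (1 : ℝ)) (zm j).1 * maxwellianBeta β (zm j).2) *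
      (hardSphereDomain (Torus.geometry d) m ε).indicator
        (tensorPow m fun p : 𝕋 × 𝔼 => maxwellianBeta β p.2) (Fin.removeNth j zm) with hg
  have hle : ∀ zm, {zm : Config (m + 1) d 𝕋 | Torus.euclidDist (zm j).1 x₀ < ε}.indicator
      ((hardSphereDomain (Torus.geometry d) (m + 1) ε).indicator
        (tensorPow (m + 1) fun p : 𝕋 × 𝔼 => maxwellianBeta β p.2)) zm ≤ g zm := by
    intro zm
    have hg0 : 0 ≤ g zm := mul_nonneg (mul_nonneg (Set.indicator_nonneg (fun _ _ => zero_le_one) _)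
      (maxwellianBeta_pos hβ _).le) (Set.indicator_nonneg (fun w _ => hT0 _ w) _)
    by_cases hnear : zm ∈ {zm : Config (m + 1) d 𝕋 | Torus.euclidDist (zm j).1 x₀ < ε}
    swap
    · rw [indicator_of_notMem hnear]; exact hg0
    rw [indicator_of_mem hnear]
    by_cases hD : zm ∈ hardSphereDomain (Torus.geometry d) (m + 1) ε
    swap
    · rw [indicator_of_notMem hD]; exact hg0
    rw [indicator_of_mem hD, hg]
    beta_reduce
    rw [indicator_of_mem (show (zm j).1 ∈ B from hnear), one_mul,
      indicator_of_mem (removeNth_mem_hardSphereDomain j hD)]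
    conv_lhs => rw [← Fin.insertNth_self_removeNth j zm]
    rw [tensorPow_insertNth]
  -- integral of `g` by Fubini along particle `j`
  have hes : MeasurePreserving
      (MeasurableEquiv.piFinSuccAbove (fun _ : Fin (m + 1) => 𝕋 × 𝔼) j).symm volume volume :=
    (volume_preserving_piFinSuccAbove (fun _ : Fin (m + 1) => 𝕋 × 𝔼) j).symm _
  have hgs : ∀ p : (𝕋 × 𝔼) × Config m d 𝕋,
      g ((MeasurableEquiv.piFinSuccAbove (fun _ : Fin (m + 1) => 𝕋 × 𝔼) j).symm p) =
      (B.indicator (fun _ => (1 : ℝ)) p.1.1 * maxwellianBeta β p.1.2) *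
        (hardSphereDomain (Torus.geometry d) m ε).indicator
          (tensorPow m fun p : 𝕋 × 𝔼 => maxwellianBeta β p.2) p.2 := by
    intro p
    rw [piFinSuccAbove_symm_apply_eq_insertNth, hg]
    simp only [Fin.insertNth_apply_same, Fin.removeNth_insertNth]
  have hprod : ∫ zm, g zm = (volume : Measure 𝕋).real B *
      canonicalPartition (Torus.geometry d) ε m (fun p : 𝕋 × 𝔼 => maxwellianBeta β p.2) := by
    rw [← hes.integral_comp']
    change ∫ p, g ((MeasurableEquiv.piFinSuccAbove (fun _ : Fin (m + 1) => 𝕋 × 𝔼) j).symm p)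
      ∂(volume : Measure (𝕋 × 𝔼)).prod (volume : Measure (Config m d 𝕋)) = _
    simp_rw [hgs]
    rw [integral_prod_mul (fun y : 𝕋 × 𝔼 => B.indicator (fun _ => (1 : ℝ)) y.1 * maxwellianBeta β y.2)
      (fun zr : Config m d 𝕋 => (hardSphereDomain (Torus.geometry d) m ε).indicator
        (tensorPow m fun p : 𝕋 × 𝔼 => maxwellianBeta β p.2) zr), canonicalPartition]
    congr 1
    rw [Measure.volume_eq_prod, integral_prod_mul (fun x : 𝕋 => B.indicator (fun _ => (1 : ℝ)) x)
      (maxwellianBeta β), integral_maxwellianBeta hβ, mul_one]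
    exact integral_indicator_one hBm
  have hgi : Integrable g := by
    have h1 : Integrable (fun p : (𝕋 × 𝔼) × Config m d 𝕋 =>
        (B.indicator (fun _ => (1 : ℝ)) p.1.1 * maxwellianBeta β p.1.2) *
          (hardSphereDomain (Torus.geometry d) m ε).indicator
            (tensorPow m fun p : 𝕋 × 𝔼 => maxwellianBeta β p.2) p.2)
        ((volume : Measure (𝕋 × 𝔼)).prod (volume : Measure (Config m d 𝕋))) := by
      refine Integrable.mul_prod (f := fun y : 𝕋 × 𝔼 => B.indicator (fun _ => (1 : ℝ)) y.1 * maxwellianBeta β y.2)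
        (g := fun zr : Config m d 𝕋 => (hardSphereDomain (Torus.geometry d) m ε).indicator
          (tensorPow m fun p : 𝕋 × 𝔼 => maxwellianBeta β p.2) zr) ?_ ?_
      · refine Integrable.mono' ((integrable_maxwellianBeta hβ).comp_snd volume)
          (((measurable_const.indicator hBm).comp measurable_fst).mul
            ((measurable_maxwellianBeta β).comp measurable_snd)).aestronglyMeasurable
          (Eventually.of_forall fun y => ?_)
        rw [Real.norm_eq_abs, abs_of_nonneg (mul_nonneg (Set.indicator_nonneg (fun _ _ => zero_le_one) _)
          (maxwellianBeta_pos hβ _).le)]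
        refine mul_le_of_le_one_left (maxwellianBeta_pos hβ _).le ?_
        exact Set.indicator_le_self' (fun _ _ => zero_le_one) _ |>.trans le_rfl
      · exact (integrable_tensorPow_maxwellianBeta hβ m).indicator (measurableSet_hardSphereDomain_torus m ε)
    have h1' : Integrable (g ∘ (MeasurableEquiv.piFinSuccAbove (fun _ : Fin (m + 1) => 𝕋 × 𝔼) j).symm)
        ((volume : Measure (𝕋 × 𝔼)).prod (volume : Measure (Config m d 𝕋))) :=
      h1.congr (Eventually.of_forall fun p => (hgs p).symm)
    exact (hes.integrable_comp_emb (MeasurableEquiv.measurableEmbedding _)).1 h1'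
  calc ∫ zm, {zm : Config (m + 1) d 𝕋 | Torus.euclidDist (zm j).1 x₀ < ε}.indicator
        ((hardSphereDomain (Torus.geometry d) (m + 1) ε).indicator
          (tensorPow (m + 1) fun p : 𝕋 × 𝔼 => maxwellianBeta β p.2)) zm
      ≤ ∫ zm, g zm := integral_mono_of_nonneg (Eventually.of_forall fun zm => Set.indicator_nonneg
          (fun w _ => Set.indicator_nonneg (fun w _ => hT0 _ w) _) _) hgi (Eventually.of_forall hle)
    _ = (volume : Measure 𝕋).real B *
        canonicalPartition (Torus.geometry d) ε m (fun p : 𝕋 × 𝔼 => maxwellianBeta β p.2) := hprod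
    _ ≤ (2 * ε) ^ Fintype.card d *
        canonicalPartition (Torus.geometry d) ε m (fun p : 𝕋 × 𝔼 => maxwellianBeta β p.2) :=
        mul_le_mul_of_nonneg_right (volume_real_setOf_euclidDist_lt_le x₀ hε)
          (canonicalPartition_maxwellianBeta_nonneg hβ)

/-- The partition function decreases with the number of spheres: `𝒵_{k+1} ≤ 𝒵_k` (drop the
constraints involving the added sphere; BGSR Appendix A, "`𝒵_N ≤ 𝒵_{N-s}`").
[cite: BodineauGallagherSaintRaymondInvent2016, Appendix A (A.1)] -/
theorem canonicalPartition_succ_le (hβ : 0 < β) (k : ℕ) :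
    canonicalPartition (Torus.geometry d) ε (k + 1) (fun p : 𝕋 × 𝔼 => maxwellianBeta β p.2) ≤
      canonicalPartition (Torus.geometry d) ε k (fun p : 𝕋 × 𝔼 => maxwellianBeta β p.2) := by
  have hT0 : ∀ (l : ℕ) (w : Config l d 𝕋), 0 ≤ tensorPow l (fun p : 𝕋 × 𝔼 => maxwellianBeta β p.2) w :=
    fun l w => tensorPow_nonneg (fun p => (maxwellianBeta_pos hβ p.2).le) l w
  rw [canonicalPartition_succ_eq_integral_integral hβ k, canonicalPartition]
  refine integral_mono (integrable_integral_indicator_tensorPow_cons hβ k)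
    ((integrable_tensorPow_maxwellianBeta hβ k).indicator (measurableSet_hardSphereDomain_torus k ε))
    fun zm => ?_
  -- `∫ 1_D T (z₀, Z') dz₀ ≤ (∫ M) · 1_D T (Z')`
  have hpt : ∀ y : 𝕋 × 𝔼, (hardSphereDomain (Torus.geometry d) (k + 1) ε).indicator
      (tensorPow (k + 1) fun p : 𝕋 × 𝔼 => maxwellianBeta β p.2) (Fin.cons y zm) ≤
      maxwellianBeta β y.2 * (hardSphereDomain (Torus.geometry d) k ε).indicator
        (tensorPow k fun p : 𝕋 × 𝔼 => maxwellianBeta β p.2) zm := by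
    intro y
    by_cases h : (Fin.cons y zm : Config (k + 1) d 𝕋) ∈ hardSphereDomain (Torus.geometry d) (k + 1) ε
    · have hzm : zm ∈ hardSphereDomain (Torus.geometry d) k ε := by
        have h' := removeNth_mem_hardSphereDomain 0 h
        simpa [Fin.removeNth] using h'
      rw [indicator_of_mem h, indicator_of_mem hzm, tensorPow_cons]
    · rw [indicator_of_notMem h]
      exact mul_nonneg (maxwellianBeta_pos hβ _).le (Set.indicator_nonneg (fun w _ => hT0 _ w) _)
  calc ∫ y : 𝕋 × 𝔼, (hardSphereDomain (Torus.geometry d) (k + 1) ε).indicator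
        (tensorPow (k + 1) fun p : 𝕋 × 𝔼 => maxwellianBeta β p.2) (Fin.cons y zm)
      ≤ ∫ y : 𝕋 × 𝔼, maxwellianBeta β y.2 * (hardSphereDomain (Torus.geometry d) k ε).indicator
          (tensorPow k fun p : 𝕋 × 𝔼 => maxwellianBeta β p.2) zm :=
        integral_mono_of_nonneg (Eventually.of_forall fun y => Set.indicator_nonneg (fun w _ => hT0 _ w) _)
          (((integrable_maxwellianBeta hβ).comp_snd volume).mul_const _) (Eventually.of_forall hpt)
    _ = (hardSphereDomain (Torus.geometry d) k ε).indicator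
          (tensorPow k fun p : 𝕋 × 𝔼 => maxwellianBeta β p.2) zm := by
        have h1 : ∫ y : 𝕋 × 𝔼, maxwellianBeta β y.2 = 1 := by
          rw [Measure.volume_eq_prod, integral_fun_snd]
          simp [integral_maxwellianBeta hβ]
        rw [integral_mul_const, h1, one_mul]

/-- `𝒵_l ≤ 𝒵_k` for `k ≤ l`. [folklore] -/
theorem canonicalPartition_antitone (hβ : 0 < β) {k l : ℕ} (h : k ≤ l) :
    canonicalPartition (Torus.geometry d) ε l (fun p : 𝕋 × 𝔼 => maxwellianBeta β p.2) ≤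
      canonicalPartition (Torus.geometry d) ε k (fun p : 𝕋 × 𝔼 => maxwellianBeta β p.2) := by
  induction h with
  | refl => exact le_rfl
  | step _ ih => exact (canonicalPartition_succ_le hβ _).trans ih

/-- `𝒵_k ≤ 1`. [folklore] -/
theorem canonicalPartition_le_one (hβ : 0 < β) (k : ℕ) :
    canonicalPartition (Torus.geometry d) ε k (fun p : 𝕋 × 𝔼 => maxwellianBeta β p.2) ≤ 1 :=
  (canonicalPartition_antitone hβ (Nat.zero_le k)).trans_eq (canonicalPartition_zero ε _)

/-- **The lower exclusion bound of BGSR Appendix A (second step)**: for `Z_s ∈ D_ε^s`,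
`∫ 1_{D_ε^{s+m+1}} M_β^{⊗}(Z_s, Z') dZ' ≥ M_β^{⊗s}(V_s) (𝒵_{m+1} - s (m+1) (2ε)^d 𝒵_m)` (printed:
`M_N^{(s)} = 𝒵_N⁻¹ 1_{D^s} M^{⊗s}(𝒵_{N-s} - 𝒵^♭)` with
`𝒵^♭ ≤ ∑_{i ≤ s} ∑_j ∫ 1_{|x_i - x_j| < ε} ∏ 1_{|x_k - x_ℓ| > ε} ≤ s (N - s) κ_d ε^d 𝒵_{N-s-1}`).
[cite: BodineauGallagherSaintRaymondInvent2016, Appendix A (second step)] -/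
theorem marginal_indicator_tensorPow_ge (hβ : 0 < β) (hε : 0 ≤ ε) {zs : Config s d 𝕋}
    (hzs : zs ∈ hardSphereDomain (Torus.geometry d) s ε) (m : ℕ) :
    tensorPow s (fun p : 𝕋 × 𝔼 => maxwellianBeta β p.2) zs *
        (canonicalPartition (Torus.geometry d) ε (m + 1) (fun p : 𝕋 × 𝔼 => maxwellianBeta β p.2) -
          s * (m + 1) * (2 * ε) ^ Fintype.card d *
            canonicalPartition (Torus.geometry d) ε m (fun p : 𝕋 × 𝔼 => maxwellianBeta β p.2)) ≤
      marginal s (m + 1) ((hardSphereDomain (Torus.geometry d) (s + (m + 1)) ε).indicator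
        (tensorPow (s + (m + 1)) fun p : 𝕋 × 𝔼 => maxwellianBeta β p.2)) zs := by
  -- notation
  set Ts : ℝ := tensorPow s (fun p : 𝕋 × 𝔼 => maxwellianBeta β p.2) zs with hTs
  set Dm := hardSphereDomain (Torus.geometry d) (m + 1) ε with hDm
  set Tm : Config (m + 1) d 𝕋 → ℝ := tensorPow (m + 1) fun p : 𝕋 × 𝔼 => maxwellianBeta β p.2 with hTm
  set S : Fin s × Fin (m + 1) → Set (Config (m + 1) d 𝕋) :=
    fun q => {zm | Torus.euclidDist (zm q.2).1 (zs q.1).1 < ε} with hS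
  have hT0 : ∀ (l : ℕ) (w : Config l d 𝕋), 0 ≤ tensorPow l (fun p : 𝕋 × 𝔼 => maxwellianBeta β p.2) w :=
    fun l w => tensorPow_nonneg (fun p => (maxwellianBeta_pos hβ p.2).le) l w
  have hTs0 : 0 ≤ Ts := hT0 s zs
  have hind0 : ∀ zm, 0 ≤ Dm.indicator Tm zm := fun zm => Set.indicator_nonneg (fun w _ => hT0 _ w) _
  -- integrability of the pieces
  have hDT : Integrable (Dm.indicator Tm) :=
    (integrable_tensorPow_maxwellianBeta hβ (m + 1)).indicator (measurableSet_hardSphereDomain_torus (m + 1) ε)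
  have hSi : ∀ q, Integrable ((S q).indicator (Dm.indicator Tm)) := fun q =>
    hDT.indicator (measurableSet_setOf_euclidDist_apply_lt q.2 _ ε)
  -- the upper integrand and its integrability
  have hF : Integrable fun zm : Config (m + 1) d 𝕋 =>
      (hardSphereDomain (Torus.geometry d) (s + (m + 1)) ε).indicator
        (tensorPow (s + (m + 1)) fun p : 𝕋 × 𝔼 => maxwellianBeta β p.2) (Fin.append zs zm) := by
    refine Integrable.mono' (hDT.const_mul Ts)
      (((measurable_tensorPow_maxwellianBeta β (s + (m + 1))).indicator
        (measurableSet_hardSphereDomain_torus (s + (m + 1)) ε)).comp (measurable_finAppend zs)).aestronglyMeasurable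
      (Eventually.of_forall fun zm => ?_)
    rw [Real.norm_eq_abs, abs_of_nonneg (Set.indicator_nonneg (fun w _ => hT0 _ w) _)]
    by_cases h : Fin.append zs zm ∈ hardSphereDomain (Torus.geometry d) (s + (m + 1)) ε
    · rw [indicator_of_mem h, indicator_of_mem (append_mem_hardSphereDomain_right h), tensorPow_append]
    · rw [indicator_of_notMem h]
      exact mul_nonneg hTs0 (hind0 zm)
  -- pointwise lower bound
  have hpt : ∀ zm : Config (m + 1) d 𝕋,
      Ts * (Dm.indicator Tm zm - ∑ q, (S q).indicator (Dm.indicator Tm) zm) ≤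
      (hardSphereDomain (Torus.geometry d) (s + (m + 1)) ε).indicator
        (tensorPow (s + (m + 1)) fun p : 𝕋 × 𝔼 => maxwellianBeta β p.2) (Fin.append zs zm) := by
    intro zm
    have hsum0 : 0 ≤ ∑ q, (S q).indicator (Dm.indicator Tm) zm :=
      Finset.sum_nonneg fun q _ => Set.indicator_nonneg (fun w _ => hind0 w) _
    by_cases h : Fin.append zs zm ∈ hardSphereDomain (Torus.geometry d) (s + (m + 1)) ε
    · rw [indicator_of_mem h, tensorPow_append, indicator_of_mem (append_mem_hardSphereDomain_right h)]
      exact mul_le_mul_of_nonneg_left (by linarith) hTs0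
    · rw [indicator_of_notMem h]
      by_cases hzm : zm ∈ Dm
      · -- some cross pair is too close
        have hclose : ∃ q : Fin s × Fin (m + 1), zm ∈ S q := by
          by_contra hcon
          push Not at hcon
          refine h (append_mem_hardSphereDomain hzs hzm fun i j => ?_)
          have hij := hcon (i, j)
          simp only [hS, Set.mem_setOf_eq, not_lt] at hij
          rwa [Torus.euclidDist_comm] at hij
        obtain ⟨q, hq⟩ := hclose
        have hge : Dm.indicator Tm zm ≤ ∑ q, (S q).indicator (Dm.indicator Tm) zm := by
          refine le_trans (le_of_eq (indicator_of_mem hq _).symm)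
            (Finset.single_le_sum (fun q' _ => Set.indicator_nonneg (fun w _ => hind0 w) _) (Finset.mem_univ q))
        exact mul_nonpos_of_nonneg_of_nonpos hTs0 (by linarith)
      · have hz0 : Dm.indicator Tm zm = 0 := indicator_of_notMem hzm _
        have hs0 : ∑ q, (S q).indicator (Dm.indicator Tm) zm = 0 :=
          Finset.sum_eq_zero fun q _ => by
            by_cases hq : zm ∈ S q
            · rw [indicator_of_mem hq, hz0]
            · rw [indicator_of_notMem hq]
        rw [hz0, hs0, sub_zero, mul_zero]
  -- integrate
  have hLint : Integrable fun zm => Ts * (Dm.indicator Tm zm - ∑ q, (S q).indicator (Dm.indicator Tm) zm) :=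
    (hDT.sub (integrable_finsetSum _ fun q _ => hSi q)).const_mul Ts
  have hint_eq : ∫ zm, Ts * (Dm.indicator Tm zm - ∑ q, (S q).indicator (Dm.indicator Tm) zm) =
      Ts * (canonicalPartition (Torus.geometry d) ε (m + 1) (fun p : 𝕋 × 𝔼 => maxwellianBeta β p.2) -
        ∑ q, ∫ zm, (S q).indicator (Dm.indicator Tm) zm) := by
    rw [integral_const_mul, integral_sub hDT (integrable_finsetSum _ fun q _ => hSi q),
      integral_finsetSum _ fun q _ => hSi q, canonicalPartition]
  have hsum_le : ∑ q : Fin s × Fin (m + 1), ∫ zm, (S q).indicator (Dm.indicator Tm) zm ≤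
      s * (m + 1) * (2 * ε) ^ Fintype.card d *
        canonicalPartition (Torus.geometry d) ε m (fun p : 𝕋 × 𝔼 => maxwellianBeta β p.2) := by
    calc ∑ q : Fin s × Fin (m + 1), ∫ zm, (S q).indicator (Dm.indicator Tm) zm
        ≤ ∑ _q : Fin s × Fin (m + 1), (2 * ε) ^ Fintype.card d *
            canonicalPartition (Torus.geometry d) ε m (fun p : 𝕋 × 𝔼 => maxwellianBeta β p.2) :=
          Finset.sum_le_sum fun q _ => integral_indicator_near_le hβ hε (zs q.1).1 q.2
      _ = s * (m + 1) * (2 * ε) ^ Fintype.card d *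
            canonicalPartition (Torus.geometry d) ε m (fun p : 𝕋 × 𝔼 => maxwellianBeta β p.2) := by
          rw [Finset.sum_const, Finset.card_univ, Fintype.card_prod, Fintype.card_fin, Fintype.card_fin]
          simp only [nsmul_eq_mul, Nat.cast_mul, Nat.cast_add, Nat.cast_one]
          ring
  calc Ts * (canonicalPartition (Torus.geometry d) ε (m + 1) (fun p : 𝕋 × 𝔼 => maxwellianBeta β p.2) -
          s * (m + 1) * (2 * ε) ^ Fintype.card d *
            canonicalPartition (Torus.geometry d) ε m (fun p : 𝕋 × 𝔼 => maxwellianBeta β p.2))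
      ≤ Ts * (canonicalPartition (Torus.geometry d) ε (m + 1) (fun p : 𝕋 × 𝔼 => maxwellianBeta β p.2) -
          ∑ q, ∫ zm, (S q).indicator (Dm.indicator Tm) zm) :=
        mul_le_mul_of_nonneg_left (by linarith) hTs0
    _ = ∫ zm, Ts * (Dm.indicator Tm zm - ∑ q, (S q).indicator (Dm.indicator Tm) zm) := hint_eq.symm
    _ ≤ _ := by
        rw [marginal]
        exact integral_mono hLint hF hpt

end ExclusionLower

section ExclusionTwoSided

variable {ε β : ℝ} {s n N : ℕ}

omit [Fintype d] in
/-- The chord bound for the convex function `y ↦ (1 + y)^s` on `[0, 1]`: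
`(1 + y)^s ≤ 1 + (2^s - 1) y`. [folklore] -/
theorem one_add_pow_le_one_add_mul {y : ℝ} (hy0 : 0 ≤ y) (hy1 : y ≤ 1) (s : ℕ) :
    (1 + y) ^ s ≤ 1 + (2 ^ s - 1) * y := by
  induction s with
  | zero => simp
  | succ k ih =>
    have h2k : (1 : ℝ) ≤ 2 ^ k := one_le_pow₀ (by norm_num)
    calc (1 + y) ^ (k + 1) = (1 + y) * (1 + y) ^ k := by ring
      _ ≤ (1 + y) * (1 + (2 ^ k - 1) * y) := mul_le_mul_of_nonneg_left ih (by linarith)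
      _ = 1 + (2 ^ k - 1) * y + y + (2 ^ k - 1) * (y * y) := by ring
      _ ≤ 1 + (2 ^ k - 1) * y + y + (2 ^ k - 1) * y := by
          have : y * y ≤ y := by nlinarith
          nlinarith
      _ = 1 + (2 ^ (k + 1) - 1) * y := by ring

/-- The integrand of `nthMarginal n s` of the Gibbs density, after the index cast, is the Gibbs
weight of `s + k` spheres normalised by `𝒵_n`. [folklore] -/
theorem marginal_canonicalDensity_comp_cast (β ε : ℝ) {k : ℕ} (e : s + k = n) (zs : Config s d 𝕋) :
    marginal s k (fun z : Config (s + k) d 𝕋 => canonicalDensity (Torus.geometry d) ε n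
      (fun p : 𝕋 × 𝔼 => maxwellianBeta β p.2) fun i => z (Fin.cast e.symm i)) zs =
      (canonicalPartition (Torus.geometry d) ε n fun p : 𝕋 × 𝔼 => maxwellianBeta β p.2)⁻¹ *
        marginal s k ((hardSphereDomain (Torus.geometry d) (s + k) ε).indicator
          (tensorPow (s + k) fun p : 𝕋 × 𝔼 => maxwellianBeta β p.2)) zs := by
  rw [marginal, marginal, ← integral_const_mul]
  congr 1
  funext zm
  rw [canonicalDensity_comp_cast β ε e, canonicalDensity]
  congr 2
  rw [e]

/-- `M^{(s)}_{n,β} = 𝒵_n⁻¹ ∫ 1_{D^n} M^{⊗n}(Z_s, Z') dZ'` with the background of size `k = n - s`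
made explicit. [folklore] -/
theorem nthMarginal_canonicalDensity_eq {k : ℕ} (e : s + k = n) (zs : Config s d 𝕋) :
    nthMarginal n s (canonicalDensity (Torus.geometry d) ε n fun p : 𝕋 × 𝔼 => maxwellianBeta β p.2) zs =
      (canonicalPartition (Torus.geometry d) ε n fun p : 𝕋 × 𝔼 => maxwellianBeta β p.2)⁻¹ *
        marginal s k ((hardSphereDomain (Torus.geometry d) (s + k) ε).indicator
          (tensorPow (s + k) fun p : 𝕋 × 𝔼 => maxwellianBeta β p.2)) zs := by
  have hs : s ≤ n := by omega
  have hk : n - s = k := by omega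
  rw [nthMarginal, dif_pos hs, marginal_canonicalDensity_comp_cast β ε (Nat.add_sub_of_le hs) zs, hk]

/-- The Gibbs marginals are nonnegative. [folklore] -/
theorem nthMarginal_canonicalDensity_nonneg (hβ : 0 < β) (zs : Config s d 𝕋) :
    0 ≤ nthMarginal n s (canonicalDensity (Torus.geometry d) ε n fun p : 𝕋 × 𝔼 => maxwellianBeta β p.2) zs := by
  rw [nthMarginal]
  split_ifs with h
  · exact integral_nonneg fun zm => canonicalDensity_maxwellianBeta_nonneg hβ _
  · exact le_rfl

/-- Over an empty set of background particles the marginal is evaluation. [folklore] -/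
theorem marginal_zero_right (W : Config (s + 0) d 𝕋 → ℝ) (zs : Config s d 𝕋) :
    marginal s 0 W zs = W (Fin.append zs (fun i => Fin.elim0 i)) := by
  rw [marginal, Measure.volume_pi_eq_dirac (fun i => Fin.elim0 i)]
  rw [integral_dirac]

/-- **BGSR Proposition 3.2, upper half, relative form**: if `(n - 1)(2ε)^d ≤ 1/2` then
`M^{(s)}_{n,β} ≤ (1 + 2^{s+1} (n-1)(2ε)^d) M_β^{⊗s}` for every `s ≤ n` (from (A.1):
`𝒵_n⁻¹ 𝒵_{n-s} ≤ (1 - (n-1)(2ε)^d)^{-s} ≤ (1 + 2(n-1)(2ε)^d)^s`, and the chord bound).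
[cite: BodineauGallagherSaintRaymondInvent2016, Prop. 3.2 with (A.1)] -/
theorem nthMarginal_canonicalDensity_le_one_add (hβ : 0 < β) (hε : 0 ≤ ε) (hs : s ≤ n)
    (hn : ((n - 1 : ℕ) : ℝ) * (2 * ε) ^ Fintype.card d ≤ 2⁻¹) (zs : Config s d 𝕋) :
    nthMarginal n s (canonicalDensity (Torus.geometry d) ε n fun p : 𝕋 × 𝔼 => maxwellianBeta β p.2) zs ≤
      (1 + 2 ^ (s + 1) * (((n - 1 : ℕ) : ℝ) * (2 * ε) ^ Fintype.card d)) *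
        tensorPow s (fun p : 𝕋 × 𝔼 => maxwellianBeta β p.2) zs := by
  set x : ℝ := ((n - 1 : ℕ) : ℝ) * (2 * ε) ^ Fintype.card d with hx
  have hx0 : 0 ≤ x := by positivity
  have hT0 : 0 ≤ tensorPow s (fun p : 𝕋 × 𝔼 => maxwellianBeta β p.2) zs :=
    tensorPow_nonneg (fun p => (maxwellianBeta_pos hβ p.2).le) s zs
  refine (nthMarginal_canonicalDensity_le hβ hs zs).trans (mul_le_mul_of_nonneg_right ?_ hT0)
  set Zn := canonicalPartition (Torus.geometry d) ε n fun p : 𝕋 × 𝔼 => maxwellianBeta β p.2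
  set Zm := canonicalPartition (Torus.geometry d) ε (n - s) fun p : 𝕋 × 𝔼 => maxwellianBeta β p.2
  have hZm0 : 0 ≤ Zm := canonicalPartition_maxwellianBeta_nonneg hβ
  have hchain : (1 - x) ^ s * Zm ≤ Zn := by
    have h := canonicalPartition_add_ge (d := d) hβ hε (n := n - 1) (by linarith) (n - s) s (by omega)
    rwa [Nat.sub_add_cancel hs] at h
  -- `(1 - x)(1 + 2x) ≥ 1`
  have hkey : 1 ≤ (1 - x) * (1 + 2 * x) := by nlinarith
  have hbound : Zm ≤ (1 + 2 * x) ^ s * Zn :=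
    calc Zm = Zm * 1 := (mul_one _).symm
      _ ≤ Zm * ((1 - x) * (1 + 2 * x)) ^ s := mul_le_mul_of_nonneg_left (one_le_pow₀ hkey) hZm0
      _ = (1 + 2 * x) ^ s * ((1 - x) ^ s * Zm) := by rw [mul_pow]; ring
      _ ≤ (1 + 2 * x) ^ s * Zn := mul_le_mul_of_nonneg_left hchain (by positivity)
  have hchord : (1 + 2 * x) ^ s ≤ 1 + 2 ^ (s + 1) * x := by
    refine (one_add_pow_le_one_add_mul (by positivity) (by linarith) s).trans ?_
    have : (2 ^ s - 1) * (2 * x) ≤ 2 ^ (s + 1) * x := by rw [pow_succ]; nlinarith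
    linarith
  by_cases hZ : Zn = 0
  · rw [hZ, inv_zero, zero_mul]; positivity
  · have hZpos : 0 < Zn := lt_of_le_of_ne (canonicalPartition_maxwellianBeta_nonneg hβ) (Ne.symm hZ)
    rw [inv_mul_le_iff₀ hZpos]
    calc Zm ≤ (1 + 2 * x) ^ s * Zn := hbound
      _ ≤ (1 + 2 ^ (s + 1) * x) * Zn := mul_le_mul_of_nonneg_right hchord hZpos.le
      _ = Zn * (1 + 2 ^ (s + 1) * x) := mul_comm _ _

/-- **BGSR Proposition 3.2, lower half**: if `(n - 1)(2ε)^d ≤ 1/2` then on the hard-sphere domain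
`M^{(s)}_{n,β}(Z_s) ≥ (1 - 2 s n (2ε)^d) M_β^{⊗s}(V_s)` for every `s ≤ n` and `Z_s ∈ D_ε^s`
(Appendix A, second step, with `𝒵^♭ ≤ s (n-s) (2ε)^d 𝒵_{n-s-1} ≤ 2 s (n-s)(2ε)^d 𝒵_{n-s}` and
`𝒵_{n-s} ≥ 𝒵_n`). [cite: BodineauGallagherSaintRaymondInvent2016, Prop. 3.2 / Appendix A] -/
theorem nthMarginal_canonicalDensity_ge (hβ : 0 < β) (hε : 0 ≤ ε) (hs : s ≤ n)
    (hn : ((n - 1 : ℕ) : ℝ) * (2 * ε) ^ Fintype.card d ≤ 2⁻¹) {zs : Config s d 𝕋}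
    (hzs : zs ∈ hardSphereDomain (Torus.geometry d) s ε) :
    (1 - 2 * s * n * (2 * ε) ^ Fintype.card d) * tensorPow s (fun p : 𝕋 × 𝔼 => maxwellianBeta β p.2) zs ≤
      nthMarginal n s (canonicalDensity (Torus.geometry d) ε n fun p : 𝕋 × 𝔼 => maxwellianBeta β p.2) zs := by
  set y : ℝ := (2 * ε) ^ Fintype.card d with hy
  have hy0 : 0 ≤ y := by positivity
  have hT0 : 0 ≤ tensorPow s (fun p : 𝕋 × 𝔼 => maxwellianBeta β p.2) zs :=
    tensorPow_nonneg (fun p => (maxwellianBeta_pos hβ p.2).le) s zs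
  have hnn := nthMarginal_canonicalDensity_nonneg (n := n) (ε := ε) hβ zs
  -- positivity of `𝒵_k`, `k ≤ n`
  have hZpos : ∀ k ≤ n, 0 < canonicalPartition (Torus.geometry d) ε k (fun p : 𝕋 × 𝔼 => maxwellianBeta β p.2) := by
    intro k hk
    exact canonicalPartition_pos_of_lt hβ hε (N := n - 1) (by linarith) k (by omega)
  obtain ⟨k, hk⟩ : ∃ k, n - s = k := ⟨n - s, rfl⟩
  have e : s + k = n := by omega
  rw [nthMarginal_canonicalDensity_eq e zs] at hnn ⊢
  cases k with
  | zero =>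
    -- `s = n`: the marginal is `𝒵_n⁻¹ 1_D M^{⊗n}(Z_s) = 𝒵_n⁻¹ M^{⊗n}(Z_s) ≥ M^{⊗n}(Z_s)`
    have hsn : s = n := by omega
    rw [marginal_zero_right]
    have happ : (Fin.append zs (fun i => Fin.elim0 i) : Config (s + 0) d 𝕋) = fun i => zs (Fin.cast (Nat.add_zero s) i) := by
      funext i
      rw [Fin.append_right_nil _ _ rfl]
      rfl
    rw [happ, indicator_tensorPow_comp_cast β ε (Nat.add_zero s).symm, indicator_of_mem hzs]
    have hZ1 : 1 ≤ (canonicalPartition (Torus.geometry d) ε n fun p : 𝕋 × 𝔼 => maxwellianBeta β p.2)⁻¹ :=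
      one_le_inv₀ (hZpos n le_rfl) |>.2 (canonicalPartition_le_one hβ n)
    calc (1 - 2 * s * n * y) * tensorPow s (fun p : 𝕋 × 𝔼 => maxwellianBeta β p.2) zs
        ≤ 1 * tensorPow s (fun p : 𝕋 × 𝔼 => maxwellianBeta β p.2) zs :=
          mul_le_mul_of_nonneg_right (by nlinarith [mul_nonneg (mul_nonneg (Nat.cast_nonneg s) (Nat.cast_nonneg n)) hy0]) hT0
      _ ≤ _ := by rw [one_mul]; exact le_mul_of_one_le_left hT0 hZ1
  | succ m =>
    have hlow := marginal_indicator_tensorPow_ge (d := d) (ε := ε) hβ hε hzs m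
    set Zn := canonicalPartition (Torus.geometry d) ε n fun p : 𝕋 × 𝔼 => maxwellianBeta β p.2 with hZn
    set Zm1 := canonicalPartition (Torus.geometry d) ε (m + 1) fun p : 𝕋 × 𝔼 => maxwellianBeta β p.2 with hZm1
    set Zm := canonicalPartition (Torus.geometry d) ε m fun p : 𝕋 × 𝔼 => maxwellianBeta β p.2 with hZm
    have hZn0 : 0 < Zn := hZpos n le_rfl
    have hZm1n : Zn ≤ Zm1 := canonicalPartition_antitone hβ (by omega)
    -- `𝒵_m ≤ 2 𝒵_{m+1}`
    have hZm_le : Zm ≤ 2 * Zm1 := by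
      have h := canonicalPartition_succ_ge (d := d) hβ hε m (β := β)
      have hmx : (m : ℝ) * y ≤ 2⁻¹ := by
        refine le_trans (mul_le_mul_of_nonneg_right ?_ hy0) hn
        exact_mod_cast (show m ≤ n - 1 by omega)
      have hZm0 : 0 ≤ Zm := canonicalPartition_maxwellianBeta_nonneg hβ
      nlinarith
    set c : ℝ := 1 - 2 * s * (m + 1) * y with hc
    have hparen : Zm1 * c ≤ Zm1 - s * (m + 1) * y * Zm := by
      rw [hc]
      have : (s : ℝ) * (m + 1) * y * Zm ≤ (s : ℝ) * (m + 1) * y * (2 * Zm1) :=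
        mul_le_mul_of_nonneg_left hZm_le (by positivity)
      nlinarith
    have hcn : 1 - 2 * (s : ℝ) * n * y ≤ c := by
      rw [hc]
      have : ((m : ℝ) + 1) ≤ n := by exact_mod_cast (show m + 1 ≤ n by omega)
      nlinarith [mul_nonneg (Nat.cast_nonneg s) hy0]
    by_cases hcpos : c ≤ 0
    · calc (1 - 2 * s * n * y) * tensorPow s (fun p : 𝕋 × 𝔼 => maxwellianBeta β p.2) zs ≤ 0 :=
            mul_nonpos_of_nonpos_of_nonneg (hcn.trans hcpos) hT0
        _ ≤ _ := hnn
    · push Not at hcpos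
      calc (1 - 2 * s * n * y) * tensorPow s (fun p : 𝕋 × 𝔼 => maxwellianBeta β p.2) zs
          ≤ c * tensorPow s (fun p : 𝕋 × 𝔼 => maxwellianBeta β p.2) zs := mul_le_mul_of_nonneg_right hcn hT0
        _ ≤ (Zn⁻¹ * Zm1) * (c * tensorPow s (fun p : 𝕋 × 𝔼 => maxwellianBeta β p.2) zs) := by
            refine le_mul_of_one_le_left (mul_nonneg hcpos.le hT0) ?_
            rw [le_inv_mul_iff₀ hZn0, mul_one]
            exact hZm1n
        _ = Zn⁻¹ * (tensorPow s (fun p : 𝕋 × 𝔼 => maxwellianBeta β p.2) zs * (Zm1 * c)) := by ring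
        _ ≤ Zn⁻¹ * (tensorPow s (fun p : 𝕋 × 𝔼 => maxwellianBeta β p.2) zs *
              (Zm1 - s * (m + 1) * y * Zm)) :=
            mul_le_mul_of_nonneg_left (mul_le_mul_of_nonneg_left hparen hT0) (inv_nonneg.2 hZn0.le)
        _ ≤ _ := by
            refine mul_le_mul_of_nonneg_left ?_ (inv_nonneg.2 hZn0.le)
            simpa [hy] using hlow

/-- **BGSR Proposition 3.2 (two-sided, explicit constants)**: in the regime `(n-1)(2ε)^d ≤ 1/2`,
`|M^{(s)}_{n,β} - M_β^{⊗s}| 1_{D_ε^s} ≤ (s + 1) 2^{s+1} n (2ε)^d M_β^{⊗s}` (printed: "`≤ C^s εα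
M_β^{⊗s}` as `N → ∞` in the scaling `N ε^{d-1} ≡ α ≪ 1/ε`"; here `n (2ε)^d = 2^d α ε` in that
scaling). [cite: BodineauGallagherSaintRaymondInvent2016, Prop. 3.2] -/
theorem abs_nthMarginal_canonicalDensity_sub_le (hβ : 0 < β) (hε : 0 ≤ ε) (hs : s ≤ n)
    (hn : ((n - 1 : ℕ) : ℝ) * (2 * ε) ^ Fintype.card d ≤ 2⁻¹) {zs : Config s d 𝕋}
    (hzs : zs ∈ hardSphereDomain (Torus.geometry d) s ε) :
    |nthMarginal n s (canonicalDensity (Torus.geometry d) ε n fun p : 𝕋 × 𝔼 => maxwellianBeta β p.2) zs -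
        tensorPow s (fun p : 𝕋 × 𝔼 => maxwellianBeta β p.2) zs| ≤
      ((s + 1) * 2 ^ (s + 1) * n * (2 * ε) ^ Fintype.card d) *
        tensorPow s (fun p : 𝕋 × 𝔼 => maxwellianBeta β p.2) zs := by
  set y : ℝ := (2 * ε) ^ Fintype.card d with hy
  have hy0 : 0 ≤ y := by positivity
  have hT0 : 0 ≤ tensorPow s (fun p : 𝕋 × 𝔼 => maxwellianBeta β p.2) zs :=
    tensorPow_nonneg (fun p => (maxwellianBeta_pos hβ p.2).le) s zs
  have hup := nthMarginal_canonicalDensity_le_one_add hβ hε hs hn zs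
  have hlo := nthMarginal_canonicalDensity_ge hβ hε hs hn hzs
  have hn1 : ((n - 1 : ℕ) : ℝ) ≤ n := by exact_mod_cast Nat.sub_le n 1
  have h2s : (1 : ℝ) ≤ 2 ^ s := one_le_pow₀ (by norm_num)
  rw [abs_le]
  constructor
  · -- lower
    have : 2 * (s : ℝ) * n * y ≤ (s + 1) * 2 ^ (s + 1) * n * y := by
      rw [pow_succ]
      have : 2 * (s : ℝ) ≤ (s + 1) * (2 ^ s * 2) := by nlinarith
      exact mul_le_mul_of_nonneg_right (mul_le_mul_of_nonneg_right this (Nat.cast_nonneg n)) hy0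
    nlinarith
  · -- upper
    have : 2 ^ (s + 1) * (((n - 1 : ℕ) : ℝ) * y) ≤ (s + 1) * 2 ^ (s + 1) * n * y := by
      have h1 : 2 ^ (s + 1) * (((n - 1 : ℕ) : ℝ) * y) ≤ 2 ^ (s + 1) * (n * y) :=
        mul_le_mul_of_nonneg_left (mul_le_mul_of_nonneg_right hn1 hy0) (by positivity)
      have h2 : 2 ^ (s + 1) * ((n : ℝ) * y) ≤ (s + 1) * 2 ^ (s + 1) * n * y := by
        have : (1 : ℝ) ≤ s + 1 := by linarith [Nat.cast_nonneg (α := ℝ) s]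
        nlinarith [mul_nonneg (mul_nonneg (by positivity : (0 : ℝ) ≤ 2 ^ (s + 1)) (Nat.cast_nonneg n)) hy0]
      linarith
    nlinarith

end ExclusionTwoSided

section InitialFactorisation

variable {ε β : ℝ} {s N : ℕ} {ρ₀ : UnitAddTorus d → ℝ} {R : ℝ}

omit [Fintype d] in
/-- Under the index cast of `nthMarginal`, the tagged coordinate `0` of the juxtaposed configuration is
the tagged coordinate of `Z_{s+1}`. [folklore] -/
theorem append_cast_zero [Fintype d] {m n : ℕ} (e : n + 1 = (s + 1) + m) (zs : Config (s + 1) d 𝕋)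
    (zm : Config m d 𝕋) : Fin.append zs zm (Fin.cast e (0 : Fin (n + 1))) = zs 0 := by
  rw [show Fin.cast e (0 : Fin (n + 1)) = Fin.castAdd m (0 : Fin (s + 1)) from Fin.ext (by simp),
    Fin.append_left]

/-- **BGSR Proposition 3.3, exact part**: the marginals of the datum (2.8) factorise as
`f_N^{0(s)}(Z_s) = ρ⁰(x₁) M^{(s)}_{N,β}(Z_s)` (printed display in Prop. 3.3), here for the
`s + 1` particles `0, …, s` containing the tagged one.
[cite: BodineauGallagherSaintRaymondInvent2016, Prop. 3.3] -/
theorem nthMarginal_bgsrInitialDensity_eq (hs : s + 1 ≤ N + 1) (zs : Config (s + 1) d 𝕋) :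
    nthMarginal (N + 1) (s + 1) (bgsrInitialDensity ε N β ρ₀) zs =
      ρ₀ (zs 0).1 * nthMarginal (N + 1) (s + 1) (canonicalDensity (Torus.geometry d) ε (N + 1)
        fun p : 𝕋 × 𝔼 => maxwellianBeta β p.2) zs := by
  rw [nthMarginal, dif_pos hs, nthMarginal, dif_pos hs, marginal, marginal, ← integral_const_mul]
  congr 1
  funext zm
  simp only [bgsrInitialDensity]
  rw [append_cast_zero (Nat.add_sub_of_le hs).symm zs zm, mul_comm]

/-- **BGSR Proposition 3.3 (two-sided, explicit constants)**: in the regime `N (2ε)^d ≤ 1/2`, on the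
hard-sphere domain, `|f_N^{0(s+1)}(Z) - ρ⁰(x₀) M_β^{⊗(s+1)}(V)| ≤ ‖ρ⁰‖_∞ (s+2) 2^{s+2} (N+1) (2ε)^d
M_β^{⊗(s+1)}(V)` (printed: "`|(f_N^{0(s)} - g^{0(s)}) 1_{D^s}| ≤ C^s εα M_β^{⊗s} ‖ρ⁰‖_{L^∞}` as
`N → ∞` in the scaling `N ε^{d-1} = α ≪ 1/ε`", a direct corollary of Prop. 3.2).
[cite: BodineauGallagherSaintRaymondInvent2016, Prop. 3.3] -/
theorem abs_nthMarginal_bgsrInitialDensity_sub_le (hβ : 0 < β) (hε : 0 ≤ ε) (hρ₀0 : ∀ x, 0 ≤ ρ₀ x)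
    (hR : ∀ x, ρ₀ x ≤ R) (hs : s + 1 ≤ N + 1) (hN : (N : ℝ) * (2 * ε) ^ Fintype.card d ≤ 2⁻¹)
    {zs : Config (s + 1) d 𝕋} (hzs : zs ∈ hardSphereDomain (Torus.geometry d) (s + 1) ε) :
    |nthMarginal (N + 1) (s + 1) (bgsrInitialDensity ε N β ρ₀) zs -
        ρ₀ (zs 0).1 * tensorPow (s + 1) (fun p : 𝕋 × 𝔼 => maxwellianBeta β p.2) zs| ≤
      R * (((s + 1 : ℕ) + 1) * 2 ^ (s + 1 + 1) * ((N + 1 : ℕ) : ℝ) * (2 * ε) ^ Fintype.card d) *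
        tensorPow (s + 1) (fun p : 𝕋 × 𝔼 => maxwellianBeta β p.2) zs := by
  have hn : ((N + 1 - 1 : ℕ) : ℝ) * (2 * ε) ^ Fintype.card d ≤ 2⁻¹ := by simpa using hN
  have h32 := abs_nthMarginal_canonicalDensity_sub_le (d := d) (ε := ε) (β := β) hβ hε hs hn hzs
  have hT0 : 0 ≤ tensorPow (s + 1) (fun p : 𝕋 × 𝔼 => maxwellianBeta β p.2) zs :=
    tensorPow_nonneg (fun p => (maxwellianBeta_pos hβ p.2).le) (s + 1) zs
  rw [nthMarginal_bgsrInitialDensity_eq hs, ← mul_sub, abs_mul, abs_of_nonneg (hρ₀0 _), mul_assoc]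
  exact mul_le_mul (hR _) h32 (abs_nonneg _) ((hρ₀0 (zs 0).1).trans (hR _))

end InitialFactorisation

/-! ## The printed input that remains: BGSR Theorem 2.2 (statement predicate, asserted nowhere) -/

section Facts

/-- *Statement predicate (UpperCamelCase, not a vendored fact; asserted nowhere — for `α > 1`
it is the hypothesis of `bodineau_gallagher_saintRaymond_linear_alpha_of`):* **BGSR Theorem 2.2
at inverse mean free path `α`, sequence form without rate** (arXiv:1305.3397v2 Thm 2.2, p. 7,
with (2.9)). Printed: "Consider the initial distribution
`f_N^0` defined in (2.8). Then the distribution `f_N^{(1)}(t, x, v)` of the tagged particle is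
close to `M_β(v) φ_α(t, x, v)`, where `φ_α` is the solution of the linear Boltzmann equation (1.3)
with initial data `ρ⁰` and hard-sphere cross section. More precisely, for all `t > 0` and all
`α > 1`, in the limit `N → ∞`, `N ε^{d-1} α⁻¹ = 1`, one has
`‖f_N^{(1)}(t) - M_β φ_α(t)‖_{L^∞(T^d × ℝ^d)} ≤ C [tα / (log log N)^{(A-1)/A}]^{A²/(A-1)}` (2.9),
where `A ≥ 2` can be taken arbitrarily large, and `C` depends on `A, β, d` and `‖ρ⁰‖_{L^∞}`."
Rendered along an exact Boltzmann–Grad sequence `(N_k + 1) ε_k^{d-1} = α` of `N_k + 1` spheres of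
diameter `ε_k < 1/2` on `T^d` (`d ≥ 2`, `β > 0`), for the datum (2.8) with a continuous
probability density `ρ⁰` and any hard-sphere flows: there is a solution `φ = φ_α` of (1.3) in
the class `IsTaggedLinearBoltzmannSolution β α ρ⁰` of the sibling file `TaggedSphereDiffusion`
(where the paper's "the solution" lives; it does not depend on `k`) such that for every `t > 0`
and `δ > 0`, eventually in `k`, `|f_{N_k}^{(1)}(t) - M_β φ(t)| ≤ δ` a.e.
(`f^{(1)} = bgsrTaggedMarginal`; "in the limit `N → ∞`" is `∀ᶠ k`, and the rate (2.9) tends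
to `0`). The sibling fact `bgsr_linearBoltzmannApprox` is the uniform-in-`N` form with the rate,
stated for `t > 1`: for `t > 1` the present statement is its qualitative consequence along
sequences, while the range `t ∈ (0, 1]` comes from the printed statement ("for all `t > 0`").
This parametrised predicate is asserted nowhere: in the printed range, `∀ α > 1, BgsrTheorem22At α`
is the hypothesis of `bodineau_gallagher_saintRaymond_linear_alpha_of` (earlier revisions also
vendored it as a closed named fact `bgsr_theorem22 := ∀ α > 1, BgsrTheorem22At α`, merged back
into that proof obligation on 2026-08-15 — module docstring, "No named fact remains"); at
every `α` it is the hypothesis of the reduction `linearBoltzmannLimitAt_of`. The printed proof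
covers `t ∈ (0, 1]` through its `L^∞([0, t'] × T^d × ℝ^d)` bound at any `t' > 1` ((5.21),
Prop. 5.8, proof of Thm 2.2: arXiv pp. 25–30).
[cite: BodineauGallagherSaintRaymondInvent2016, Thm. 2.2 (2.9)] -/
def BgsrTheorem22At (α : ℝ) : Prop :=
  ∀ (_hd : 2 ≤ Fintype.card d) {β : ℝ} (_hβ : 0 < β) (N : ℕ → ℕ) (ε : ℕ → ℝ),
    Literature.Analysis.FluidPDE.IsBoltzmannGradSequenceExact d α (fun k => N k + 1) ε → (∀ k, ε k < 2⁻¹) →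
    ∀ ρ₀ : 𝕋 → ℝ, Continuous ρ₀ → (∀ x, 0 ≤ ρ₀ x) → ∫ x, ρ₀ x = 1 →
    ∀ Φ : ∀ k, Literature.Analysis.FluidPDE.HardSphereFlow (Torus.geometry d) (ε k) (N k + 1),
    ∃ φ : ℝ → 𝕋 → 𝔼 → ℝ, IsTaggedLinearBoltzmannSolution β α ρ₀ φ ∧
      ∀ t, 0 < t → ∀ δ, 0 < δ → ∀ᶠ k in atTop, ∀ᵐ z : 𝕋 × 𝔼,
        |bgsrTaggedMarginal (Φ k) β ρ₀ t z.1 z.2 - Literature.Analysis.FunctionSpaces.maxwellianBeta β z.2 * φ t z.1 z.2| ≤ δ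

end Facts

/-! ## Fact (c) at inverse mean free path `α`, and the corrected statement -/

section Statements

/-- *Statement predicate (UpperCamelCase, not a vendored fact):* fact (c)
`bodineau_gallagher_saintRaymond_linear` at a general inverse mean free path `α` — verbatim (c)
with the exact Boltzmann–Grad sequence `(N_k + 1) ε_k^{d-1} = α` and the collision kernel
`α • hardSphereKernel` (BGSR (1.3): `∂ₜ φ + v·∇ₓ φ = -α L φ`). For `α = 1` this is (c)
(`bodineau_gallagher_saintRaymond_linear_of_limitAt_one`); it is derived for every `α > 1`
(`bodineau_gallagher_saintRaymond_linear_alpha_of`) and asserted for no other value.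
[cite: BodineauGallagherSaintRaymondInvent2016, Thm. 2.2] -/
def LinearBoltzmannLimitAt (α : ℝ) : Prop :=
  ∀ (_hd : 2 ≤ Fintype.card d) {β : ℝ} (_hβ : 0 < β) (N : ℕ → ℕ) (ε : ℕ → ℝ)
    (_hNε : Literature.Analysis.FluidPDE.IsBoltzmannGradSequenceExact d α (fun k => N k + 1) ε)
    (_hε : ∀ k, ε k < 2⁻¹) (ρ₀ : 𝕋 → ℝ) (_hρ₀ : Continuous ρ₀)
    (_hρ₀0 : ∀ x, 0 ≤ ρ₀ x) (_hρ₀1 : ∫ x, ρ₀ x = 1)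
    (Φ : ∀ k, Literature.Analysis.FluidPDE.HardSphereFlow (Torus.geometry d) (ε k) (N k + 1)),
    ∃ g : ℝ → 𝕋 → 𝔼 → ℝ, (g 0 = fun x v => ρ₀ x * Literature.Analysis.FunctionSpaces.maxwellianBeta β v) ∧
      (∀ T, 0 ≤ T → Literature.Analysis.FunctionSpaces.IsMildLinearBoltzmannSolutionOn T (Torus.geometry d)
        (α • hardSphereKernel) (Literature.Analysis.FunctionSpaces.maxwellianBeta β) g) ∧
      ∀ t, 0 ≤ t → ∀ φ : 𝕋 × 𝔼 → ℝ, Continuous φ → (∃ C, ∀ z, |φ z| ≤ C) →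
        Tendsto
          (fun k => ∫ z, φ z ∂Literature.Analysis.FunctionSpaces.taggedLaw (Φ k)
            (Literature.Analysis.FunctionSpaces.equilibriumTaggedDensity (Torus.geometry d) (ε k) (N k) β
              (fun z => ρ₀ z.1)) t)
          atTop (𝓝 (∫ x, ∫ v, φ (x, v) * g t x v))

/-- Fact (c) is its `α = 1` instance (`(1 : ℝ) • hardSphereKernel = hardSphereKernel`). [folklore] -/
theorem bodineau_gallagher_saintRaymond_linear_of_limitAt_one
    (h : LinearBoltzmannLimitAt (d := d) 1) :
    bodineau_gallagher_saintRaymond_linear (d := d) := by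
  intro hd β hβ N ε hNε hε ρ₀ hρ₀ hρ₀0 hρ₀1 Φ
  obtain ⟨g, h0, hmild, hconv⟩ := h hd hβ N ε hNε hε ρ₀ hρ₀ hρ₀0 hρ₀1 Φ
  exact ⟨g, h0, fun T hT => by simpa using hmild T hT, hconv⟩

end Statements

/-! ## Assembly -/

section Assembly

omit [Fintype d] in
/-- A continuous function on the (compact) torus is bounded above. [folklore] -/
theorem exists_upper_bound_of_continuous {ρ₀ : 𝕋 → ℝ} (hρ₀ : Continuous ρ₀) :
    ∃ R : ℝ, ∀ x, ρ₀ x ≤ R := by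
  obtain ⟨R, hR⟩ := (isCompact_range hρ₀).bddAbove
  exact ⟨R, fun x => hR ⟨x, rfl⟩⟩

/-- For `t ≥ 0`, `(x, v) ↦ M_β(v) φ(t, x, v)` is continuous for `φ` in the solution class. [folklore] -/
theorem IsTaggedLinearBoltzmannSolution.continuous_maxwellian_mul {β α : ℝ} {ρ₀ : 𝕋 → ℝ}
    {φ : ℝ → 𝕋 → 𝔼 → ℝ} (hφ : IsTaggedLinearBoltzmannSolution β α ρ₀ φ) {t : ℝ} (ht : 0 ≤ t) :
    Continuous fun z : 𝕋 × 𝔼 => Literature.Analysis.FunctionSpaces.maxwellianBeta β z.2 * φ t z.1 z.2 := by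
  have h1 : Continuous fun z : 𝕋 × 𝔼 => φ t z.1 z.2 :=
    (hφ.continuousOn t ht).comp_continuous (continuous_const.prodMk continuous_id)
      fun z => ⟨⟨ht, le_rfl⟩, Set.mem_univ _⟩
  exact ((continuous_maxwellianBeta β).comp continuous_snd).mul h1

/-- **The linear Boltzmann limit of the tagged sphere from Theorem 2.2.** At any inverse mean
free path `α`, the sequence form of BGSR Thm 2.2 implies the weak convergence statement (c) at
`α`: the limit is `g = M_β φ_α`; the identification of the tagged law with `f_N^{(1)} dx dv`, the
eventual positivity of the partition function (Appendix A), the maximum-principle bound of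
Prop. 4.1 and the exact initial factorisation of Prop. 3.3 (both for `s = 1`), and dominated
convergence are all proved above. [cite: BodineauGallagherSaintRaymondInvent2016, Thm. 2.2] -/
theorem linearBoltzmannLimitAt_of {α : ℝ} (h22 : BgsrTheorem22At (d := d) α) :
    LinearBoltzmannLimitAt (d := d) α := by
  intro hd β hβ N ε hNε hε ρ₀ hρ₀ hρ₀0 hρ₀1 Φ
  obtain ⟨R, hR⟩ := exists_upper_bound_of_continuous hρ₀
  obtain ⟨φs, hφs, hconv⟩ := h22 hd hβ N ε hNε hε ρ₀ hρ₀ hρ₀0 hρ₀1 Φ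
  refine ⟨fun t x v => Literature.Analysis.FunctionSpaces.maxwellianBeta β v * φs t x v, ?_, hφs.mild, ?_⟩
  · funext x v
    simp only [hφs.init, mul_comm]
  · intro t ht φ hφ hφb
    have h_eq : ∀ k, ∫ z, φ z ∂Literature.Analysis.FunctionSpaces.taggedLaw (Φ k)
        (Literature.Analysis.FunctionSpaces.equilibriumTaggedDensity (Torus.geometry d) (ε k) (N k) β fun z => ρ₀ z.1) t =
        ∫ z : 𝕋 × 𝔼, bgsrTaggedMarginal (Φ k) β ρ₀ t z.1 z.2 * φ z := fun k =>
      integral_taggedLaw_eq_integral_bgsrTaggedMarginal hβ hρ₀.measurable hρ₀0 hR (Φ k) t φ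
    simp_rw [h_eq]
    obtain ⟨CT, hCT⟩ := hφs.bounded t ht
    refine tendsto_integral_mul_of_maxwellian_dominated hβ
      (fun k z => bgsrTaggedMarginal (Φ k) β ρ₀ t z.1 z.2)
      (fun z => Literature.Analysis.FunctionSpaces.maxwellianBeta β z.2 * φs t z.1 z.2)
      (fun k => measurable_bgsrTaggedMarginal hρ₀.measurable (Φ k) β t)
      (hφs.continuous_maxwellian_mul ht) (R := CT) (fun z => ?_) (C := R)
      (Eventually.of_forall fun k z => ?_) (fun δ hδ => ?_) φ hφ hφb
    · rw [abs_mul, abs_of_pos (Literature.Analysis.FunctionSpaces.maxwellianBeta_pos hβ _), mul_comm]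
      exact mul_le_mul_of_nonneg_right (hCT t ⟨ht, le_rfl⟩ z.1 z.2)
        (Literature.Analysis.FunctionSpaces.maxwellianBeta_pos hβ _).le
    · rw [abs_of_nonneg (bgsrTaggedMarginal_nonneg hβ hρ₀0 (Φ k) t z.1 z.2)]
      exact bgsrTaggedMarginal_le hβ hρ₀0 hR (Φ k) t z.1 z.2
    · rcases ht.eq_or_lt with rfl | ht'
      · -- `t = 0`: Prop 3.3 (`s = 1`), exact as soon as `𝒵 > 0`
        filter_upwards [equilibriumTaggedPartition_eventually_pos hd hβ N ε hNε] with k hk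
        filter_upwards [bgsrTaggedMarginal_zero_ae_eq hβ hk.ne' (Φ k) ρ₀] with z hz
        rw [hz, hφs.init]
        simp only [mul_comm (ρ₀ z.1), sub_self, abs_zero]
        exact hδ.le
      · exact hconv t ht' δ hδ

/-- **hilbert6.S22 (c) corrected to the printed hypothesis of BGSR Theorem 2.2, reduced to the
printed theorem.** BGSR Theorem 2.2 in sequence form for all `α > 1` (the hypothesis that
earlier revisions named `bgsr_theorem22`) implies the weak convergence statement
`bodineau_gallagher_saintRaymond_linear` *at every `α > 1`* (`LinearBoltzmannLimitAt α`; the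
vendored (c) fixes `α = (N_k + 1) ε_k^{d-1} = 1`, the boundary value that Thm 2.2's hypothesis
"for all `α > 1`" excludes — module docstring, "Discrepancy"), every ingredient but the
hypothesis being proved in this file (`linearBoltzmannLimitAt_of`). *Merged form (reviews of
2026-08-15, D-0026; module docstring, "No named fact remains"):* the conclusion was earlier
recorded as the closed named fact `bodineau_gallagher_saintRaymond_linear_alpha` and the
hypothesis as the closed named fact `bgsr_theorem22`; both `def`s are deleted — BGSR Thm 2.2 is
vendored once, as `bgsr_linearBoltzmannApprox` (`TaggedSphereDiffusion`) — and their statements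
are, verbatim, the hypothesis and the conclusion of this theorem.
[cite: BodineauGallagherSaintRaymondInvent2016, Thm. 2.2] -/
theorem bodineau_gallagher_saintRaymond_linear_alpha_of
    (h22 : ∀ α : ℝ, 1 < α → BgsrTheorem22At (d := d) α) :
    ∀ α : ℝ, 1 < α → LinearBoltzmannLimitAt (d := d) α :=
  fun α hα => linearBoltzmannLimitAt_of (h22 α hα)

end Assembly

/-! ## Assembly from almost-everywhere pointwise convergence (the qualitative input)

Fact (c) is a *weak* convergence statement (against bounded continuous observables), so the
dominated-convergence assembly above only consumes the a.e.-uniform estimate of Theorem 2.2 through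
its consequence "`f_{N_k}^{(1)}(t, z) → M_β(v) φ_α(t, z)` for a.e. `z`". This section records that
weaker, qualitative input as a statement predicate (`BgsrAeConvergenceAt α`, asserted nowhere),
shows that it follows from `BgsrTheorem22At α`, and that it already implies
`LinearBoltzmannLimitAt α` — so that the bottom-up proof of "(c) for every `α > 1`"
(`∀ α > 1, LinearBoltzmannLimitAt α`) may aim at the a.e.-pointwise, Lanford–King-type
termwise convergence (Cercignani–Illner–Pulvirenti 1994 §4.4, "term by term convergence") inside
BGSR's pruned expansion, instead of the quantitative `L^∞` estimate (2.9). -/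

section AeAssembly

/-- **Dominated convergence on `T^d × ℝ^d` with a Maxwellian majorant, a.e.-pointwise form.** As
`tendsto_integral_mul_of_maxwellian_dominated`, with the a.e.-uniform hypothesis replaced by its
consequence `f_k z → g z` for a.e. `z` (which is all that dominated convergence uses). [folklore] -/
theorem tendsto_integral_mul_of_maxwellian_dominated_ae {β : ℝ} (hβ : 0 < β)
    (f : ℕ → 𝕋 × 𝔼 → ℝ) (g : 𝕋 × 𝔼 → ℝ) (hf : ∀ k, Measurable (f k))
    (hg : Continuous g) {R : ℝ} (hgR : ∀ z, |g z| ≤ R * Literature.Analysis.FunctionSpaces.maxwellianBeta β z.2)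
    {C : ℝ} (hdom : ∀ᶠ k in atTop, ∀ z, |f k z| ≤ C * Literature.Analysis.FunctionSpaces.maxwellianBeta β z.2)
    (hconv : ∀ᵐ z : 𝕋 × 𝔼, Tendsto (fun k => f k z) atTop (𝓝 (g z)))
    (φ : 𝕋 × 𝔼 → ℝ) (hφ : Continuous φ) (hφb : ∃ B, ∀ z, |φ z| ≤ B) :
    Tendsto (fun k => ∫ z, f k z * φ z) atTop (𝓝 (∫ x, ∫ v, φ (x, v) * g (x, v))) := by
  obtain ⟨B, hB⟩ := hφb
  set M : 𝔼 → ℝ := Literature.Analysis.FunctionSpaces.maxwellianBeta β with hM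
  have hMpos : ∀ v, 0 < M v := fun v => Literature.Analysis.FunctionSpaces.maxwellianBeta_pos hβ v
  have hMint : Integrable (fun z : 𝕋 × 𝔼 => M z.2) (volume : Measure (𝕋 × 𝔼)) :=
    (integrable_maxwellianBeta hβ).comp_snd volume
  set C' : ℝ := max C 0 with hC'
  have hC'0 : 0 ≤ C' := le_max_right _ _
  -- the limit value, by Fubini
  have hlim_int : Integrable (fun z : 𝕋 × 𝔼 => φ z * g z) (volume : Measure (𝕋 × 𝔼)) := by
    refine Integrable.mono' (hMint.const_mul (B * R))
      (hφ.aestronglyMeasurable.mul hg.aestronglyMeasurable) (Eventually.of_forall fun z => ?_)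
    rw [norm_mul, Real.norm_eq_abs, Real.norm_eq_abs]
    calc |φ z| * |g z| ≤ B * (R * M z.2) :=
          mul_le_mul (hB z) (hgR z) (abs_nonneg _) ((abs_nonneg _).trans (hB z))
      _ = B * R * M z.2 := by ring
  have h_val : ∫ x, ∫ v, φ (x, v) * g (x, v) = ∫ z, g z * φ z ∂(volume : Measure (𝕋 × 𝔼)) := by
    have h := integral_prod (μ := (volume : Measure 𝕋)) (ν := (volume : Measure 𝔼)) _ hlim_int
    rw [show (fun z : 𝕋 × 𝔼 => g z * φ z) = fun z => φ z * g z from funext fun z => mul_comm _ _]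
    exact h.symm
  rw [h_val]
  -- dominated convergence
  refine tendsto_integral_filter_of_dominated_convergence (fun z => C' * M z.2 * B) ?_ ?_ ?_ ?_
  · exact Eventually.of_forall fun k => ((hf k).aestronglyMeasurable).mul hφ.aestronglyMeasurable
  · filter_upwards [hdom] with k hk
    refine Eventually.of_forall fun z => ?_
    rw [norm_mul, Real.norm_eq_abs, Real.norm_eq_abs]
    have h1 : |f k z| ≤ C' * M z.2 :=
      (hk z).trans (mul_le_mul_of_nonneg_right (le_max_left _ _) (hMpos _).le)
    exact mul_le_mul h1 (hB z) (abs_nonneg _) (mul_nonneg hC'0 (hMpos _).le)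
  · exact (hMint.const_mul C').mul_const B
  · filter_upwards [hconv] with z hz
    exact hz.mul_const (φ z)

/-- *Statement predicate (UpperCamelCase, not a vendored fact; asserted nowhere):* the
**qualitative, almost-everywhere form of BGSR Theorem 2.2 at inverse mean free path `α`** along an
exact Boltzmann–Grad sequence `(N_k + 1) ε_k^{d-1} = α`, `ε_k < 1/2`, for the datum (2.8) with a
continuous probability density `ρ⁰` and any hard-sphere flows: there is a solution `φ = φ_α` of
(1.3) in the class `IsTaggedLinearBoltzmannSolution β α ρ⁰` such that for every `t > 0`,
`f_{N_k}^{(1)}(t, x, v) → M_β(v) φ(t, x, v)` for almost every `(x, v)` as `k → ∞`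
(`f^{(1)} = bgsrTaggedMarginal`). This is the consequence of the printed `L^∞` estimate (2.9)
(`bgsrAeConvergenceAt_of_theorem22At`) that the weak-convergence statement (c) actually consumes
(`linearBoltzmannLimitAt_of_ae`); it is also the form delivered by Lanford's term-by-term argument
(CIP 1994 §4.4) run inside BGSR's pruned expansion (§4.3). [cite: BodineauGallagherSaintRaymondInvent2016, Thm. 2.2] -/
def BgsrAeConvergenceAt (α : ℝ) : Prop :=
  ∀ (_hd : 2 ≤ Fintype.card d) {β : ℝ} (_hβ : 0 < β) (N : ℕ → ℕ) (ε : ℕ → ℝ),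
    Literature.Analysis.FluidPDE.IsBoltzmannGradSequenceExact d α (fun k => N k + 1) ε → (∀ k, ε k < 2⁻¹) →
    ∀ ρ₀ : 𝕋 → ℝ, Continuous ρ₀ → (∀ x, 0 ≤ ρ₀ x) → ∫ x, ρ₀ x = 1 →
    ∀ Φ : ∀ k, Literature.Analysis.FluidPDE.HardSphereFlow (Torus.geometry d) (ε k) (N k + 1),
    ∃ φ : ℝ → 𝕋 → 𝔼 → ℝ, IsTaggedLinearBoltzmannSolution β α ρ₀ φ ∧
      ∀ t, 0 < t → ∀ᵐ z : 𝕋 × 𝔼,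
        Tendsto (fun k => bgsrTaggedMarginal (Φ k) β ρ₀ t z.1 z.2) atTop
          (𝓝 (Literature.Analysis.FunctionSpaces.maxwellianBeta β z.2 * φ t z.1 z.2))

/-- The sequence form of Theorem 2.2 implies its a.e.-pointwise form (a.e.-uniform estimates for
every `δ > 0` give a.e. convergence, `ae_tendsto_of_forall_eventually_ae_le`). [folklore] -/
theorem bgsrAeConvergenceAt_of_theorem22At {α : ℝ} (h22 : BgsrTheorem22At (d := d) α) :
    BgsrAeConvergenceAt (d := d) α := by
  intro hd β hβ N ε hNε hε ρ₀ hρ₀ hρ₀0 hρ₀1 Φ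
  obtain ⟨φs, hφs, hconv⟩ := h22 hd hβ N ε hNε hε ρ₀ hρ₀ hρ₀0 hρ₀1 Φ
  exact ⟨φs, hφs, fun t ht => ae_tendsto_of_forall_eventually_ae_le (hconv t ht)⟩

/-- **The linear Boltzmann limit of the tagged sphere from a.e.-pointwise convergence.** At any
inverse mean free path `α`, the qualitative a.e. form `BgsrAeConvergenceAt α` already implies the
weak convergence statement (c) at `α`: as in `linearBoltzmannLimitAt_of`, the limit is
`g = M_β φ_α`, the tagged law is `f_N^{(1)} dx dv`, the majorant `‖ρ⁰‖_∞ M_β` is Prop. 4.1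
(`s = 1`), the case `t = 0` is Prop. 3.3 (`s = 1`, exact once `𝒵 > 0`, eventually by Appendix A),
and dominated convergence concludes. [cite: BodineauGallagherSaintRaymondInvent2016, Thm. 2.2] -/
theorem linearBoltzmannLimitAt_of_ae {α : ℝ} (h : BgsrAeConvergenceAt (d := d) α) :
    LinearBoltzmannLimitAt (d := d) α := by
  intro hd β hβ N ε hNε hε ρ₀ hρ₀ hρ₀0 hρ₀1 Φ
  obtain ⟨R, hR⟩ := exists_upper_bound_of_continuous hρ₀
  obtain ⟨φs, hφs, hconv⟩ := h hd hβ N ε hNε hε ρ₀ hρ₀ hρ₀0 hρ₀1 Φ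
  refine ⟨fun t x v => Literature.Analysis.FunctionSpaces.maxwellianBeta β v * φs t x v, ?_, hφs.mild, ?_⟩
  · funext x v
    simp only [hφs.init, mul_comm]
  · intro t ht φ hφ hφb
    have h_eq : ∀ k, ∫ z, φ z ∂Literature.Analysis.FunctionSpaces.taggedLaw (Φ k)
        (Literature.Analysis.FunctionSpaces.equilibriumTaggedDensity (Torus.geometry d) (ε k) (N k) β fun z => ρ₀ z.1) t =
        ∫ z : 𝕋 × 𝔼, bgsrTaggedMarginal (Φ k) β ρ₀ t z.1 z.2 * φ z := fun k =>
      integral_taggedLaw_eq_integral_bgsrTaggedMarginal hβ hρ₀.measurable hρ₀0 hR (Φ k) t φ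
    simp_rw [h_eq]
    obtain ⟨CT, hCT⟩ := hφs.bounded t ht
    refine tendsto_integral_mul_of_maxwellian_dominated_ae hβ
      (fun k z => bgsrTaggedMarginal (Φ k) β ρ₀ t z.1 z.2)
      (fun z => Literature.Analysis.FunctionSpaces.maxwellianBeta β z.2 * φs t z.1 z.2)
      (fun k => measurable_bgsrTaggedMarginal hρ₀.measurable (Φ k) β t)
      (hφs.continuous_maxwellian_mul ht) (R := CT) (fun z => ?_) (C := R)
      (Eventually.of_forall fun k z => ?_) ?_ φ hφ hφb
    · rw [abs_mul, abs_of_pos (Literature.Analysis.FunctionSpaces.maxwellianBeta_pos hβ _), mul_comm]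
      exact mul_le_mul_of_nonneg_right (hCT t ⟨ht, le_rfl⟩ z.1 z.2)
        (Literature.Analysis.FunctionSpaces.maxwellianBeta_pos hβ _).le
    · rw [abs_of_nonneg (bgsrTaggedMarginal_nonneg hβ hρ₀0 (Φ k) t z.1 z.2)]
      exact bgsrTaggedMarginal_le hβ hρ₀0 hR (Φ k) t z.1 z.2
    · rcases ht.eq_or_lt with rfl | ht'
      · -- `t = 0`: Prop 3.3 (`s = 1`), exact as soon as `𝒵 > 0`, hence a.e. convergence
        refine ae_tendsto_of_forall_eventually_ae_le fun δ hδ => ?_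
        filter_upwards [equilibriumTaggedPartition_eventually_pos hd hβ N ε hNε] with k hk
        filter_upwards [bgsrTaggedMarginal_zero_ae_eq hβ hk.ne' (Φ k) ρ₀] with z hz
        rw [hz, hφs.init]
        simp only [mul_comm (ρ₀ z.1), sub_self, abs_zero]
        exact hδ.le
      · exact hconv t ht'

/-- Consequently the corrected statement "(c) for every `α > 1`" follows from the a.e. form at
every `α > 1` (the target of the bottom-up plan: prove `BgsrAeConvergenceAt α`, `α > 1`).
[cite: BodineauGallagherSaintRaymondInvent2016, Thm. 2.2] -/
theorem bodineau_gallagher_saintRaymond_linear_alpha_of_ae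
    (h : ∀ α : ℝ, 1 < α → BgsrAeConvergenceAt (d := d) α) :
    ∀ α : ℝ, 1 < α → LinearBoltzmannLimitAt (d := d) α :=
  fun α hα => linearBoltzmannLimitAt_of_ae (h α hα)

end AeAssembly

end Hilbert6


/-! ## Corollaries: three named facts of `LorentzGas` on the equilibrium datum -/

section Kinetic

variable {d : Type*} [Fintype d]

attribute [local instance] KineticTheory.sigmaFinite_volume_phaseSpace

/-- `∫∫ M_β(v) dx dv = 1` on `T^d × ℝ^d` (unit volume of the torus, unit mass of `M_β`). [folklore] -/
theorem integral_maxwellianBeta_phaseSpace {β : ℝ} (hβ : 0 < β) :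
    ∫ y : UnitAddTorus d × EuclideanSpace ℝ d, Literature.Analysis.FunctionSpaces.maxwellianBeta β y.2 = 1 := by
  rw [Measure.volume_eq_prod, integral_fun_snd]
  simp [integral_maxwellianBeta hβ]

/-- Discharge of `Kinetic.equilibriumTaggedPartition_le_one` (BGSR after (1.4)/(2.7): drop the
indicator, `∫ M_β^{⊗(N+1)} = (∫∫ M_β)^{N+1} = 1`). [cite: BodineauGallagherSaintRaymondInvent2016, (2.7)] -/
theorem equilibriumTaggedPartition_le_one_holds : Literature.Analysis.FunctionSpaces.equilibriumTaggedPartition_le_one (d := d) := by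
  intro β hβ ε N
  rw [Literature.Analysis.FunctionSpaces.equilibriumTaggedPartition, Literature.Analysis.FluidPDE.canonicalPartition]
  have h0 : ∀ z : Literature.Analysis.FluidPDE.Config (N + 1) d (UnitAddTorus d),
      0 ≤ Literature.Analysis.FluidPDE.tensorPow (N + 1) (fun p : UnitAddTorus d × EuclideanSpace ℝ d => Literature.Analysis.FunctionSpaces.maxwellianBeta β p.2) z :=
    fun z => Literature.Analysis.FluidPDE.tensorPow_nonneg (fun p => (Literature.Analysis.FunctionSpaces.maxwellianBeta_pos hβ p.2).le) (N + 1) z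
  calc ∫ z, (Literature.Analysis.FluidPDE.hardSphereDomain (Literature.Analysis.FluidPDE.Torus.geometry d) (N + 1) ε).indicator
        (Literature.Analysis.FluidPDE.tensorPow (N + 1) fun p : UnitAddTorus d × EuclideanSpace ℝ d => Literature.Analysis.FunctionSpaces.maxwellianBeta β p.2) z
      ≤ ∫ z, Literature.Analysis.FluidPDE.tensorPow (N + 1) (fun p : UnitAddTorus d × EuclideanSpace ℝ d => Literature.Analysis.FunctionSpaces.maxwellianBeta β p.2) z :=
        integral_mono_of_nonneg (Eventually.of_forall fun z => Set.indicator_nonneg (fun w _ => h0 w) z)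
          (KineticTheory.integrable_tensorPow_maxwellianBeta hβ (N + 1))
          (Eventually.of_forall fun z => Set.indicator_le_self' (fun w _ => h0 w) z)
    _ = 1 := by
        change ∫ z : Fin (N + 1) → UnitAddTorus d × EuclideanSpace ℝ d,
          ∏ i, Literature.Analysis.FunctionSpaces.maxwellianBeta β (z i).2 = 1
        rw [integral_fintype_prod_volume_eq_pow (fun p : UnitAddTorus d × EuclideanSpace ℝ d =>
          Literature.Analysis.FunctionSpaces.maxwellianBeta β p.2), integral_maxwellianBeta_phaseSpace hβ, one_pow]

/-- Discharge of `Kinetic.equilibriumTaggedPartition_pos` (BGSR after (1.4): the Gibbs weight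
`1_{D_ε} M_β^{⊗(N+1)}` is positive on `D_ε`, so `𝒵 > 0` as soon as `D_ε` has positive measure).
[cite: BodineauGallagherSaintRaymondInvent2016, (2.7)] -/
theorem equilibriumTaggedPartition_pos_holds : Literature.Analysis.FunctionSpaces.equilibriumTaggedPartition_pos (d := d) := by
  intro β hβ ε N hD
  rw [Literature.Analysis.FunctionSpaces.equilibriumTaggedPartition, Literature.Analysis.FluidPDE.canonicalPartition]
  have hpos : ∀ z : Literature.Analysis.FluidPDE.Config (N + 1) d (UnitAddTorus d),
      0 < Literature.Analysis.FluidPDE.tensorPow (N + 1) (fun p : UnitAddTorus d × EuclideanSpace ℝ d => Literature.Analysis.FunctionSpaces.maxwellianBeta β p.2) z :=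
    fun z => Finset.prod_pos fun i _ => Literature.Analysis.FunctionSpaces.maxwellianBeta_pos hβ (z i).2
  rw [integral_pos_iff_support_of_nonneg
    (fun z => Set.indicator_nonneg (fun w _ => (hpos w).le) z)
    ((KineticTheory.integrable_tensorPow_maxwellianBeta hβ (N + 1)).indicator
      (KineticTheory.measurableSet_hardSphereDomain_torus (N + 1) ε))]
  have hsupp : Function.support
      (Literature.Analysis.FluidPDE.tensorPow (N + 1) fun p : UnitAddTorus d × EuclideanSpace ℝ d => Literature.Analysis.FunctionSpaces.maxwellianBeta β p.2) = univ :=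
    Function.support_eq_univ fun z => (hpos z).ne'
  rw [Set.support_indicator, hsupp, Set.inter_univ]
  exact pos_iff_ne_zero.2 hD

/-- Discharge of `Kinetic.lintegral_equilibriumTaggedDensity` (BGSR (1.5)/(2.8): the tilted Gibbs
density is a probability density for the Liouville measure, given the normalisation).
[cite: BodineauGallagherSaintRaymondInvent2016, (2.8)] -/
theorem lintegral_equilibriumTaggedDensity_holds : Literature.Analysis.FunctionSpaces.lintegral_equilibriumTaggedDensity (d := d) := by
  intro β hβ ε N h₀ hh₀ hnorm
  set f : Literature.Analysis.FluidPDE.Config (N + 1) d (UnitAddTorus d) → ℝ := fun z =>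
    Literature.Analysis.FluidPDE.canonicalDensity (Literature.Analysis.FluidPDE.Torus.geometry d) ε (N + 1) (fun p => Literature.Analysis.FunctionSpaces.maxwellianBeta β p.2) z * h₀ (z 0) with hf
  have hf0 : ∀ z, 0 ≤ f z := fun z => mul_nonneg (canonicalDensity_maxwellianBeta_nonneg hβ z) (hh₀ _)
  have hint : Integrable f := Integrable.of_integral_ne_zero (by rw [hnorm]; exact one_ne_zero)
  have hoff : ∀ z ∉ Literature.Analysis.FluidPDE.hardSphereDomain (Literature.Analysis.FluidPDE.Torus.geometry d) (N + 1) ε, f z = 0 := fun z hz => by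
    simp [hf, Literature.Analysis.FluidPDE.canonicalDensity, Set.indicator_of_notMem hz]
  change ∫⁻ z, ENNReal.ofReal (f z) ∂Literature.Analysis.FluidPDE.liouville (Literature.Analysis.FluidPDE.Torus.geometry d) (N + 1) ε = 1
  rw [Literature.Analysis.FluidPDE.liouville_eq, ← lintegral_indicator (KineticTheory.measurableSet_hardSphereDomain_torus (N + 1) ε)]
  have hind : (Literature.Analysis.FluidPDE.hardSphereDomain (Literature.Analysis.FluidPDE.Torus.geometry d) (N + 1) ε).indicator (fun z => ENNReal.ofReal (f z)) =
      fun z => ENNReal.ofReal (f z) := by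
    funext z
    by_cases hz : z ∈ Literature.Analysis.FluidPDE.hardSphereDomain (Literature.Analysis.FluidPDE.Torus.geometry d) (N + 1) ε
    · rw [Set.indicator_of_mem hz]
    · rw [Set.indicator_of_notMem hz, hoff z hz, ENNReal.ofReal_zero]
  rw [hind, ← ofReal_integral_eq_lintegral_ofReal hint (Eventually.of_forall hf0), hnorm,
    ENNReal.ofReal_one]

end Kinetic

end

end Literature.MathematicalPhysics.KineticTheory
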